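import Literature.Geometry.Symplectic.FoldFormsFourFolds
import Literature.Geometry.Symplectic.OrigamiNullFoliation
import Literature.Geometry.Kaehler.ManifoldFormsPullback
import Literature.Geometry.Kaehler.FubiniStudy
import Literature.Topology.FourManifolds.RegularLevelSet
import Literature.Topology.FourManifolds.ConnectedSum
import Mathlib.Geometry.Manifold.BumpFunction
import HarnessLib

/-!
# Fold-forms for four-folds (Cannas da Silva 2010) — proofs companion:
# pull-backs by fold maps are folded symplectic forms; the fold is an embedded 3-manifold

Companion of `FoldFormsFourFolds.lean`, which states the NAMED FACT
`Literature.Geometry.Symplectic.CannasDaSilva2010_foldedForm_of_orientable` (A. Cannas da Silva,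
*Fold-forms for four-folds*, J. Symplectic Geom. 8 (2010) 189–203 = arXiv:0909.4067
[`Cannasdasilva2010`], Thm 2: every orientable 4-manifold carries a folded symplectic form).

The printed proof (§§3–6) produces the folded form as a PULL-BACK: a closed 2-form `ω̃` of
maximal rank on `M × ℝ` (Gromov's h-principle, Lemma 2) is pulled back along a `Z`-immersion
`f : M → M × ℝ` relative to the kernel foliation (Eliashberg's h-principle, Lemma 5), and
(§1, p. 2 of the arXiv text) *"The pullback of a symplectic form by a `Z`-immersion is a folded
symplectic form with folding hypersurface `Z`"*; Lemma 4 (§5): *"Let `ω̃` be a closed 2-form of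
maximal rank in `N` whose kernel is the tangent space to the leaves of `𝓛`. If `f : M → N` is a
`Z`-immersion relative to `𝓛`, then `f^*ω̃` is a folded symplectic form on `M` with folding
hypersurface `Z`"*, proved by reduction to the local leaf spaces, which are symplectic
4-manifolds, where the statement is the equidimensional one formalised here.

This file proves that equidimensional statement for `2n = 4` in the tree's rendering of Def. 1
(`Literature.Geometry.Symplectic.IsFoldedForm`, hypersurface carried as data): for a `C^∞` map
`f : M → X` of 4-manifolds and a smooth closed non-degenerate 2-form `σ` on `X`, the pull-back
`f^*σ` (`MForm.pullback`, `Literature/NumberTheory/Transcendental/FormsAlgebra`) is a folded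
symplectic form with folding hypersurface `j : N ↪ M` as soon as `f` has FOLD SINGULARITIES
along `j`: the singular set `{x | ker df_x ≠ 0}` is `range j`, the Jacobian determinant of `f`
(in the preferred charts) vanishes transversally there, and `ker df ⊄ T(range j)` (no cusps).
These three conditions are what the local model `(x₁, …, x₄) ↦ (x₁², x₂, x₃, x₄)` of a
`Z`-immersion (§1) provides.

## Main statements

* `isFoldedForm_pullback` — the theorem just described
  (`IsFoldedForm (σ.pullback (𝓡 4) f) N j`);
* `mem_fold_pullback_of_mfderiv_apply_eq_zero`, `not_mem_fold_pullback` — the fold of `f^*σ`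
  is the singular set of `f`;
* `pfaffian_inChart_pullback_eventuallyEq` — in charts, `Pf(f^*σ) = det(Df) · (Pf σ ∘ f)`
  (`pfaffian_compContinuousLinearMap` read through `MForm.inChart_pullback_eventuallyEq`);
* `fderiv_pfaffian_inChart_pullback_ne_zero` — hence `(f^*σ)² = f^*(σ²)` vanishes
  transversally exactly where `det Df` does;
* `foldMap`, `hyperplaneIncl`, `isFoldedForm_pullback_foldMap` — THE MODEL (§1): the fold map
  `φ (x) = (x₀², x₁, x₂, x₃)` of `ℝ⁴` satisfies the three hypotheses along the hyperplane
  `{x₀ = 0}` (`det dφ = 2x₀`), so `φ^*σ` is a folded symplectic form for every smooth closed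
  non-degenerate `σ` on `ℝ⁴`;
* `exists_sliceChart_fold`, `exists_isFoldedForm_of_transverse`,
  `exists_isFoldedForm_of_transverse'` — FROM DEF. 1 TO `IsFoldedForm` (§2: "By tranversality,
  `Z` is a codimension-1 submanifold"): if the chart Pfaffian of a smooth closed `2`-form is
  transversal at every fold point and some kernel vector is transverse to the fold (maximal rank
  of `ı^*ω`), then the fold itself, with the slice-chart smooth structure of the tree's
  `Literature.Topology.FourManifolds.SliceChartFamily` (regular value theorem,
  `Literature.Topology.FourManifolds.exists_sliceChart`, applied to a bump-function
  globalisation of the chart Pfaffian), is a (compact, for compact `M`) `3`-manifold whose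
  inclusion is the folding hypersurface datum of `IsFoldedForm` — the conclusion of the named
  fact for that form;
* `IsFoldedForm.span_range_mfderiv_eq_ker`, `IsFoldedForm.exists_ker_fderiv_pfaffian_ne_zero`,
  `exists_isFoldedForm_iff` — CONVERSELY, for a folded form `T_z Z = ker d(Pf)` along the fold
  and some kernel vector is transverse, so `IsFoldedForm` (with some, equivalently with its own
  fold as, hypersurface datum) is EQUIVALENT to the chart-wise Def. 1;
* `opens_inChart_pullback_subtypeVal_eventuallyEq`, `isSmoothForm_of_opens_cover`, …,
  `maximalRank_of_opens_cover`, `exists_def_one_of_opens_partition` — Def. 1 is LOCAL: the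
  chart representative of the restriction `s|_U` of `s` to an open submanifold agrees with that
  of `s` near the centre, so each clause may be checked on an open cover, and forms given on an
  open partition assemble;
* `cannasDaSilva2010_foldedForm_of_orientable_of_connected` — applied to the connected
  components, the named fact REDUCES TO CONNECTED `M` (where the printed proof, §§3–6, takes
  place): what remains is exactly its h-principle core;
* `contactFoldForm F b = d(F(x₀) · b)`, `pfaffian_contactFoldForm`, `contactFoldForm_def_one_at`,
  `exists_isFoldedForm_contactFoldForm`, `exists_isFoldedForm_baykurFoldModel` — the
  CONTACT-TYPE FOLD MODEL behind "doubles of `ω`-convex symplectic manifolds are folded" (§2):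
  `Pf(d(F(x₀) b)) = F F' (b ∧ db)(e₁,e₂,e₃)`, Def. 1 along `{F' = 0}`, and Baykur's model
  `d((x₀² + 1)(dx₃ + x₁ dx₂))` as a folded symplectic form on `ℝ⁴` folded along `{x₀ = 0}`;
* `def_one_at_of_pullback`, `def_one_at_of_chart`, `def_one_pullback_diffeomorph`,
  `exists_isFoldedForm_pullback_diffeomorph`, `def_one_at_of_chart_contactFoldForm` — the
  clauses of Def. 1 PULL BACK ALONG LOCAL DIFFEOMORPHISMS (germ form: `Pf(f^*t) = det(Dg) ·
  (Pf(t) ∘ g)` with the second factor vanishing at a fold point), so they may be checked in any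
  chart of the maximal atlas, folded symplectic forms transport along diffeomorphisms, and a
  form reading as the contact-type fold model in some chart satisfies Def. 1 there;
* `def_one_at_congr`, `isSmoothForm_of_locally`, `isClosedForm_of_locally`, `def_one_of_locally`
  — the clauses depend only on GERMS, so a form given piecewise (agreeing near each point with
  a form satisfying them there) is smooth, closed and satisfies Def. 1 along its fold;
* `genContactFoldForm Φ b = d(Φ · b)`, `pfaffian_genContactFoldForm`,
  `genContactFoldForm_def_one_at`, `def_one_at_of_chart_genContactFoldForm` — the same with a
  profile `Φ` depending on ALL coordinates (still `Pf = Φ ∂₀Φ (b ∧ db)`: the slice derivatives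
  of `Φ` cancel), the form met along a seam in the collar of a normalised Liouville field.

Smoothness and closedness of `f^*σ` are the tree's pull-back calculus
(`isSmoothForm_pullback`, `mextDeriv_pullback`, unconditional through
`Literature.Geometry.Kaehler.instPullbackFacts`).

The h-principle steps of the printed proof (Lemmas 2, 3, 5 and §6 of the paper: Gromov 1969,
Dold–Whitney 1959, Eliashberg 1972) are not in the tree; this file holds the elementary last
steps (Lemma 4 and the passage from Def. 1 to the hypersurface datum).

## References

* [Cannasdasilva2010] A. Cannas da Silva, *Fold-forms for four-folds*, J. Symplectic Geom. 8
  (2010) 189–203, doi:10.4310/jsg.2010.v8.n2.a3 = arXiv:0909.4067, §1 (p. 2), Def. 1 (§2),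
  Lemma 4 (§5).
* [CannasdasilvaGuilleminPires2010] A. Cannas da Silva, V. Guillemin, A. R. Pires, *Symplectic
  Origami*, IMRN 2011, Def. 2.1, Example 2.3 (the folding map `S²ⁿ → D²ⁿ`).
* [Baykur2006] R. İ. Baykur, *Kähler decomposition of 4-manifolds*, Algebr. Geom. Topol. 6
  (2006) 1239–1265, Def. 2 and proof of Thm. 6.1 (the local model `d((t² + 1) π^*α)` on
  `[-1, 1] × H` of a folded Kähler structure).
* [LeeSmoothManifolds2013] J. M. Lee, *Introduction to Smooth Manifolds*, 2nd ed. (2013),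
  Thm. 5.8, Cor. 5.14 (slice charts, regular level sets) — through `SliceCharts.lean`,
  `RegularLevelSet.lean`.
-/

noncomputable section

open scoped Manifold ContDiff Topology
open Set Function Filter
open Literature.Geometry.Kaehler

namespace Literature.Geometry.Symplectic

/-! ### Linear algebra on `ℝ⁴`: kernel vectors and the determinant -/

section Linear

/-- An endomorphism of `ℝ⁴` with a non-zero kernel vector has determinant zero
(`det L ≠ 0 ⇒ L` invertible). [folklore] -/
theorem det_eq_zero_of_apply_eq_zero
    {L : (EuclideanSpace ℝ (Fin 4)) →L[ℝ] EuclideanSpace ℝ (Fin 4)}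
    {v : EuclideanSpace ℝ (Fin 4)} (hv : v ≠ 0) (hL : L v = 0) :
    LinearMap.det (L : (EuclideanSpace ℝ (Fin 4)) →ₗ[ℝ] EuclideanSpace ℝ (Fin 4)) = 0 := by
  by_contra h
  have hU : IsUnit (L : (EuclideanSpace ℝ (Fin 4)) →ₗ[ℝ] EuclideanSpace ℝ (Fin 4)) :=
    (LinearMap.isUnit_iff_isUnit_det _).2 (isUnit_iff_ne_zero.2 h)
  have hker := (LinearMap.isUnit_iff_ker_eq_bot _).1 hU
  have hmem : v ∈ LinearMap.ker
      (L : (EuclideanSpace ℝ (Fin 4)) →ₗ[ℝ] EuclideanSpace ℝ (Fin 4)) := by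
    rw [LinearMap.mem_ker]
    exact hL
  rw [hker, Submodule.mem_bot] at hmem
  exact hv hmem

/-- An endomorphism of `ℝ⁴` without non-zero kernel vectors is bijective (rank–nullity).
[folklore] -/
theorem bijective_of_forall_apply_ne_zero
    {L : (EuclideanSpace ℝ (Fin 4)) →L[ℝ] EuclideanSpace ℝ (Fin 4)}
    (h : ∀ v, v ≠ 0 → L v ≠ 0) : Bijective L := by
  have hinj :
      Injective (L : (EuclideanSpace ℝ (Fin 4)) →ₗ[ℝ] EuclideanSpace ℝ (Fin 4)) := by
    rw [← LinearMap.ker_eq_bot, Submodule.eq_bot_iff]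
    intro v hv
    by_contra hv0
    exact h v hv0 (by rwa [LinearMap.mem_ker] at hv)
  exact ⟨hinj, LinearMap.injective_iff_surjective.1 hinj⟩

end Linear

/-! ### The fold of a pull-back is the singular set of the map -/

section Pullback

universe u

variable {M : Type u} [TopologicalSpace M] [ChartedSpace (EuclideanSpace ℝ (Fin 4)) M]
  {X : Type*} [TopologicalSpace X] [ChartedSpace (EuclideanSpace ℝ (Fin 4)) X]

/-- Evaluation of a pulled-back 2-form on a pair of tangent vectors:
`(f^*σ)_x (v, w) = σ_{f x} (df_x v, df_x w)`. [folklore] -/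
theorem pullback_apply_two (σ : MForm (𝓡 4) X ℝ 2) (f : M → X) (x : M)
    (v w : TangentSpace (𝓡 4) x) :
    σ.pullback (𝓡 4) f x ![v, w] =
      σ (f x) ![mfderiv (𝓡 4) (𝓡 4) f x v, mfderiv (𝓡 4) (𝓡 4) f x w] := by
  rw [MForm.pullback_apply]
  congr 1
  funext i
  fin_cases i <;> rfl

/-- **A singular point of `f` is a fold point of `f^*σ`**: a non-zero kernel vector `v` of
`df_x` lies in the kernel of `(f^*σ)_x`, since
`(f^*σ)_x (v, w) = σ (df_x v, df_x w) = σ (0, df_x w) = 0`.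
[cite: Cannasdasilva2010, §1 (p. 2) and Lemma 4] -/
theorem mem_fold_pullback_of_mfderiv_apply_eq_zero (σ : MForm (𝓡 4) X ℝ 2) (f : M → X)
    {x : M} {v : TangentSpace (𝓡 4) x} (hv : v ≠ 0) (h0 : mfderiv (𝓡 4) (𝓡 4) f x v = 0) :
    x ∈ fold (σ.pullback (𝓡 4) f) := by
  refine ⟨v, hv, fun w => ?_⟩
  rw [pullback_apply_two, h0]
  exact (σ (f x)).map_coord_zero 0 rfl

/-- **A regular point of `f` over a non-degenerate point of `σ` is not a fold point of `f^*σ`**: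
if `df_x` has no kernel vector it is a linear automorphism of `ℝ⁴`, so a kernel vector `v` of
`(f^*σ)_x` would give the kernel vector `df_x v` of `σ_{f x}`.
[cite: Cannasdasilva2010, §1 (p. 2) and Lemma 4] -/
theorem not_mem_fold_pullback (σ : MForm (𝓡 4) X ℝ 2) (f : M → X) {x : M}
    (hσ : f x ∉ fold σ)
    (hreg : ∀ v : TangentSpace (𝓡 4) x, v ≠ 0 → mfderiv (𝓡 4) (𝓡 4) f x v ≠ 0) :
    x ∉ fold (σ.pullback (𝓡 4) f) := by
  have hb : Bijective (mfderiv (𝓡 4) (𝓡 4) f x) := bijective_of_forall_apply_ne_zero hreg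
  rintro ⟨v, hv, h⟩
  refine hσ ⟨mfderiv (𝓡 4) (𝓡 4) f x v, hreg v hv, fun w' => ?_⟩
  obtain ⟨w, rfl⟩ := hb.2 w'
  rw [← pullback_apply_two]
  exact h w

/-! ### Transversality: `Pf(f^*σ) = det(Df) · (Pf σ ∘ f)` in charts -/

variable [IsManifold (𝓡 4) ∞ M] [IsManifold (𝓡 4) ∞ X]

/-- **The chart Pfaffian of a pull-back**, germ at the centre of the chart at `x₀`: writing
`g = writtenInExtChartAt (𝓡 4) (𝓡 4) x₀ f` for `f` read in the preferred charts at `x₀` and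
`f x₀`, the chart representative of `f^*σ` at `x₀` is the pull-back of the representative of
`σ` at `f x₀` along `g` (`MForm.inChart_pullback_eventuallyEq`), so by functoriality of the
Pfaffian (`pfaffian_compContinuousLinearMap`: `Pf (α ∘ (L × L)) = det L · Pf α`)
`Pf ((f^*σ).inChart x₀ y) = det (Dg y) · Pf (σ.inChart (f x₀) (g y))` for `y` near the
centre — the chart form of `(f^*σ) ∧ (f^*σ) = f^*(σ ∧ σ) = det(Df) · (σ ∧ σ ∘ f)`.
[cite: Cannasdasilva2010, Lemma 4] -/
theorem pfaffian_inChart_pullback_eventuallyEq (σ : MForm (𝓡 4) X ℝ 2) {f : M → X} {x₀ : M}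
    (hf : ∀ᶠ z in 𝓝 x₀, MDifferentiableAt (𝓡 4) (𝓡 4) f z) :
    (fun y => pfaffian ((σ.pullback (𝓡 4) f).inChart x₀ y)) =ᶠ[𝓝 (extChartAt (𝓡 4) x₀ x₀)]
      fun y => LinearMap.det (fderiv ℝ (writtenInExtChartAt (𝓡 4) (𝓡 4) x₀ f) y :
          (EuclideanSpace ℝ (Fin 4)) →ₗ[ℝ] EuclideanSpace ℝ (Fin 4)) *
        pfaffian (σ.inChart (f x₀) (writtenInExtChartAt (𝓡 4) (𝓡 4) x₀ f y)) := by
  have hev := σ.inChart_pullback_eventuallyEq (I := 𝓡 4) (I' := 𝓡 4) hf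
  rw [ModelWithCorners.Boundaryless.range_eq_univ, nhdsWithin_univ] at hev
  filter_upwards [hev] with y hy
  simp only [hy, fderivWithin_univ, pfaffian_compContinuousLinearMap]

/-- **Transversality of `(f^*σ)²` at a fold singularity.** Let `σ` be smooth and
non-degenerate at `f x₀`, `f` be `C^∞`, `x₀` a singular point of `f` (`ker df_{x₀} ≠ 0`) at
which the Jacobian determinant `y ↦ det (Dg y)` of `f` in the preferred charts has non-zero
derivative. Then the chart Pfaffian of `f^*σ` has non-zero derivative at the centre of the
chart at `x₀` — the transversality clause `ω ∧ ω ⋔ 0` of Def. 1 for `ω = f^*σ`: by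
`pfaffian_inChart_pullback_eventuallyEq` and the product rule,
`d(Pf(f^*σ)) = Pf σ(f x₀) · d(det Dg) + det Dg(y₀) · (…) = Pf σ(f x₀) · d(det Dg) ≠ 0`, since
`det Dg (y₀) = det df_{x₀} = 0` and `Pf σ (f x₀) ≠ 0`.
[cite: Cannasdasilva2010, §1 (p. 2) and Lemma 4] -/
theorem fderiv_pfaffian_inChart_pullback_ne_zero {σ : MForm (𝓡 4) X ℝ 2} (hσ : IsSmoothForm σ)
    {f : M → X} (hf : ContMDiff (𝓡 4) (𝓡 4) ∞ f) {x₀ : M} (hx : f x₀ ∉ fold σ)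
    (hsing : ∃ v : TangentSpace (𝓡 4) x₀, v ≠ 0 ∧ mfderiv (𝓡 4) (𝓡 4) f x₀ v = 0)
    (htr : fderiv ℝ (fun y => LinearMap.det
        (fderiv ℝ (writtenInExtChartAt (𝓡 4) (𝓡 4) x₀ f) y :
          (EuclideanSpace ℝ (Fin 4)) →ₗ[ℝ] EuclideanSpace ℝ (Fin 4)))
      (extChartAt (𝓡 4) x₀ x₀) ≠ 0) :
    fderiv ℝ (fun y => pfaffian ((σ.pullback (𝓡 4) f).inChart x₀ y))
      (extChartAt (𝓡 4) x₀ x₀) ≠ 0 := by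
  have hfx : ContMDiffAt (𝓡 4) (𝓡 4) ∞ f x₀ := hf x₀
  have hev := pfaffian_inChart_pullback_eventuallyEq σ (x₀ := x₀)
    (Eventually.of_forall fun z => (hf z).mdifferentiableAt (by simp))
  rw [hev.fderiv_eq]
  -- the written map `g` is `C^∞` at the centre `y₀`
  have hgs : ContDiffAt ℝ ∞ (writtenInExtChartAt (𝓡 4) (𝓡 4) x₀ f)
      (extChartAt (𝓡 4) x₀ x₀) := by
    have h2 := (contMDiffAt_iff.1 hfx).2
    rw [ModelWithCorners.Boundaryless.range_eq_univ] at h2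
    exact h2.contDiffAt univ_mem
  have hgy₀ : writtenInExtChartAt (𝓡 4) (𝓡 4) x₀ f (extChartAt (𝓡 4) x₀ x₀) =
      extChartAt (𝓡 4) (f x₀) (f x₀) :=
    writtenInExtChartAt_apply_self f x₀
  -- the Pfaffian factor is differentiable at `y₀` …
  have hpd : DifferentiableAt ℝ
      (fun y => pfaffian (σ.inChart (f x₀) (writtenInExtChartAt (𝓡 4) (𝓡 4) x₀ f y)))
      (extChartAt (𝓡 4) x₀ x₀) := by
    have h1 : ContDiffWithinAt ℝ ∞ (σ.inChart (f x₀)) univ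
        (writtenInExtChartAt (𝓡 4) (𝓡 4) x₀ f (extChartAt (𝓡 4) x₀ x₀)) := by
      have h := hσ (f x₀)
      rwa [ModelWithCorners.Boundaryless.range_eq_univ, ← hgy₀] at h
    have h2 : DifferentiableAt ℝ (σ.inChart (f x₀))
        (writtenInExtChartAt (𝓡 4) (𝓡 4) x₀ f (extChartAt (𝓡 4) x₀ x₀)) :=
      (h1.contDiffAt univ_mem).differentiableAt (by simp)
    have h3 : DifferentiableAt ℝ
        (fun y => σ.inChart (f x₀) (writtenInExtChartAt (𝓡 4) (𝓡 4) x₀ f y))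
        (extChartAt (𝓡 4) x₀ x₀) :=
      h2.comp (extChartAt (𝓡 4) x₀ x₀) (hgs.differentiableAt (by simp))
    exact (contDiff_pfaffian.differentiable (by simp)).differentiableAt.comp
      (extChartAt (𝓡 4) x₀ x₀) h3
  -- … and does not vanish there (`σ` is non-degenerate at `f x₀`)
  have hp0 : pfaffian (σ.inChart (f x₀)
      (writtenInExtChartAt (𝓡 4) (𝓡 4) x₀ f (extChartAt (𝓡 4) x₀ x₀))) ≠ 0 := by
    rw [hgy₀]
    exact fun h => hx ((mem_fold_iff_pfaffian_inChart_self σ (f x₀)).2 h)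
  -- the determinant factor is differentiable at `y₀` (its derivative is non-zero) …
  have hud : DifferentiableAt ℝ
      (fun y => LinearMap.det (fderiv ℝ (writtenInExtChartAt (𝓡 4) (𝓡 4) x₀ f) y :
        (EuclideanSpace ℝ (Fin 4)) →ₗ[ℝ] EuclideanSpace ℝ (Fin 4)))
      (extChartAt (𝓡 4) x₀ x₀) := by
    by_contra h
    exact htr (fderiv_zero_of_not_differentiableAt h)
  -- … and vanishes there (`x₀` is a singular point of `f`)
  have hu0 : LinearMap.det (fderiv ℝ (writtenInExtChartAt (𝓡 4) (𝓡 4) x₀ f)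
      (extChartAt (𝓡 4) x₀ x₀) :
        (EuclideanSpace ℝ (Fin 4)) →ₗ[ℝ] EuclideanSpace ℝ (Fin 4)) = 0 := by
    obtain ⟨v, hv, hv0⟩ := hsing
    have hm : mfderiv (𝓡 4) (𝓡 4) f x₀ =
        fderiv ℝ (writtenInExtChartAt (𝓡 4) (𝓡 4) x₀ f) (extChartAt (𝓡 4) x₀ x₀) := by
      rw [(hfx.mdifferentiableAt (by simp)).mfderiv,
        ModelWithCorners.Boundaryless.range_eq_univ, fderivWithin_univ]
    rw [← hm]
    exact det_eq_zero_of_apply_eq_zero hv hv0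
  rw [fderiv_fun_mul hud hpd, hu0, zero_smul, zero_add]
  exact smul_ne_zero hp0 htr

/-! ### The theorem: pull-backs by fold maps are folded symplectic forms -/

/-- **The pull-back of a symplectic form by a map with fold singularities is a folded
symplectic form** (Cannas da Silva 2010, §1, p. 2: "The pullback of a symplectic form by a
`Z`-immersion is a folded symplectic form with folding hypersurface `Z`"; Lemma 4,
equidimensional case `2n = 4`, to which the printed proof reduces via the local leaf spaces).
Let `σ` be a smooth closed non-degenerate (`fold σ = ∅`) 2-form on the 4-manifold `X`,
`f : M → X` a `C^∞` map of 4-manifolds, and `j : N ↪ M` a smooth embedding of a 3-manifold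
such that (i) the singular set of `f` is the image of `j`: `x ∈ range j ↔ ker df_x ≠ 0`;
(ii) at every `j n` the Jacobian determinant of `f` in the preferred charts vanishes
transversally (`d (det Dg) ≠ 0` at the centre); (iii) no cusps: some kernel vector of
`df_{j n}` is not tangent to `j` (`∉ range (dj_n)`). Then `f^*σ` is a folded symplectic form
on `M` with folding hypersurface `j` (`IsFoldedForm`, = Def. 1 of the paper with the
hypersurface as data): it is smooth and closed (pull-back calculus), its fold is the singular
set (`(f^*σ)_x` degenerates iff `df_x` does, `σ` being non-degenerate), `(f^*σ)²` vanishes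
transversally along it (`fderiv_pfaffian_inChart_pullback_ne_zero`), and a kernel vector of
`df_{j n}` not tangent to `j` is a kernel vector of `(f^*σ)_{j n}` not tangent to `j` (maximal
rank on the fold). The local model `(x₁, x₂, x₃, x₄) ↦ (x₁², x₂, x₃, x₄)` of a `Z`-immersion
satisfies (i)–(iii). [cite: Cannasdasilva2010, §1 (p. 2), Lemma 4 (§5), Def. 1 (§2)] -/
theorem isFoldedForm_pullback {σ : MForm (𝓡 4) X ℝ 2} (hσs : IsSmoothForm σ)
    (hσc : IsClosedForm σ) (hσn : fold σ = ∅) {f : M → X} (hf : ContMDiff (𝓡 4) (𝓡 4) ∞ f)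
    {N : Type} [TopologicalSpace N] [ChartedSpace (EuclideanSpace ℝ (Fin 3)) N] {j : N → M}
    (hj : Manifold.IsSmoothEmbedding (𝓡 3) (𝓡 4) ∞ j)
    (hsing : ∀ x, x ∈ range j ↔
      ∃ v : TangentSpace (𝓡 4) x, v ≠ 0 ∧ mfderiv (𝓡 4) (𝓡 4) f x v = 0)
    (htr : ∀ n : N, fderiv ℝ (fun y => LinearMap.det
        (fderiv ℝ (writtenInExtChartAt (𝓡 4) (𝓡 4) (j n) f) y :
          (EuclideanSpace ℝ (Fin 4)) →ₗ[ℝ] EuclideanSpace ℝ (Fin 4)))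
      (extChartAt (𝓡 4) (j n) (j n)) ≠ 0)
    (hker : ∀ n : N, ∃ v : TangentSpace (𝓡 4) (j n),
      mfderiv (𝓡 4) (𝓡 4) f (j n) v = 0 ∧ v ∉ range (mfderiv (𝓡 3) (𝓡 4) j n)) :
    IsFoldedForm (σ.pullback (𝓡 4) f) N j where
  smooth := Literature.NumberTheory.Transcendental.isSmoothForm_pullback hf hσs
  closed := by
    have h0 : mextDeriv σ = 0 := hσc
    rw [IsClosedForm, Literature.NumberTheory.Transcendental.mextDeriv_pullback hf hσs, h0,
      MForm.pullback_zero]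
  embedding := hj
  range_eq := by
    ext x
    rw [hsing x]
    constructor
    · rintro ⟨v, hv, hv0⟩
      exact mem_fold_pullback_of_mfderiv_apply_eq_zero σ f hv hv0
    · intro hx
      by_contra h
      push Not at h
      have hσx : f x ∉ fold σ := by simp [hσn]
      exact not_mem_fold_pullback σ f hσx h hx
  transverse := by
    intro x₀ hx₀
    have hx₀' : ∃ v : TangentSpace (𝓡 4) x₀, v ≠ 0 ∧ mfderiv (𝓡 4) (𝓡 4) f x₀ v = 0 := by
      by_contra h
      push Not at h
      have hσx : f x₀ ∉ fold σ := by simp [hσn]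
      exact not_mem_fold_pullback σ f hσx h hx₀
    obtain ⟨n, rfl⟩ := (hsing x₀).2 hx₀'
    have hσx : f (j n) ∉ fold σ := by simp [hσn]
    exact fderiv_pfaffian_inChart_pullback_ne_zero hσs hf hσx hx₀' (htr n)
  maximalRank := by
    intro n
    obtain ⟨v, hv0, hv⟩ := hker n
    refine ⟨v, fun w => ?_, hv⟩
    rw [pullback_apply_two, hv0]
    exact (σ (f (j n))).map_coord_zero 0 rfl

end Pullback

/-! ### The model: the standard fold map of `ℝ⁴` folds every symplectic form along `{x₀ = 0}`

§1 of the paper: a `Z`-immersion is, near a point of `Z`, the map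
`(x₁, x₂, …, xₙ) ⟼ (x₁², x₂, …, xₙ)` in suitable coordinates, and "Simplest instances are the
spheres `S²ⁿ`, where a folded symplectic form is obtained by pulling back the standard symplectic
form on `ℝ²ⁿ` via the folding map `S²ⁿ → D²ⁿ`" (§2). Here: the fold map of `ℝ⁴` itself satisfies
the three hypotheses of `isFoldedForm_pullback` with `j` the inclusion of the hyperplane
`{x₀ = 0}`, so `φ^*σ` is folded for EVERY smooth closed non-degenerate `σ` on `ℝ⁴` (e.g. the
tree's `stdSymplecticMForm` of `GromovR4RelEndProofs.lean`). -/

section Model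

/-- **The standard fold map** `φ (x₀, x₁, x₂, x₃) = (x₀², x₁, x₂, x₃)` of `ℝ⁴` (the local model
of a `Z`-immersion, `Z = {x₀ = 0}`). [cite: Cannasdasilva2010, §1 (p. 2)] -/
def foldMap (x : EuclideanSpace ℝ (Fin 4)) : EuclideanSpace ℝ (Fin 4) :=
  WithLp.toLp 2 ![x 0 * x 0, x 1, x 2, x 3]

/-- `(φ x)₀ = x₀²`. [folklore] -/
@[simp] theorem foldMap_apply_zero (x : EuclideanSpace ℝ (Fin 4)) : foldMap x 0 = x 0 * x 0 := rfl
/-- `(φ x)₁ = x₁`. [folklore] -/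
@[simp] theorem foldMap_apply_one (x : EuclideanSpace ℝ (Fin 4)) : foldMap x 1 = x 1 := rfl
/-- `(φ x)₂ = x₂`. [folklore] -/
@[simp] theorem foldMap_apply_two (x : EuclideanSpace ℝ (Fin 4)) : foldMap x 2 = x 2 := rfl
/-- `(φ x)₃ = x₃`. [folklore] -/
@[simp] theorem foldMap_apply_three (x : EuclideanSpace ℝ (Fin 4)) : foldMap x 3 = x 3 := rfl

/-- The derivative `dφ_x (v) = (2 x₀ v₀, v₁, v₂, v₃)` of the fold map, as a linear map.
[folklore] -/
def foldMapDerivₗ (x : EuclideanSpace ℝ (Fin 4)) :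
    EuclideanSpace ℝ (Fin 4) →ₗ[ℝ] EuclideanSpace ℝ (Fin 4) where
  toFun v := WithLp.toLp 2 ![2 * x 0 * v 0, v 1, v 2, v 3]
  map_add' v w := by
    ext i
    fin_cases i <;> simp [mul_add]
  map_smul' c v := by
    ext i
    fin_cases i <;> simp [mul_left_comm]

/-- The derivative `dφ_x (v) = (2 x₀ v₀, v₁, v₂, v₃)` of the fold map, as a continuous linear
map. [folklore] -/
def foldMapDeriv (x : EuclideanSpace ℝ (Fin 4)) :
    EuclideanSpace ℝ (Fin 4) →L[ℝ] EuclideanSpace ℝ (Fin 4) :=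
  LinearMap.toContinuousLinearMap (foldMapDerivₗ x)

/-- `dφ_x (v) = (2 x₀ v₀, v₁, v₂, v₃)`. [folklore] -/
@[simp] theorem foldMapDeriv_apply (x v : EuclideanSpace ℝ (Fin 4)) :
    foldMapDeriv x v = WithLp.toLp 2 ![2 * x 0 * v 0, v 1, v 2, v 3] := rfl

/-- The coordinate `x ↦ xᵢ` of `ℝ⁴` has itself (the projection) as strict derivative.
[folklore] -/
theorem hasStrictFDerivAt_coord (i : Fin 4) (y : EuclideanSpace ℝ (Fin 4)) :
    HasStrictFDerivAt (fun x : EuclideanSpace ℝ (Fin 4) => x i)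
      (EuclideanSpace.proj i : EuclideanSpace ℝ (Fin 4) →L[ℝ] ℝ) y :=
  (EuclideanSpace.proj i : EuclideanSpace ℝ (Fin 4) →L[ℝ] ℝ).hasStrictFDerivAt

/-- **`dφ_y = foldMapDeriv y`**: the fold map has strict derivative `(2 y₀ v₀, v₁, v₂, v₃)` at
`y` (coordinate-wise: `d(x₀²) = 2 x₀ dx₀`, `dxᵢ = dxᵢ`). [folklore] -/
theorem hasStrictFDerivAt_foldMap (y : EuclideanSpace ℝ (Fin 4)) :
    HasStrictFDerivAt foldMap (foldMapDeriv y) y := by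
  rw [hasStrictFDerivAt_euclidean]
  intro i
  fin_cases i
  · show HasStrictFDerivAt (fun x : EuclideanSpace ℝ (Fin 4) => x 0 * x 0) _ y
    refine ((hasStrictFDerivAt_coord 0 y).fun_mul (hasStrictFDerivAt_coord 0 y)).congr_fderiv
      ?_
    ext v
    simp [PiLp.proj_apply]
    ring
  · show HasStrictFDerivAt (fun x : EuclideanSpace ℝ (Fin 4) => x 1) _ y
    refine (hasStrictFDerivAt_coord 1 y).congr_fderiv ?_
    ext v
    simp [PiLp.proj_apply]
  · show HasStrictFDerivAt (fun x : EuclideanSpace ℝ (Fin 4) => x 2) _ y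
    refine (hasStrictFDerivAt_coord 2 y).congr_fderiv ?_
    ext v
    simp [PiLp.proj_apply]
  · show HasStrictFDerivAt (fun x : EuclideanSpace ℝ (Fin 4) => x 3) _ y
    refine (hasStrictFDerivAt_coord 3 y).congr_fderiv ?_
    ext v
    simp [PiLp.proj_apply]

/-- `fderiv φ y = foldMapDeriv y`. [folklore] -/
theorem fderiv_foldMap (y : EuclideanSpace ℝ (Fin 4)) : fderiv ℝ foldMap y = foldMapDeriv y :=
  (hasStrictFDerivAt_foldMap y).hasFDerivAt.fderiv

/-- The fold map is `C^∞` (polynomial coordinates). [folklore] -/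
theorem contDiff_foldMap : ContDiff ℝ ∞ foldMap := by
  rw [contDiff_euclidean]
  intro i
  fin_cases i
  · show ContDiff ℝ ∞ (fun x : EuclideanSpace ℝ (Fin 4) => x 0 * x 0)
    exact (EuclideanSpace.proj (0 : Fin 4) : EuclideanSpace ℝ (Fin 4) →L[ℝ] ℝ).contDiff.mul
      (EuclideanSpace.proj (0 : Fin 4) : EuclideanSpace ℝ (Fin 4) →L[ℝ] ℝ).contDiff
  · show ContDiff ℝ ∞ (fun x : EuclideanSpace ℝ (Fin 4) => x 1)
    exact (EuclideanSpace.proj (1 : Fin 4) : EuclideanSpace ℝ (Fin 4) →L[ℝ] ℝ).contDiff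
  · show ContDiff ℝ ∞ (fun x : EuclideanSpace ℝ (Fin 4) => x 2)
    exact (EuclideanSpace.proj (2 : Fin 4) : EuclideanSpace ℝ (Fin 4) →L[ℝ] ℝ).contDiff
  · show ContDiff ℝ ∞ (fun x : EuclideanSpace ℝ (Fin 4) => x 3)
    exact (EuclideanSpace.proj (3 : Fin 4) : EuclideanSpace ℝ (Fin 4) →L[ℝ] ℝ).contDiff

/-- The fold map is a `C^∞` map of the manifold `ℝ⁴` (model `𝓡 4`). [folklore] -/
theorem contMDiff_foldMap : ContMDiff (𝓡 4) (𝓡 4) ∞ foldMap :=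
  contMDiff_iff_contDiff.2 contDiff_foldMap

/-- `mfderiv φ x = foldMapDeriv x` (on the model space `mfderiv = fderiv`). [folklore] -/
theorem mfderiv_foldMap (x : EuclideanSpace ℝ (Fin 4)) :
    mfderiv (𝓡 4) (𝓡 4) foldMap x = foldMapDeriv x := by
  rw [mfderiv_eq_fderiv, fderiv_foldMap]

/-- **The Jacobian determinant of the fold map is `2 x₀`** (`dφ_x = diag (2x₀, 1, 1, 1)`).
[folklore] -/
theorem det_foldMapDeriv (x : EuclideanSpace ℝ (Fin 4)) :
    LinearMap.det (foldMapDeriv x : EuclideanSpace ℝ (Fin 4) →ₗ[ℝ] EuclideanSpace ℝ (Fin 4)) =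
      2 * x 0 := by
  rw [linearMap_det_eq_det_coords, matrix_det_fin_four]
  simp [Matrix.of_apply, stdVec_apply]

/-- On the model space `ℝ⁴` the map written in the preferred (identity) charts is the map
itself. [folklore] -/
theorem writtenInExtChartAt_model (f : EuclideanSpace ℝ (Fin 4) → EuclideanSpace ℝ (Fin 4))
    (x : EuclideanSpace ℝ (Fin 4)) : writtenInExtChartAt (𝓡 4) (𝓡 4) x f = f := by
  funext y
  simp [writtenInExtChartAt]

/-- **The Jacobian determinant of the fold map vanishes transversally**: `y ↦ det (dφ_y) = 2 y₀`
has derivative `2 dx₀ ≠ 0` everywhere. [cite: Cannasdasilva2010, §1 (p. 2)] -/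
theorem fderiv_det_fderiv_foldMap_ne_zero (y₀ : EuclideanSpace ℝ (Fin 4)) :
    fderiv ℝ (fun y => LinearMap.det
        (fderiv ℝ foldMap y : EuclideanSpace ℝ (Fin 4) →ₗ[ℝ] EuclideanSpace ℝ (Fin 4))) y₀ ≠ 0 := by
  have hfun : (fun y => LinearMap.det
      (fderiv ℝ foldMap y : EuclideanSpace ℝ (Fin 4) →ₗ[ℝ] EuclideanSpace ℝ (Fin 4))) =
      fun y : EuclideanSpace ℝ (Fin 4) => 2 * y 0 := by
    funext y
    rw [fderiv_foldMap, det_foldMapDeriv]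
  have h : HasFDerivAt (fun y : EuclideanSpace ℝ (Fin 4) => 2 * y 0)
      ((2 : ℝ) • (EuclideanSpace.proj 0 : EuclideanSpace ℝ (Fin 4) →L[ℝ] ℝ)) y₀ :=
    (hasStrictFDerivAt_coord 0 y₀).hasFDerivAt.const_mul 2
  rw [hfun, h.fderiv]
  intro h0
  have h1 := congrArg (fun L : EuclideanSpace ℝ (Fin 4) →L[ℝ] ℝ => L (stdVec 0)) h0
  simp [PiLp.proj_apply, stdVec_apply] at h1

/-! #### The folding hypersurface: the hyperplane `{x₀ = 0}` -/

/-- The inclusion `ℝ³ ↪ ℝ⁴`, `(y₀, y₁, y₂) ↦ (0, y₀, y₁, y₂)`, onto the hyperplane `{x₀ = 0}`, as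
a linear map. [folklore] -/
def hyperplaneInclₗ : EuclideanSpace ℝ (Fin 3) →ₗ[ℝ] EuclideanSpace ℝ (Fin 4) where
  toFun y := WithLp.toLp 2 ![0, y 0, y 1, y 2]
  map_add' v w := by
    ext i
    fin_cases i <;> simp
  map_smul' c v := by
    ext i
    fin_cases i <;> simp

/-- **The folding hypersurface of the model**: the isometric inclusion `j : ℝ³ ↪ ℝ⁴` onto the
hyperplane `Z = {x₀ = 0}`. [cite: Cannasdasilva2010, §1 (p. 2)] -/
def hyperplaneIncl : EuclideanSpace ℝ (Fin 3) →ₗᵢ[ℝ] EuclideanSpace ℝ (Fin 4) :=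
  { hyperplaneInclₗ with
    norm_map' := fun v => by
      -- `‖(0, v₀, v₁, v₂)‖² = Σ vᵢ² = ‖v‖²`
      have h : ‖hyperplaneInclₗ v‖ ^ 2 = ‖v‖ ^ 2 := by
        rw [EuclideanSpace.real_norm_sq_eq, EuclideanSpace.real_norm_sq_eq, Fin.sum_univ_four,
          Fin.sum_univ_three]
        simp [hyperplaneInclₗ]
      exact (sq_eq_sq₀ (norm_nonneg _) (norm_nonneg _)).1 h }

/-- `j y = (0, y₀, y₁, y₂)`. [folklore] -/
theorem hyperplaneIncl_apply (y : EuclideanSpace ℝ (Fin 3)) :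
    hyperplaneIncl y = WithLp.toLp 2 ![0, y 0, y 1, y 2] := rfl

/-- `(j y)₀ = 0`. [folklore] -/
@[simp] theorem hyperplaneIncl_apply_zero (y : EuclideanSpace ℝ (Fin 3)) : hyperplaneIncl y 0 = 0 :=
  rfl
/-- `(j y)₁ = y₀`. [folklore] -/
@[simp] theorem hyperplaneIncl_apply_one (y : EuclideanSpace ℝ (Fin 3)) :
    hyperplaneIncl y 1 = y 0 :=
  rfl
/-- `(j y)₂ = y₁`. [folklore] -/
@[simp] theorem hyperplaneIncl_apply_two (y : EuclideanSpace ℝ (Fin 3)) :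
    hyperplaneIncl y 2 = y 1 :=
  rfl
/-- `(j y)₃ = y₂`. [folklore] -/
@[simp] theorem hyperplaneIncl_apply_three (y : EuclideanSpace ℝ (Fin 3)) :
    hyperplaneIncl y 3 = y 2 :=
  rfl

/-- **The image of `j` is the hyperplane `{x₀ = 0}`.** [folklore] -/
theorem range_hyperplaneIncl :
    range hyperplaneIncl = {x : EuclideanSpace ℝ (Fin 4) | x 0 = 0} := by
  ext x
  constructor
  · rintro ⟨y, rfl⟩
    rfl
  · intro hx
    refine ⟨WithLp.toLp 2 ![x 1, x 2, x 3], ?_⟩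
    have hx' : x 0 = 0 := hx
    ext i
    fin_cases i <;> simp [hyperplaneIncl_apply, hx']

/-- The splitting `ℝ³ × ℝ ≃ ℝ⁴`, `((y₀, y₁, y₂), t) ↦ (t, y₀, y₁, y₂)` — the complement datum of
the immersion `j` (`j y = split (y, 0)`), as a linear equivalence. [folklore] -/
def hyperplaneSplitₗ : (EuclideanSpace ℝ (Fin 3) × ℝ) ≃ₗ[ℝ] EuclideanSpace ℝ (Fin 4) where
  toFun p := WithLp.toLp 2 ![p.2, p.1 0, p.1 1, p.1 2]
  invFun v := (WithLp.toLp 2 ![v 1, v 2, v 3], v 0)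
  map_add' p q := by
    ext i
    fin_cases i <;> simp
  map_smul' c p := by
    ext i
    fin_cases i <;> simp
  left_inv p := by
    obtain ⟨y, t⟩ := p
    refine Prod.ext ?_ rfl
    ext i
    fin_cases i <;> simp
  right_inv v := by
    ext i
    fin_cases i <;> simp

/-- The splitting `ℝ³ × ℝ ≃ ℝ⁴` as a continuous linear equivalence. [folklore] -/
def hyperplaneSplit : (EuclideanSpace ℝ (Fin 3) × ℝ) ≃L[ℝ] EuclideanSpace ℝ (Fin 4) :=
  hyperplaneSplitₗ.toContinuousLinearEquiv

/-- `split (y, 0) = j y`. [folklore] -/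
theorem hyperplaneSplit_apply_zero (y : EuclideanSpace ℝ (Fin 3)) :
    hyperplaneSplit (y, 0) = hyperplaneIncl y := rfl

/-- **`j` is a `C^∞` immersion** (in the identity charts it is `y ↦ split (y, 0)`). [folklore] -/
theorem isImmersion_hyperplaneIncl : Manifold.IsImmersion (𝓡 3) (𝓡 4) ∞ hyperplaneIncl := by
  refine ⟨ℝ, inferInstance, inferInstance, fun n => ?_⟩
  refine Manifold.IsImmersionAtOfComplement.mk_of_continuousAt
    hyperplaneIncl.continuous.continuousAt hyperplaneSplit
    (chartAt (EuclideanSpace ℝ (Fin 3)) n) (chartAt (EuclideanSpace ℝ (Fin 4)) (hyperplaneIncl n))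
    (mem_chart_source _ n) (mem_chart_source _ (hyperplaneIncl n))
    (IsManifold.chart_mem_maximalAtlas n) (IsManifold.chart_mem_maximalAtlas (hyperplaneIncl n))
    ?_
  intro y _
  simp only [Function.comp_apply, OpenPartialHomeomorph.extend_coe,
    OpenPartialHomeomorph.extend_coe_symm, modelWithCornersSelf_coe, modelWithCornersSelf_coe_symm,
    id_eq, chartAt_self_eq, OpenPartialHomeomorph.refl_apply, OpenPartialHomeomorph.refl_symm]
  rfl

/-- **`j` is a `C^∞` embedding** (an isometric immersion). [folklore] -/
theorem isSmoothEmbedding_hyperplaneIncl :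
    Manifold.IsSmoothEmbedding (𝓡 3) (𝓡 4) ∞ hyperplaneIncl :=
  ⟨isImmersion_hyperplaneIncl, hyperplaneIncl.isometry.isEmbedding⟩

/-- `mfderiv j n = j` (a linear map is its own derivative). [folklore] -/
theorem mfderiv_hyperplaneIncl_apply (n : EuclideanSpace ℝ (Fin 3))
    (v : TangentSpace (𝓡 3) n) :
    mfderiv (𝓡 3) (𝓡 4) hyperplaneIncl n v = hyperplaneIncl v := by
  rw [show (hyperplaneIncl : EuclideanSpace ℝ (Fin 3) → EuclideanSpace ℝ (Fin 4)) =
      hyperplaneIncl.toContinuousLinearMap from rfl, mfderiv_eq_fderiv,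
    ContinuousLinearMap.fderiv]
  rfl

/-! #### The three hypotheses of `isFoldedForm_pullback` for the model -/

/-- **(i) The singular set of the fold map is the hyperplane `{x₀ = 0}`**:
`dφ_x = diag (2x₀, 1, 1, 1)` has a kernel vector iff `x₀ = 0` iff `x ∈ range j`.
[cite: Cannasdasilva2010, §1 (p. 2)] -/
theorem mem_range_hyperplaneIncl_iff (x : EuclideanSpace ℝ (Fin 4)) :
    x ∈ range hyperplaneIncl ↔
      ∃ v : TangentSpace (𝓡 4) x, v ≠ 0 ∧ mfderiv (𝓡 4) (𝓡 4) foldMap x v = 0 := by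
  rw [range_hyperplaneIncl, mfderiv_foldMap]
  constructor
  · intro hx
    have hx' : x 0 = 0 := hx
    have hne : (stdVec 0 : EuclideanSpace ℝ (Fin 4)) ≠ 0 := by
      intro h
      have h1 := congrArg (fun v : EuclideanSpace ℝ (Fin 4) => v 0) h
      simp [stdVec_apply] at h1
    refine ⟨stdVec 0, hne, ?_⟩
    show foldMapDeriv x (stdVec 0) = 0
    ext i
    fin_cases i <;> simp [stdVec_apply, hx']
  · rintro ⟨v, hv, h⟩
    change EuclideanSpace ℝ (Fin 4) at v
    change v ≠ (0 : EuclideanSpace ℝ (Fin 4)) at hv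
    have h' : foldMapDeriv x v = 0 := h
    have e0 : 2 * x 0 * v 0 = 0 := by
      have := congrArg (fun w : EuclideanSpace ℝ (Fin 4) => w 0) h'
      simpa using this
    have e1 : v 1 = 0 := by
      have := congrArg (fun w : EuclideanSpace ℝ (Fin 4) => w 1) h'
      simpa using this
    have e2 : v 2 = 0 := by
      have := congrArg (fun w : EuclideanSpace ℝ (Fin 4) => w 2) h'
      simpa using this
    have e3 : v 3 = 0 := by
      have := congrArg (fun w : EuclideanSpace ℝ (Fin 4) => w 3) h'
      simpa using this
    have hv0 : v 0 ≠ 0 := by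
      intro hv0
      apply hv
      ext i
      fin_cases i
      · simpa using hv0
      · simpa using e1
      · simpa using e2
      · simpa using e3
    show x 0 = 0
    rcases mul_eq_zero.1 e0 with h0 | h0
    · exact (mul_eq_zero.1 h0).resolve_left two_ne_zero
    · exact absurd h0 hv0

/-- **(ii) Transversality for the model**: at every point of the hyperplane (indeed everywhere)
the Jacobian determinant of `φ`, read in the preferred (identity) charts, has non-zero
derivative. [cite: Cannasdasilva2010, §1 (p. 2)] -/
theorem fderiv_det_writtenInExtChartAt_foldMap_ne_zero (n : EuclideanSpace ℝ (Fin 3)) :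
    fderiv ℝ (fun y => LinearMap.det
        (fderiv ℝ (writtenInExtChartAt (𝓡 4) (𝓡 4) (hyperplaneIncl n) foldMap) y :
          EuclideanSpace ℝ (Fin 4) →ₗ[ℝ] EuclideanSpace ℝ (Fin 4)))
      (extChartAt (𝓡 4) (hyperplaneIncl n) (hyperplaneIncl n)) ≠ 0 := by
  rw [writtenInExtChartAt_model, extChartAt_self_apply, modelWithCornersSelf_coe, id_eq]
  exact fderiv_det_fderiv_foldMap_ne_zero _

/-- **(iii) No cusps in the model**: `e₀ = ∂/∂x₀` spans `ker dφ` along the hyperplane and is not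
tangent to it. [cite: Cannasdasilva2010, §1 (p. 2)] -/
theorem exists_ker_not_mem_range_hyperplaneIncl (n : EuclideanSpace ℝ (Fin 3)) :
    ∃ v : TangentSpace (𝓡 4) (hyperplaneIncl n),
      mfderiv (𝓡 4) (𝓡 4) foldMap (hyperplaneIncl n) v = 0 ∧
        v ∉ range (mfderiv (𝓡 3) (𝓡 4) hyperplaneIncl n) := by
  refine ⟨stdVec 0, ?_, ?_⟩
  · rw [mfderiv_foldMap]
    show foldMapDeriv (hyperplaneIncl n) (stdVec 0) = 0
    ext i
    fin_cases i <;> simp [stdVec_apply]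
  · rintro ⟨y, hy⟩
    rw [mfderiv_hyperplaneIncl_apply] at hy
    have h1 := congrArg (fun v : EuclideanSpace ℝ (Fin 4) => v 0) hy
    simp [stdVec_apply] at h1

/-- **The model folded symplectic form** (§1–§2 of the paper: pulling back a symplectic form by
the folding map): for every smooth closed non-degenerate 2-form `σ` on `ℝ⁴`, the pull-back
`φ^*σ` by the fold map `φ (x) = (x₀², x₁, x₂, x₃)` is a folded symplectic form on `ℝ⁴` with
folding hypersurface the hyperplane `j : ℝ³ ↪ {x₀ = 0}` — `isFoldedForm_pullback` with its
three hypotheses discharged by `mem_range_hyperplaneIncl_iff`,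
`fderiv_det_writtenInExtChartAt_foldMap_ne_zero`, `exists_ker_not_mem_range_hyperplaneIncl`.
(An instance of `σ`: the tree's `stdSymplecticMForm`, `GromovR4RelEndProofs.lean`.)
[cite: Cannasdasilva2010, §1 (p. 2), §2, Lemma 4] -/
theorem isFoldedForm_pullback_foldMap {σ : MForm (𝓡 4) (EuclideanSpace ℝ (Fin 4)) ℝ 2}
    (hσs : IsSmoothForm σ) (hσc : IsClosedForm σ) (hσn : fold σ = ∅) :
    IsFoldedForm (σ.pullback (𝓡 4) foldMap) (EuclideanSpace ℝ (Fin 3)) hyperplaneIncl :=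
  isFoldedForm_pullback hσs hσc hσn contMDiff_foldMap isSmoothEmbedding_hyperplaneIncl
    mem_range_hyperplaneIncl_iff fderiv_det_writtenInExtChartAt_foldMap_ne_zero
    exists_ker_not_mem_range_hyperplaneIncl

end Model

/-! ### From Def. 1 to `IsFoldedForm`: the fold is an embedded (compact) 3-manifold (step 7)

Def. 1 of the paper (§2): "By tranversality, `Z` is a codimension-1 submanifold of `M`, called
the folding hypersurface" — the tree's `IsFoldedForm` carries this hypersurface as DATA
`j : N ↪ M`. Here the datum is produced from the transversality clause, for the fold ITSELF
with its slice-chart smooth structure (the tree's codimension-one slice machinery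
`Literature.Topology.FourManifolds.SliceChartFamily` and the straightening
`Literature.Topology.FourManifolds.exists_sliceChart` of the regular value theorem): locally the
fold is the regular zero set of the chart Pfaffian `g_z (q) = Pf (s.inChart z (extChartAt z q))`,
which a bump function globalises to a smooth function on `M` with the same germ at `z`. -/

section Hypersurface

open Literature.Topology.FourManifolds

variable {M : Type*} [TopologicalSpace M] [ChartedSpace (EuclideanSpace ℝ (Fin 4)) M]
  [IsManifold (𝓡 4) ∞ M]

/-- **The chart Pfaffian, read back on the manifold, is smooth on the chart domain**: for a
smooth `2`-form `s`, `q ↦ Pf (s.inChart z (extChartAt z q))` is `C^∞` on the source of the chart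
at `z` (the representative `s.inChart z` is `C^∞` on the whole chart target,
`MForm.SmoothAt.contDiffWithinAt_inChart`). [folklore] -/
theorem contMDiffOn_pfaffian_inChart {s : MForm (𝓡 4) M ℝ 2} (hs : IsSmoothForm s) (z : M) :
    ContMDiffOn (𝓡 4) 𝓘(ℝ, ℝ) ∞ (fun q => pfaffian (s.inChart z (extChartAt (𝓡 4) z q)))
      (chartAt (EuclideanSpace ℝ (Fin 4)) z).source := by
  have h1 : ContMDiffOn (𝓡 4) 𝓘(ℝ, EuclideanSpace ℝ (Fin 4)) ∞ (extChartAt (𝓡 4) z)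
      (chartAt (EuclideanSpace ℝ (Fin 4)) z).source := contMDiffOn_extChartAt
  have h2 : ContDiffOn ℝ ∞ (fun y => pfaffian (s.inChart z y)) (extChartAt (𝓡 4) z).target := by
    intro y hy
    have hz' : (extChartAt (𝓡 4) z).symm y ∈ (extChartAt (𝓡 4) z).source :=
      (extChartAt (𝓡 4) z).map_target hy
    have h := MForm.SmoothAt.contDiffWithinAt_inChart (I := 𝓡 4) hz' (hs _)
    rw [(extChartAt (𝓡 4) z).right_inv hy, ModelWithCorners.Boundaryless.range_eq_univ] at h
    exact (contDiff_pfaffian.contDiffAt.comp_contDiffWithinAt y h).mono (subset_univ _)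
  refine h2.contMDiffOn.comp h1 fun q hq => ?_
  rw [← extChartAt_source (I := 𝓡 4)] at hq
  exact (extChartAt (𝓡 4) z).map_source hq

/-- **The derivative of the chart Pfaffian read back on the manifold** is the derivative of the
chart Pfaffian at the centre: `d(g_z)_z = d(Pf ∘ s.inChart z)(extChartAt z z)` (in the chart at
`z` the map `g_z` IS `Pf ∘ s.inChart z`, on the chart target). [folklore] -/
theorem mfderiv_pfaffian_inChart_eq {s : MForm (𝓡 4) M ℝ 2} (hs : IsSmoothForm s) (z : M) :
    mfderiv (𝓡 4) 𝓘(ℝ, ℝ) (fun q => pfaffian (s.inChart z (extChartAt (𝓡 4) z q))) z =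
      fderiv ℝ (fun y => pfaffian (s.inChart z y)) (extChartAt (𝓡 4) z z) := by
  have hgsm : ContMDiffAt (𝓡 4) 𝓘(ℝ, ℝ) ∞
      (fun q => pfaffian (s.inChart z (extChartAt (𝓡 4) z q))) z :=
    (contMDiffOn_pfaffian_inChart hs z).contMDiffAt
      ((chartAt _ z).open_source.mem_nhds (mem_chart_source _ z))
  rw [(hgsm.mdifferentiableAt (by simp)).mfderiv, ModelWithCorners.Boundaryless.range_eq_univ,
    fderivWithin_univ]
  refine Filter.EventuallyEq.fderiv_eq ?_
  filter_upwards [extChartAt_target_mem_nhds (I := 𝓡 4) z] with y hy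
  simp only [writtenInExtChartAt, Function.comp_apply, extChartAt_model_space_eq_id,
    PartialEquiv.refl_coe, id_eq, (extChartAt (𝓡 4) z).right_inv hy]

/-- **The chart Pfaffian has a smooth global extension with the same germ**: multiplying by a
smooth bump function supported in the chart domain at `z` and `≡ 1` near `z`
(Mathlib's `SmoothBumpFunction`). [folklore] -/
theorem exists_contMDiff_eventuallyEq_pfaffian_inChart [T2Space M] {s : MForm (𝓡 4) M ℝ 2}
    (hs : IsSmoothForm s) (z : M) :
    ∃ G : M → ℝ, ContMDiff (𝓡 4) 𝓘(ℝ, ℝ) ∞ G ∧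
      G =ᶠ[𝓝 z] fun q => pfaffian (s.inChart z (extChartAt (𝓡 4) z q)) := by
  obtain ⟨f⟩ : Nonempty (SmoothBumpFunction (𝓡 4) z) := inferInstance
  refine ⟨fun q => f q • pfaffian (s.inChart z (extChartAt (𝓡 4) z q)),
    f.contMDiff_smul (contMDiffOn_pfaffian_inChart hs z), ?_⟩
  filter_upwards [f.eventuallyEq_one] with q hq
  rw [hq, Pi.one_apply, one_smul]

/-- **A slice chart for the fold at a transversal fold point.** If the chart Pfaffian of the
smooth `2`-form `s` has non-zero derivative at the fold point `z` (the clause `ω ∧ ω ⋔ 0` of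
Def. 1 at `z`), then some chart `ψ` of the maximal atlas of `M` around `z` straightens the fold:
`q ∈ fold s ↔ (ψ q)₃ = 0` on its source — the regular value theorem
(`Literature.Topology.FourManifolds.exists_sliceChart`) applied to a smooth globalisation of the
chart Pfaffian, then restricted to where the globalisation agrees with it and the fold is its
zero set (`mem_fold_iff_pfaffian_inChart`).
[cite: Cannasdasilva2010, Def. 1 (§2: "By tranversality, `Z` is a codimension-1 submanifold")] -/
theorem exists_sliceChart_fold [T2Space M] {s : MForm (𝓡 4) M ℝ 2} (hs : IsSmoothForm s)
    {z : M} (hz : z ∈ fold s)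
    (htr : fderiv ℝ (fun y => pfaffian (s.inChart z y)) (extChartAt (𝓡 4) z z) ≠ 0) :
    ∃ ψ : OpenPartialHomeomorph M (EuclideanSpace ℝ (Fin 4)),
      ψ ∈ IsManifold.maximalAtlas (𝓡 4) ∞ M ∧ z ∈ ψ.source ∧
      (∀ q ∈ ψ.source, q ∈ fold s ↔ (𝓡 4) (ψ q) (Fin.last 3) = 0) ∧
      ∀ q ∈ ψ.source, (𝓡 4) (ψ q) ∈ interior (range (𝓡 4)) := by
  obtain ⟨G, hG, hGg⟩ := exists_contMDiff_eventuallyEq_pfaffian_inChart hs z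
  have hGz : G z = 0 := by
    rw [hGg.self_of_nhds]
    exact (mem_fold_iff_pfaffian_inChart_self s z).1 hz
  have hcrit : ¬ IsMCriticalPt (𝓡 4) G z := by
    intro h0
    apply htr
    rw [← mfderiv_pfaffian_inChart_eq hs z, ← hGg.mfderiv_eq]
    exact h0
  obtain ⟨ψ, hψ, hzψ, hlast, -⟩ :=
    Literature.Topology.FourManifolds.exists_sliceChart hG BoundarylessManifold.isInteriorPoint
      hcrit
  -- an open neighbourhood of `z` on which `G` is the chart Pfaffian, inside the chart domain
  obtain ⟨U, hUG, hUo, hzU⟩ := eventually_nhds_iff.1 hGg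
  set W : Set M := U ∩ (extChartAt (𝓡 4) z).source with hW
  have hWo : IsOpen W := hUo.inter (isOpen_extChartAt_source z)
  have hzW : z ∈ W := ⟨hzU, mem_extChartAt_source z⟩
  refine ⟨ψ.restr W, restr_mem_maximalAtlas _ hψ hWo, ?_, ?_, ?_⟩
  · rw [OpenPartialHomeomorph.restr_source, hWo.interior_eq]
    exact ⟨hzψ, hzW⟩
  · intro q hq
    rw [OpenPartialHomeomorph.restr_source, hWo.interior_eq] at hq
    rw [OpenPartialHomeomorph.restr_apply, hlast q hq.1, hGz, sub_zero, hUG q hq.2.1]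
    exact mem_fold_iff_pfaffian_inChart s z hq.2.2
  · intro q _
    rw [ModelWithCorners.Boundaryless.range_eq_univ, interior_univ]
    exact mem_univ _

/-- **The fold of a smooth `2`-form is compact** on a compact 4-manifold (it is closed,
`isClosed_fold_of_isSmoothForm`). [folklore] -/
theorem compactSpace_fold [CompactSpace M] {s : MForm (𝓡 4) M ℝ 2} (hs : IsSmoothForm s) :
    CompactSpace (fold s) :=
  isCompact_iff_compactSpace.1 (isClosed_fold_of_isSmoothForm hs).isCompact

end Hypersurface

section HypersurfaceExists

open Literature.Topology.FourManifolds

variable {M : Type} [TopologicalSpace M] [ChartedSpace (EuclideanSpace ℝ (Fin 4)) M]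
  [IsManifold (𝓡 4) ∞ M]

/-- **Def. 1 implies `IsFoldedForm`: the folding hypersurface as data.** Let `s` be a smooth closed
`2`-form on the 4-manifold `M` (Hausdorff) such that at every point `z` of its fold
(i) `ω ∧ ω ⋔ 0`: the chart Pfaffian `Pf ∘ s.inChart z` has non-zero derivative at the centre,
and (ii) `ı^*ω` has maximal rank: some kernel vector `v` of `s z` is transverse to the fold,
`d(Pf ∘ s.inChart z)(v) ≠ 0` (for the `2`-dimensional kernel `E_z` this says `E_z ⊄ T_z Z`,
`T_z Z = ker d(Pf)`, i.e. `ı^*ω` has a one-dimensional kernel — rank `2n - 2 = 2`). Then the fold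
`Z = fold s`, with the smooth structure of its slice charts (`exists_sliceChart_fold`,
`SliceChartFamily.chartedSpace`/`.isManifold`), is a `3`-manifold whose inclusion is a smooth
embedding, and `s` is a folded symplectic form with folding hypersurface `Z ↪ M` in the sense of
the tree (`IsFoldedForm s Z Subtype.val`): Def. 1 of the paper, "By tranversality, `Z` is a
codimension-1 submanifold of `M`, called the folding hypersurface", made into the datum of
`IsFoldedForm`. Maximal rank: the chart Pfaffian vanishes on `Z` near `z`, so its differential
kills `T_z Z = range d(ı)_z`, hence the transverse kernel vector `v` is not tangent to `Z`.
[cite: Cannasdasilva2010, Def. 1 (§2)] [cite: CannasdasilvaGuilleminPires2010, Def. 2.1] -/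
theorem exists_isFoldedForm_of_transverse [T2Space M] {s : MForm (𝓡 4) M ℝ 2}
    (hs : IsSmoothForm s) (hc : IsClosedForm s)
    (htr : ∀ z ∈ fold s, fderiv ℝ (fun y => pfaffian (s.inChart z y)) (extChartAt (𝓡 4) z z) ≠ 0)
    (hmax : ∀ z ∈ fold s, ∃ v : TangentSpace (𝓡 4) z, (∀ w, s z ![v, w] = 0) ∧
      fderiv ℝ (fun y => pfaffian (s.inChart z y)) (extChartAt (𝓡 4) z z) v ≠ 0) :
    ∃ (_ : ChartedSpace (EuclideanSpace ℝ (Fin 3)) (fold s)) (_ : IsManifold (𝓡 3) ∞ (fold s)),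
      IsFoldedForm s (fold s) Subtype.val := by
  have hsl : ∀ p : fold s, ∃ ψ : OpenPartialHomeomorph M (EuclideanSpace ℝ (Fin 4)),
      ψ ∈ IsManifold.maximalAtlas (𝓡 4) ∞ M ∧ p.1 ∈ ψ.source ∧
      (∀ q ∈ ψ.source, q ∈ fold s ↔ (𝓡 4) (ψ q) (Fin.last 3) = 0) ∧
      ∀ q ∈ ψ.source, (𝓡 4) (ψ q) ∈ interior (range (𝓡 4)) := fun p =>
    exists_sliceChart_fold hs p.2 (htr p.1 p.2)
  choose ψ hψ₁ hψ₂ hψ₃ hψ₄ using hsl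
  let Ψ : SliceChartFamily (𝓡 4) (fold s) := ⟨ψ, hψ₁, hψ₂, hψ₃, hψ₄⟩
  letI := Ψ.chartedSpace
  haveI := Ψ.isManifold
  refine ⟨Ψ.chartedSpace, Ψ.isManifold, ?_⟩
  refine ⟨hs, hc, Ψ.isSmoothEmbedding_subtype_val, Subtype.range_val, htr, fun n => ?_⟩
  obtain ⟨v, hv, hdv⟩ := hmax n.1 n.2
  refine ⟨v, hv, ?_⟩
  rintro ⟨u, hu⟩
  apply hdv
  -- the chart Pfaffian `g` at `z = n.1`, read back on `M`
  have hgsm : ContMDiffAt (𝓡 4) 𝓘(ℝ, ℝ) ∞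
      (fun q => pfaffian (s.inChart n.1 (extChartAt (𝓡 4) n.1 q))) n.1 :=
    (contMDiffOn_pfaffian_inChart hs n.1).contMDiffAt
      ((chartAt _ n.1).open_source.mem_nhds (mem_chart_source _ n.1))
  have hgd : MDifferentiableAt (𝓡 4) 𝓘(ℝ, ℝ)
      (fun q => pfaffian (s.inChart n.1 (extChartAt (𝓡 4) n.1 q))) n.1 :=
    hgsm.mdifferentiableAt (by simp)
  have hval : MDifferentiableAt (𝓡 3) (𝓡 4) (Subtype.val : fold s → M) n :=
    (Ψ.contMDiff_subtype_val n).mdifferentiableAt (by simp)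
  -- `g ∘ val` vanishes near `n`
  have hzero : ((fun q => pfaffian (s.inChart n.1 (extChartAt (𝓡 4) n.1 q))) ∘
      (Subtype.val : fold s → M)) =ᶠ[𝓝 n] fun _ => (0 : ℝ) := by
    have hopen : IsOpen ((Subtype.val : fold s → M) ⁻¹' (extChartAt (𝓡 4) n.1).source) :=
      (isOpen_extChartAt_source n.1).preimage continuous_subtype_val
    filter_upwards [hopen.mem_nhds (mem_extChartAt_source (I := 𝓡 4) n.1)] with q hq
    exact (mem_fold_iff_pfaffian_inChart s n.1 hq).1 q.2
  have h0 : mfderiv (𝓡 3) 𝓘(ℝ, ℝ) ((fun q => pfaffian (s.inChart n.1 (extChartAt (𝓡 4) n.1 q))) ∘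
      (Subtype.val : fold s → M)) n = 0 := by
    rw [hzero.mfderiv_eq]
    exact mfderiv_const
  have hcomp := mfderiv_comp n hgd hval
  rw [h0] at hcomp
  have h1 : mfderiv (𝓡 4) 𝓘(ℝ, ℝ)
      (fun q => pfaffian (s.inChart n.1 (extChartAt (𝓡 4) n.1 q))) n.1 v = 0 := by
    rw [← hu, ← ContinuousLinearMap.comp_apply, ← hcomp]
    rfl
  rw [← mfderiv_pfaffian_inChart_eq hs n.1]
  exact h1

/-- **Def. 1 implies `IsFoldedForm`, in the shape of the named fact** (compact `M`): under the
hypotheses of `exists_isFoldedForm_of_transverse` on a compact Hausdorff 4-manifold there are a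
compact `3`-manifold `N` and a map `j : N → M` with `IsFoldedForm s N j` — the conclusion of
`CannasDaSilva2010_foldedForm_of_orientable` for this `s` (`N` = the fold, `j` its inclusion).
[cite: Cannasdasilva2010, Def. 1 (§2), Thm 2 (shape of the conclusion)] -/
theorem exists_isFoldedForm_of_transverse' [T2Space M] [CompactSpace M] {s : MForm (𝓡 4) M ℝ 2}
    (hs : IsSmoothForm s) (hc : IsClosedForm s)
    (htr : ∀ z ∈ fold s, fderiv ℝ (fun y => pfaffian (s.inChart z y)) (extChartAt (𝓡 4) z z) ≠ 0)
    (hmax : ∀ z ∈ fold s, ∃ v : TangentSpace (𝓡 4) z, (∀ w, s z ![v, w] = 0) ∧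
      fderiv ℝ (fun y => pfaffian (s.inChart z y)) (extChartAt (𝓡 4) z z) v ≠ 0) :
    ∃ (N : Type) (_ : TopologicalSpace N) (_ : ChartedSpace (EuclideanSpace ℝ (Fin 3)) N)
      (_ : IsManifold (𝓡 3) ∞ N) (_ : CompactSpace N) (j : N → M), IsFoldedForm s N j := by
  obtain ⟨i1, i2, h⟩ := exists_isFoldedForm_of_transverse hs hc htr hmax
  exact ⟨fold s, inferInstance, i1, i2, compactSpace_fold hs, Subtype.val, h⟩

end HypersurfaceExists

/-! ### From `IsFoldedForm` back to Def. 1: the tangent space of the fold and a transverse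
kernel vector

Conversely, the hypersurface datum of `IsFoldedForm` satisfies the printed clauses: along the
fold, `T_z Z = range (dj_n)` is the kernel of the differential of the chart Pfaffian (both are
`3`-dimensional and the chart Pfaffian vanishes on `Z`), so "`ker ω_z ⊄ T_z Z`" (the tree's
maximal-rank clause) is "some kernel vector `v` has `d(Pf)(v) ≠ 0`" (the hypothesis of
`exists_isFoldedForm_of_transverse`). Together: on a Hausdorff 4-manifold, a smooth closed
`2`-form is folded with SOME hypersurface datum iff it is folded with its own fold, iff it
satisfies Def. 1 chart-wise (`exists_isFoldedForm_iff`). -/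

section DefOneConverse

open Module

variable {M : Type*} [TopologicalSpace M] [ChartedSpace (EuclideanSpace ℝ (Fin 4)) M]
  [IsManifold (𝓡 4) ∞ M]
  {N : Type} [TopologicalSpace N] [ChartedSpace (EuclideanSpace ℝ (Fin 3)) N]
  [IsManifold (𝓡 3) ∞ N] {j : N → M}

omit [IsManifold (𝓡 3) ∞ N] in
/-- **The differential of the chart Pfaffian kills the tangent space of the fold**: for a folded
form with hypersurface `j`, `d(Pf ∘ s.inChart (j n))(centre) ∘ dj_n = 0` — the chart Pfaffian
read back on `M` (`q ↦ Pf (s.inChart (j n) (extChartAt (j n) q))`) vanishes on `range j = fold s`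
near `j n`, so the differential of its composite with `j` at `n` is zero (chain rule,
`mfderiv_pfaffian_inChart_eq`). [cite: CannasdasilvaGuilleminPires2010, Def. 2.1] -/
theorem IsFoldedForm.fderiv_pfaffian_inChart_mfderiv {s : MForm (𝓡 4) M ℝ 2}
    (h : IsFoldedForm s N j) (n : N) (u : TangentSpace (𝓡 3) n) :
    fderiv ℝ (fun y => pfaffian (s.inChart (j n) y)) (extChartAt (𝓡 4) (j n) (j n))
      (mfderiv (𝓡 3) (𝓡 4) j n u) = 0 := by
  have hgsm : ContMDiffAt (𝓡 4) 𝓘(ℝ, ℝ) ∞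
      (fun q => pfaffian (s.inChart (j n) (extChartAt (𝓡 4) (j n) q))) (j n) :=
    (contMDiffOn_pfaffian_inChart h.smooth (j n)).contMDiffAt
      ((chartAt _ (j n)).open_source.mem_nhds (mem_chart_source _ (j n)))
  have hgd : MDifferentiableAt (𝓡 4) 𝓘(ℝ, ℝ)
      (fun q => pfaffian (s.inChart (j n) (extChartAt (𝓡 4) (j n) q))) (j n) :=
    hgsm.mdifferentiableAt (by simp)
  have hjd : MDifferentiableAt (𝓡 3) (𝓡 4) j n :=
    (h.embedding.isImmersion.contMDiff n).mdifferentiableAt (by simp)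
  -- the chart Pfaffian vanishes on `range j` near `n`
  have hzero : ((fun q => pfaffian (s.inChart (j n) (extChartAt (𝓡 4) (j n) q))) ∘ j)
      =ᶠ[𝓝 n] fun _ => (0 : ℝ) := by
    have hopen : IsOpen (j ⁻¹' (extChartAt (𝓡 4) (j n)).source) :=
      (isOpen_extChartAt_source (j n)).preimage h.embedding.isEmbedding.continuous
    filter_upwards [hopen.mem_nhds (mem_extChartAt_source (I := 𝓡 4) (j n))] with m hm
    have hmf : j m ∈ fold s := by
      rw [← h.range_eq]
      exact mem_range_self m
    exact (mem_fold_iff_pfaffian_inChart s (j n) hm).1 hmf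
  have h0 : mfderiv (𝓡 3) 𝓘(ℝ, ℝ)
      ((fun q => pfaffian (s.inChart (j n) (extChartAt (𝓡 4) (j n) q))) ∘ j) n = 0 := by
    rw [hzero.mfderiv_eq]
    exact mfderiv_const
  have hcomp := mfderiv_comp n hgd hjd
  rw [h0, mfderiv_pfaffian_inChart_eq h.smooth (j n)] at hcomp
  have h1 := DFunLike.congr_fun hcomp u
  exact h1.symm

/-- **The tangent space of the folding hypersurface is the kernel of the differential of the
chart Pfaffian**: `range (dj_n) = ker d(Pf ∘ s.inChart (j n))(centre)` inside
`T_{j n} M = ℝ⁴` (the range as the span of its image, a submodule of `ℝ⁴` as in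
`IsFoldedForm.finrank_span_range_mfderiv`) — the inclusion is
`IsFoldedForm.fderiv_pfaffian_inChart_mfderiv`, and both sides are `3`-dimensional (`j` is an
immersion of a `3`-manifold; the differential is a non-zero covector by `ω ∧ ω ⋔ 0`). In print:
`T Z = ker d(ωⁿ / vol)` along the folding hypersurface `Z = {ωⁿ = 0}`.
[cite: Cannasdasilva2010, Def. 1 (§2)] -/
theorem IsFoldedForm.span_range_mfderiv_eq_ker {s : MForm (𝓡 4) M ℝ 2} (h : IsFoldedForm s N j)
    (n : N) :
    (Submodule.span ℝ (Set.range (mfderiv (𝓡 3) (𝓡 4) j n)) :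
        Submodule ℝ (EuclideanSpace ℝ (Fin 4))) =
      LinearMap.ker (fderiv ℝ (fun y => pfaffian (s.inChart (j n) y))
        (extChartAt (𝓡 4) (j n) (j n)) : EuclideanSpace ℝ (Fin 4) →ₗ[ℝ] ℝ) := by
  set ℓ : EuclideanSpace ℝ (Fin 4) →L[ℝ] ℝ :=
    fderiv ℝ (fun y => pfaffian (s.inChart (j n) y)) (extChartAt (𝓡 4) (j n) (j n)) with hℓ
  have hmem : j n ∈ fold s := by
    rw [← h.range_eq]
    exact mem_range_self n
  have hℓ0 : ℓ ≠ 0 := h.transverse (j n) hmem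
  -- `range dj ≤ ker ℓ`
  have hle : (Submodule.span ℝ (Set.range (mfderiv (𝓡 3) (𝓡 4) j n)) :
      Submodule ℝ (EuclideanSpace ℝ (Fin 4))) ≤
        LinearMap.ker (ℓ : EuclideanSpace ℝ (Fin 4) →ₗ[ℝ] ℝ) := by
    refine Submodule.span_le.2 ?_
    rintro _ ⟨u, rfl⟩
    exact LinearMap.mem_ker.2 (h.fderiv_pfaffian_inChart_mfderiv n u)
  -- dimensions: both are `3`
  have hker : finrank ℝ (LinearMap.ker (ℓ : EuclideanSpace ℝ (Fin 4) →ₗ[ℝ] ℝ)) = 3 := by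
    obtain ⟨v, hv⟩ : ∃ v, ℓ v ≠ 0 := by
      by_contra! hall
      exact hℓ0 (ContinuousLinearMap.ext hall)
    have hrange : LinearMap.range (ℓ : EuclideanSpace ℝ (Fin 4) →ₗ[ℝ] ℝ) = ⊤ := by
      rw [eq_top_iff]
      rintro c -
      refine ⟨(c / ℓ v) • v, ?_⟩
      simp [div_mul_cancel₀ c hv]
    have hsum := LinearMap.finrank_range_add_finrank_ker
      (ℓ : EuclideanSpace ℝ (Fin 4) →ₗ[ℝ] ℝ)
    rw [hrange, finrank_top, finrank_self, finrank_euclideanSpace_fin] at hsum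
    omega
  refine Submodule.eq_of_le_of_finrank_eq hle ?_
  rw [h.finrank_span_range_mfderiv n, hker]

/-- **`IsFoldedForm` implies the printed maximal-rank clause**: at every point of the folding
hypersurface some kernel vector `v` of `ω` is transverse to the fold, `d(Pf ∘ s.inChart z)(v) ≠ 0`
— the tree's clause gives `v ∈ ker ω_{j n}` outside `range (dj_n)`, which is the kernel of that
differential (`IsFoldedForm.span_range_mfderiv_eq_ker`). [cite: Cannasdasilva2010, Def. 1 (§2)] -/
theorem IsFoldedForm.exists_ker_fderiv_pfaffian_ne_zero {s : MForm (𝓡 4) M ℝ 2}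
    (h : IsFoldedForm s N j) (n : N) :
    ∃ v : TangentSpace (𝓡 4) (j n), (∀ w, s (j n) ![v, w] = 0) ∧
      fderiv ℝ (fun y => pfaffian (s.inChart (j n) y)) (extChartAt (𝓡 4) (j n) (j n)) v ≠ 0 := by
  obtain ⟨v, hv, hnot⟩ := h.maximalRank n
  refine ⟨v, hv, fun h0 => hnot ?_⟩
  have hmem : (v : EuclideanSpace ℝ (Fin 4)) ∈
      ((Submodule.span ℝ (Set.range (mfderiv (𝓡 3) (𝓡 4) j n)) :
        Submodule ℝ (EuclideanSpace ℝ (Fin 4))) : Set (EuclideanSpace ℝ (Fin 4))) := by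
    rw [h.span_range_mfderiv_eq_ker n]
    exact LinearMap.mem_ker.2 h0
  rwa [coe_span_range_mfderiv n] at hmem

/-- **`IsFoldedForm` implies Def. 1 along the whole fold** (set form of
`IsFoldedForm.exists_ker_fderiv_pfaffian_ne_zero`, through `range j = fold s`).
[cite: Cannasdasilva2010, Def. 1 (§2)] -/
theorem IsFoldedForm.exists_ker_fderiv_pfaffian_ne_zero_of_mem {s : MForm (𝓡 4) M ℝ 2}
    (h : IsFoldedForm s N j) {z : M} (hz : z ∈ fold s) :
    ∃ v : TangentSpace (𝓡 4) z, (∀ w, s z ![v, w] = 0) ∧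
      fderiv ℝ (fun y => pfaffian (s.inChart z y)) (extChartAt (𝓡 4) z z) v ≠ 0 := by
  rw [← h.range_eq] at hz
  obtain ⟨n, rfl⟩ := hz
  exact h.exists_ker_fderiv_pfaffian_ne_zero n

end DefOneConverse

/-! ### Def. 1 ⟺ `IsFoldedForm` -/

section DefOneIff

/-- **Def. 1 of the paper is equivalent to the tree's `IsFoldedForm` with some — equivalently,
with its own fold as — hypersurface datum.** For a `2`-form `s` on a Hausdorff `C^∞` 4-manifold
`M` the following are packaged as an `iff`: there are a `C^∞` `3`-manifold `N` and `j : N → M`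
with `IsFoldedForm s N j` **iff** `s` is smooth and closed, its chart Pfaffian has non-zero
derivative at every fold point (`ω ∧ ω ⋔ 0`), and at every fold point some kernel vector of `ω`
is transverse to the fold (`ı^*ω` of maximal rank) — `exists_isFoldedForm_of_transverse` and
`IsFoldedForm.exists_ker_fderiv_pfaffian_ne_zero_of_mem`.
[cite: Cannasdasilva2010, Def. 1 (§2)] [cite: CannasdasilvaGuilleminPires2010, Def. 2.1] -/
theorem exists_isFoldedForm_iff {M : Type} [TopologicalSpace M] [T2Space M]
    [ChartedSpace (EuclideanSpace ℝ (Fin 4)) M] [IsManifold (𝓡 4) ∞ M]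
    (s : MForm (𝓡 4) M ℝ 2) :
    (∃ (N : Type) (_ : TopologicalSpace N) (_ : ChartedSpace (EuclideanSpace ℝ (Fin 3)) N)
      (_ : IsManifold (𝓡 3) ∞ N) (j : N → M), IsFoldedForm s N j) ↔
    IsSmoothForm s ∧ IsClosedForm s ∧
      (∀ z ∈ fold s,
        fderiv ℝ (fun y => pfaffian (s.inChart z y)) (extChartAt (𝓡 4) z z) ≠ 0) ∧
      (∀ z ∈ fold s, ∃ v : TangentSpace (𝓡 4) z, (∀ w, s z ![v, w] = 0) ∧
        fderiv ℝ (fun y => pfaffian (s.inChart z y)) (extChartAt (𝓡 4) z z) v ≠ 0) := by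
  constructor
  · rintro ⟨N, _, _, _, j, h⟩
    exact ⟨h.smooth, h.closed, h.transverse, fun z hz =>
      h.exists_ker_fderiv_pfaffian_ne_zero_of_mem hz⟩
  · rintro ⟨hs, hc, htr, hmax⟩
    obtain ⟨i1, i2, h⟩ := exists_isFoldedForm_of_transverse hs hc htr hmax
    exact ⟨fold s, inferInstance, i1, i2, Subtype.val, h⟩

end DefOneIff

/-! ### Def. 1 is local: restriction to open submanifolds

The four clauses of Def. 1 (smooth, closed, `ω ∧ ω ⋔ 0` at the fold points, a transverse kernel
vector at the fold points) are conditions at single points read in the preferred charts, and the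
charts of an open submanifold `U ⊆ M` are the restricted charts of `M`
(`TopologicalSpace.Opens.instChartedSpace`): so each clause holds for `s` at `x ∈ U` iff it holds
for the restriction `s|_U = val^* s` at `x`. Hence Def. 1 may be checked on an open cover, and
forms given on the connected components (open, as manifolds are locally connected) assemble. -/

section OpensRestrict

variable {M : Type*} [TopologicalSpace M] [ChartedSpace (EuclideanSpace ℝ (Fin 4)) M]

/-- The extended chart of an open submanifold at `x` is the extended chart of `M` at `x`, read on
`U` (`TopologicalSpace.Opens.chartAt_eq`). [folklore] -/
theorem opens_extChartAt_apply (U : TopologicalSpace.Opens M) (x q : U) :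
    extChartAt (𝓡 4) x q = extChartAt (𝓡 4) (x : M) (q : M) := rfl

/-- The target of the extended chart of an open submanifold lies in the target of the extended
chart of `M` (`OpenPartialHomeomorph.subtypeRestr_target_subset`). [folklore] -/
theorem opens_extChartAt_target_subset (U : TopologicalSpace.Opens M) (x : U) :
    (extChartAt (𝓡 4) x).target ⊆ (extChartAt (𝓡 4) (x : M)).target := by
  have hU : Nonempty U := ⟨x⟩
  intro y hy
  simp only [extChartAt_target, ModelWithCorners.Boundaryless.range_eq_univ, inter_univ,
    mem_preimage, TopologicalSpace.Opens.chartAt_eq] at hy ⊢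
  exact (chartAt (EuclideanSpace ℝ (Fin 4)) (x : M)).subtypeRestr_target_subset hU hy

/-- The inverse extended chart of an open submanifold is the inverse extended chart of `M`, on
the target of the former (`OpenPartialHomeomorph.subtypeRestr_symm_apply`). [folklore] -/
theorem opens_val_extChartAt_symm (U : TopologicalSpace.Opens M) (x : U)
    {y : EuclideanSpace ℝ (Fin 4)} (hy : y ∈ (extChartAt (𝓡 4) x).target) :
    (((extChartAt (𝓡 4) x).symm y : U) : M) = (extChartAt (𝓡 4) (x : M)).symm y := by
  have hU : Nonempty U := ⟨x⟩
  have hy' : (𝓡 4).symm y ∈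
      ((chartAt (EuclideanSpace ℝ (Fin 4)) (x : M)).subtypeRestr hU).target := by
    simp only [extChartAt_target, ModelWithCorners.Boundaryless.range_eq_univ, inter_univ,
      mem_preimage, TopologicalSpace.Opens.chartAt_eq] at hy
    exact hy
  exact (chartAt (EuclideanSpace ℝ (Fin 4)) (x : M)).subtypeRestr_symm_apply hU hy'

/-- The inclusion of an open submanifold, written in the extended charts at `x` and `↑x`, is the
identity on the target of the chart of `U`. [folklore] -/
theorem opens_writtenInExtChartAt_subtypeVal (U : TopologicalSpace.Opens M) (x : U)
    {y : EuclideanSpace ℝ (Fin 4)} (hy : y ∈ (extChartAt (𝓡 4) x).target) :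
    writtenInExtChartAt (𝓡 4) (𝓡 4) x (Subtype.val : U → M) y = y := by
  simp only [writtenInExtChartAt, Function.comp_apply]
  rw [opens_val_extChartAt_symm U x hy]
  exact (extChartAt (𝓡 4) (x : M)).right_inv (opens_extChartAt_target_subset U x hy)

variable [IsManifold (𝓡 4) ∞ M]

/-- **The chart representative of the restriction `s|_U` at `x ∈ U` is the chart representative
of `s` at `x`, near the centre** — by the pull-back formula for chart representatives
(`MForm.inChart_pullback_eventuallyEq`) with `f = val`, whose written-in-charts form is the
identity near the centre. [folklore] -/
theorem opens_inChart_pullback_subtypeVal_eventuallyEq (U : TopologicalSpace.Opens M)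
    (s : MForm (𝓡 4) M ℝ 2) (x : U) :
    (s.pullback (𝓡 4) (Subtype.val : U → M)).inChart x =ᶠ[𝓝 (extChartAt (𝓡 4) x x)]
      s.inChart (x : M) := by
  have hval : ∀ᶠ z in 𝓝 x, MDifferentiableAt (𝓡 4) (𝓡 4) (Subtype.val : U → M) z :=
    Eventually.of_forall fun z =>
      ((contMDiff_subtype_val (n := ∞) (U := U)) z).mdifferentiableAt (by simp)
  have hev := s.inChart_pullback_eventuallyEq (I := 𝓡 4) (I' := 𝓡 4) hval
  rw [ModelWithCorners.Boundaryless.range_eq_univ, nhdsWithin_univ] at hev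
  -- the inclusion written in charts is the identity near every point of the target
  have hg : ∀ᶠ y in 𝓝 (extChartAt (𝓡 4) x x),
      writtenInExtChartAt (𝓡 4) (𝓡 4) x (Subtype.val : U → M) =ᶠ[𝓝 y] id := by
    filter_upwards [extChartAt_target_mem_nhds (I := 𝓡 4) x] with y hy
    filter_upwards [(isOpen_extChartAt_target (I := 𝓡 4) x).mem_nhds hy] with y' hy'
    exact opens_writtenInExtChartAt_subtypeVal U x hy'
  filter_upwards [hev, hg] with y hy hgy
  simp only [hy]
  rw [fderivWithin_univ, hgy.fderiv_eq, fderiv_id, hgy.self_of_nhds, id]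
  ext v
  simp only [ContinuousAlternatingMap.compContinuousLinearMap_apply]
  rfl

/-- Smoothness at `x ∈ U` of the restriction `s|_U` is smoothness of `s` at `x`. [folklore] -/
theorem opens_smoothAt_pullback_subtypeVal_iff (U : TopologicalSpace.Opens M)
    (s : MForm (𝓡 4) M ℝ 2) (x : U) :
    (s.pullback (𝓡 4) (Subtype.val : U → M)).SmoothAt x ↔ s.SmoothAt (x : M) := by
  have hev := opens_inChart_pullback_subtypeVal_eventuallyEq U s x
  simp only [MForm.SmoothAt, ModelWithCorners.Boundaryless.range_eq_univ, contDiffWithinAt_univ]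
  exact ⟨fun h => h.congr_of_eventuallyEq hev.symm, fun h => h.congr_of_eventuallyEq hev⟩

/-- Closedness at `x ∈ U` of the restriction `s|_U` is closedness of `s` at `x`, for `s` smooth at
`x` (`mextDeriv_pullback_subtypeVal_apply`). [folklore] -/
theorem opens_mextDeriv_pullback_subtypeVal_eq_zero_iff (U : TopologicalSpace.Opens M)
    {s : MForm (𝓡 4) M ℝ 2} {x : U} (hs : s.SmoothAt (x : M)) :
    mextDeriv (s.pullback (𝓡 4) (Subtype.val : U → M)) x = 0 ↔ mextDeriv s (x : M) = 0 := by
  constructor <;> intro h <;> ext v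
  · rw [← mextDeriv_pullback_subtypeVal_apply (I := 𝓡 4) hs v, h]
    rfl
  · rw [mextDeriv_pullback_subtypeVal_apply (I := 𝓡 4) hs v, h]
    rfl

omit [IsManifold (𝓡 4) ∞ M] in
/-- The fold of the restriction `s|_U` is the trace of the fold of `s`
(`MForm.pullback_subtypeVal_apply`). [folklore] -/
theorem opens_mem_fold_pullback_subtypeVal_iff (U : TopologicalSpace.Opens M)
    (s : MForm (𝓡 4) M ℝ 2) (x : U) :
    x ∈ fold (s.pullback (𝓡 4) (Subtype.val : U → M)) ↔ (x : M) ∈ fold s := by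
  simp only [mem_fold_iff, MForm.pullback_subtypeVal_apply]
  exact Iff.rfl

/-- The differential at the centre of the chart Pfaffian of the restriction `s|_U` at `x ∈ U` is
that of `s` at `x` (the chart representatives agree near the centre). [folklore] -/
theorem opens_fderiv_pfaffian_inChart_pullback_subtypeVal (U : TopologicalSpace.Opens M)
    (s : MForm (𝓡 4) M ℝ 2) (x : U) :
    fderiv ℝ (fun y => pfaffian ((s.pullback (𝓡 4) (Subtype.val : U → M)).inChart x y))
        (extChartAt (𝓡 4) x x) =
      fderiv ℝ (fun y => pfaffian (s.inChart (x : M) y)) (extChartAt (𝓡 4) (x : M) x) :=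
  ((opens_inChart_pullback_subtypeVal_eventuallyEq U s x).fun_comp pfaffian).fderiv_eq

/-! #### Def. 1 on an open cover -/

/-- A form whose restrictions to the members of an open cover are smooth is smooth. [folklore] -/
theorem isSmoothForm_of_opens_cover {ι : Type*} (U : ι → TopologicalSpace.Opens M)
    (hU : ∀ x, ∃ i, x ∈ U i) {s : MForm (𝓡 4) M ℝ 2}
    (h : ∀ i, IsSmoothForm (s.pullback (𝓡 4) (Subtype.val : U i → M))) : IsSmoothForm s := by
  intro x
  obtain ⟨i, hx⟩ := hU x
  exact (opens_smoothAt_pullback_subtypeVal_iff (U i) s ⟨x, hx⟩).1 (h i ⟨x, hx⟩)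

/-- A smooth form whose restrictions to the members of an open cover are closed is closed.
[folklore] -/
theorem isClosedForm_of_opens_cover {ι : Type*} (U : ι → TopologicalSpace.Opens M)
    (hU : ∀ x, ∃ i, x ∈ U i) {s : MForm (𝓡 4) M ℝ 2} (hs : IsSmoothForm s)
    (h : ∀ i, IsClosedForm (s.pullback (𝓡 4) (Subtype.val : U i → M))) : IsClosedForm s := by
  unfold IsClosedForm
  funext x
  obtain ⟨i, hx⟩ := hU x
  have h2 : mextDeriv (s.pullback (𝓡 4) (Subtype.val : U i → M)) = 0 := h i
  ext v
  have key := mextDeriv_pullback_subtypeVal_apply (I := 𝓡 4) (U := U i) (x := ⟨x, hx⟩) (hs x) v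
  rw [h2] at key
  rw [← key]
  rfl

/-- `ω ∧ ω ⋔ 0` along the fold holds for `s` if it holds for its restrictions to the members of an
open cover. [folklore] -/
theorem transverse_of_opens_cover {ι : Type*} (U : ι → TopologicalSpace.Opens M)
    (hU : ∀ x, ∃ i, x ∈ U i) {s : MForm (𝓡 4) M ℝ 2}
    (h : ∀ i, ∀ z ∈ fold (s.pullback (𝓡 4) (Subtype.val : U i → M)),
      fderiv ℝ (fun y => pfaffian ((s.pullback (𝓡 4) (Subtype.val : U i → M)).inChart z y))
        (extChartAt (𝓡 4) z z) ≠ 0) :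
    ∀ z ∈ fold s, fderiv ℝ (fun y => pfaffian (s.inChart z y)) (extChartAt (𝓡 4) z z) ≠ 0 := by
  intro z hz
  obtain ⟨i, hzU⟩ := hU z
  have hz' : (⟨z, hzU⟩ : U i) ∈ fold (s.pullback (𝓡 4) (Subtype.val : U i → M)) :=
    (opens_mem_fold_pullback_subtypeVal_iff (U i) s ⟨z, hzU⟩).2 hz
  have h1 := h i _ hz'
  rwa [opens_fderiv_pfaffian_inChart_pullback_subtypeVal (U i) s ⟨z, hzU⟩] at h1

/-- A transverse kernel vector at the fold points exists for `s` if it exists for its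
restrictions to the members of an open cover. [folklore] -/
theorem maximalRank_of_opens_cover {ι : Type*} (U : ι → TopologicalSpace.Opens M)
    (hU : ∀ x, ∃ i, x ∈ U i) {s : MForm (𝓡 4) M ℝ 2}
    (h : ∀ i, ∀ z ∈ fold (s.pullback (𝓡 4) (Subtype.val : U i → M)),
      ∃ v : TangentSpace (𝓡 4) z,
        (∀ w, (s.pullback (𝓡 4) (Subtype.val : U i → M)) z ![v, w] = 0) ∧
        fderiv ℝ (fun y => pfaffian ((s.pullback (𝓡 4) (Subtype.val : U i → M)).inChart z y))
          (extChartAt (𝓡 4) z z) v ≠ 0) :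
    ∀ z ∈ fold s, ∃ v : TangentSpace (𝓡 4) z, (∀ w, s z ![v, w] = 0) ∧
      fderiv ℝ (fun y => pfaffian (s.inChart z y)) (extChartAt (𝓡 4) z z) v ≠ 0 := by
  intro z hz
  obtain ⟨i, hzU⟩ := hU z
  obtain ⟨v, hv, hdv⟩ := h i ⟨z, hzU⟩
    ((opens_mem_fold_pullback_subtypeVal_iff (U i) s ⟨z, hzU⟩).2 hz)
  refine ⟨v, fun w => ?_, ?_⟩
  · have h1 := hv w
    rwa [MForm.pullback_subtypeVal_apply] at h1
  · rwa [opens_fderiv_pfaffian_inChart_pullback_subtypeVal (U i) s ⟨z, hzU⟩] at hdv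

/-! #### Assembly over an open partition -/

/-- **Assembly of Def. 1 forms over an open partition.** For open sets `U i` and an index
function `idx` with `x ∈ U (idx x)` and `idx = i` on `U i` (so the `U i` in the image of `idx`
partition `M`), `2`-forms `t i` on the open submanifolds `U i`, each satisfying Def. 1, assemble
to the form `s x = t (idx x) x` on `M`, which restricts to `t i` on each `U i` and satisfies
Def. 1 (the clauses are local: `isSmoothForm_of_opens_cover`, …, `maximalRank_of_opens_cover`).
[folklore] -/
theorem exists_def_one_of_opens_partition {ι : Type*} (U : ι → TopologicalSpace.Opens M)
    (idx : M → ι) (hidx : ∀ x, x ∈ U (idx x)) (huniq : ∀ i, ∀ q : U i, idx q = i)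
    (t : ∀ i, MForm (𝓡 4) (U i) ℝ 2)
    (hts : ∀ i, IsSmoothForm (t i)) (htc : ∀ i, IsClosedForm (t i))
    (httr : ∀ i, ∀ z ∈ fold (t i),
      fderiv ℝ (fun y => pfaffian ((t i).inChart z y)) (extChartAt (𝓡 4) z z) ≠ 0)
    (htmax : ∀ i, ∀ z ∈ fold (t i), ∃ v : TangentSpace (𝓡 4) z, (∀ w, t i z ![v, w] = 0) ∧
      fderiv ℝ (fun y => pfaffian ((t i).inChart z y)) (extChartAt (𝓡 4) z z) v ≠ 0) :
    ∃ s : MForm (𝓡 4) M ℝ 2,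
      (∀ i, s.pullback (𝓡 4) (Subtype.val : U i → M) = t i) ∧
      IsSmoothForm s ∧ IsClosedForm s ∧
      (∀ z ∈ fold s,
        fderiv ℝ (fun y => pfaffian (s.inChart z y)) (extChartAt (𝓡 4) z z) ≠ 0) ∧
      (∀ z ∈ fold s, ∃ v : TangentSpace (𝓡 4) z, (∀ w, s z ![v, w] = 0) ∧
        fderiv ℝ (fun y => pfaffian (s.inChart z y)) (extChartAt (𝓡 4) z z) v ≠ 0) := by
  let s : MForm (𝓡 4) M ℝ 2 := fun x => t (idx x) ⟨x, hidx x⟩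
  have hres : ∀ i, s.pullback (𝓡 4) (Subtype.val : U i → M) = t i := by
    intro i
    funext q
    obtain ⟨y, hy⟩ := q
    have hqi : idx y = i := huniq i ⟨y, hy⟩
    subst hqi
    ext v
    rw [MForm.pullback_subtypeVal_apply]
    rfl
  have hU : ∀ x : M, ∃ i, x ∈ U i := fun x => ⟨idx x, hidx x⟩
  have hs : IsSmoothForm s :=
    isSmoothForm_of_opens_cover U hU fun i => by rw [hres i]; exact hts i
  refine ⟨s, hres, hs, ?_, ?_, ?_⟩
  · exact isClosedForm_of_opens_cover U hU hs fun i => by rw [hres i]; exact htc i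
  · exact transverse_of_opens_cover U hU fun i => by rw [hres i]; exact httr i
  · exact maximalRank_of_opens_cover U hU fun i => by rw [hres i]; exact htmax i

end OpensRestrict

/-! ### Reduction of the named fact to connected `M` -/

section Reduction

open Literature.Topology.FourManifolds

/-- **The named fact reduces to connected manifolds.** If every CONNECTED compact orientable
Hausdorff second-countable `C^∞` 4-manifold carries a `2`-form satisfying Def. 1 chart-wise
(smooth, closed, `ω ∧ ω ⋔ 0` along the fold, a transverse kernel vector at each fold point — the
printed conclusion of Theorem 2 for connected `M`, before the folding hypersurface is packaged
as data), then `CannasDaSilva2010_foldedForm_of_orientable` holds: the connected components of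
`M` are open (a manifold is locally connected), closed hence compact, connected, and oriented
by restriction (`SmoothOrientation.restrict`); apply the hypothesis to each, assemble over this
open partition (`exists_def_one_of_opens_partition`), and package the fold as the hypersurface
datum (`exists_isFoldedForm_of_transverse'`). This isolates exactly the h-principle core of the
printed proof (§§3–6, which take `M` connected). [cite: Cannasdasilva2010, Theorem 2 and §6] -/
theorem cannasDaSilva2010_foldedForm_of_orientable_of_connected
    (h : ∀ (M : Type) [TopologicalSpace M] [T2Space M] [SecondCountableTopology M]
      [CompactSpace M] [ConnectedSpace M] [ChartedSpace (EuclideanSpace ℝ (Fin 4)) M]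
      [IsManifold (𝓡 4) ∞ M], Nonempty (SmoothOrientation (𝓡 4) M) →
      ∃ s : MForm (𝓡 4) M ℝ 2, IsSmoothForm s ∧ IsClosedForm s ∧
        (∀ z ∈ fold s,
          fderiv ℝ (fun y => pfaffian (s.inChart z y)) (extChartAt (𝓡 4) z z) ≠ 0) ∧
        (∀ z ∈ fold s, ∃ v : TangentSpace (𝓡 4) z, (∀ w, s z ![v, w] = 0) ∧
          fderiv ℝ (fun y => pfaffian (s.inChart z y)) (extChartAt (𝓡 4) z z) v ≠ 0)) :
    CannasDaSilva2010_foldedForm_of_orientable := by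
  intro M _ _ _ _ _ _ hM
  obtain ⟨o⟩ := hM
  haveI : LocallyConnectedSpace M :=
    ChartedSpace.locallyConnectedSpace (EuclideanSpace ℝ (Fin 4)) M
  -- the connected components, as open subsets
  have hopen : ∀ c : ConnectedComponents M, IsOpen (ConnectedComponents.mk ⁻¹' {c}) := by
    intro c
    obtain ⟨x, rfl⟩ := ConnectedComponents.surjective_coe c
    rw [connectedComponents_preimage_singleton]
    exact isOpen_connectedComponent
  let U : ConnectedComponents M → TopologicalSpace.Opens M := fun c =>
    ⟨ConnectedComponents.mk ⁻¹' {c}, hopen c⟩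
  have hUc : ∀ x : M, ((U (ConnectedComponents.mk x) : TopologicalSpace.Opens M) : Set M) =
      connectedComponent x := fun x => connectedComponents_preimage_singleton
  have hcpt : ∀ c, CompactSpace (U c) := by
    intro c
    obtain ⟨x, rfl⟩ := ConnectedComponents.surjective_coe c
    have h1 : IsCompact ((U (ConnectedComponents.mk x) : TopologicalSpace.Opens M) : Set M) := by
      rw [hUc]
      exact isClosed_connectedComponent.isCompact
    exact isCompact_iff_compactSpace.1 h1
  have hconn : ∀ c, ConnectedSpace (U c) := by
    intro c
    obtain ⟨x, rfl⟩ := ConnectedComponents.surjective_coe c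
    have h1 : IsConnected ((U (ConnectedComponents.mk x) : TopologicalSpace.Opens M) : Set M) := by
      rw [hUc]
      exact isConnected_connectedComponent
    exact isConnected_iff_connectedSpace.1 h1
  have hc : ∀ c : ConnectedComponents M, ∃ t : MForm (𝓡 4) (U c) ℝ 2,
      IsSmoothForm t ∧ IsClosedForm t ∧
        (∀ z ∈ fold t,
          fderiv ℝ (fun y => pfaffian (t.inChart z y)) (extChartAt (𝓡 4) z z) ≠ 0) ∧
        (∀ z ∈ fold t, ∃ v : TangentSpace (𝓡 4) z, (∀ w, t z ![v, w] = 0) ∧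
          fderiv ℝ (fun y => pfaffian (t.inChart z y)) (extChartAt (𝓡 4) z z) v ≠ 0) := by
    intro c
    haveI := hcpt c
    haveI := hconn c
    exact h (U c) ⟨o.restrict (U c)⟩
  choose t hts htc httr htmax using hc
  obtain ⟨s, -, hs, hsc, hstr, hsmax⟩ :=
    exists_def_one_of_opens_partition U ConnectedComponents.mk (fun x => rfl) (fun c q => q.2)
      t hts htc httr htmax
  exact ⟨s, exists_isFoldedForm_of_transverse' hs hsc hstr hsmax⟩

end Reduction

/-! ### The contact-type fold model `d(F(x₀) · b)`: doubles of `ω`-convex manifolds are folded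

Source, §2: *"Doubles of symplectic manifolds with `ω`-convex (or `ω`-concave) boundary are easy
examples of manifolds with folded symplectic forms."*  In a bicollar `(-ε, ε) × H` of the seam
of such a double (`t` the Liouville parameter, `α` the contact form induced on the
`ω`-convex boundary `H`) the doubled form is `d(f(t) α)` for a positive profile `f` with a single
non-degenerate critical point on the seam — Baykur's local model `([-1, 1] × H, d((t² + 1) π^*α))`
of a folded Kähler structure (Baykur 2006, Def. 2 and proof of Thm. 6.1).  This section proves
the computation behind it, read in a chart `ℝ⁴ = ℝ × ℝ³`: for `λ = F(x₀) · b` with `b` a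
covector field pulled back from the slices (`b(e₀) = 0`, `∂₀ b = 0`), the `2`-form `s = dλ`
has `Pf(s) = F F' · (b ∧ db)(e₁, e₂, e₃)` (`pfaffian_contactFoldForm`), so at the points of
`{F' = 0}` with `F F'' (b ∧ db)(e₁, e₂, e₃) ≠ 0` the clauses of Def. 1 hold with the transverse
kernel vector `e₀` (`contactFoldForm_def_one_at`, stated on an open set for use in charts); the
global model is a folded symplectic form on `ℝ⁴` (`exists_isFoldedForm_contactFoldForm`), in
particular Baykur's `d((x₀² + 1)(dx₃ + x₁ dx₂))`, folded along the hyperplane `{x₀ = 0}`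
(`exists_isFoldedForm_baykurFoldModel`). -/

section ContactFoldModel

/-- Covectors on `ℝ⁴` as `1`-forms (`ContinuousAlternatingMap.ofSubsingletonLIE`). [folklore] -/
def covectorToOneForm :
    (EuclideanSpace ℝ (Fin 4) →L[ℝ] ℝ) ≃ₗᵢ[ℝ] (EuclideanSpace ℝ (Fin 4)) [⋀^Fin 1]→L[ℝ] ℝ :=
  ContinuousAlternatingMap.ofSubsingletonLIE (0 : Fin 1)

/-- `covectorToOneForm f v = f (v 0)`. [folklore] -/
@[simp]
theorem covectorToOneForm_apply (f : EuclideanSpace ℝ (Fin 4) →L[ℝ] ℝ)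
    (v : Fin 1 → EuclideanSpace ℝ (Fin 4)) : covectorToOneForm f v = f (v 0) := rfl

/-- The `1`-form `λ_x = F(x₀) · b_x` on `ℝ⁴` built from a profile `F : ℝ → ℝ` and a covector
field `b`. [folklore] -/
def foldPrimitive (F : ℝ → ℝ)
    (b : EuclideanSpace ℝ (Fin 4) → EuclideanSpace ℝ (Fin 4) →L[ℝ] ℝ) :
    EuclideanSpace ℝ (Fin 4) → (EuclideanSpace ℝ (Fin 4)) [⋀^Fin 1]→L[ℝ] ℝ := fun x =>
  F (x 0) • covectorToOneForm (b x)

/-- The **contact-type fold model** `s = d(F(x₀) · b)`, a `2`-form on `ℝ⁴`. [folklore] -/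
def contactFoldForm (F : ℝ → ℝ)
    (b : EuclideanSpace ℝ (Fin 4) → EuclideanSpace ℝ (Fin 4) →L[ℝ] ℝ) :
    MForm (𝓡 4) (EuclideanSpace ℝ (Fin 4)) ℝ 2 := fun x =>
  extDeriv (foldPrimitive F b) x

/-- The derivative of `λ = F(x₀) · b`: `Dλ_x(u) = F(x₀) · Db_x(u) + F'(x₀) u₀ · b_x`. [folklore] -/
theorem hasFDerivAt_foldPrimitive {F : ℝ → ℝ} {F' : ℝ}
    {b : EuclideanSpace ℝ (Fin 4) → EuclideanSpace ℝ (Fin 4) →L[ℝ] ℝ}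
    {b' : EuclideanSpace ℝ (Fin 4) →L[ℝ] EuclideanSpace ℝ (Fin 4) →L[ℝ] ℝ}
    {x : EuclideanSpace ℝ (Fin 4)} (hF : HasDerivAt F F' (x 0)) (hb : HasFDerivAt b b' x) :
    HasFDerivAt (foldPrimitive F b)
      (F (x 0) • (covectorToOneForm.toContinuousLinearEquiv :
          (EuclideanSpace ℝ (Fin 4) →L[ℝ] ℝ) →L[ℝ] (EuclideanSpace ℝ (Fin 4)) [⋀^Fin 1]→L[ℝ] ℝ).comp
            b' +
        (F' • (EuclideanSpace.proj (0 : Fin 4) : EuclideanSpace ℝ (Fin 4) →L[ℝ] ℝ)).smulRight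
          (covectorToOneForm (b x))) x := by
  have hφ : HasFDerivAt (fun y : EuclideanSpace ℝ (Fin 4) => F (y 0))
      (F' • (EuclideanSpace.proj (0 : Fin 4) : EuclideanSpace ℝ (Fin 4) →L[ℝ] ℝ)) x :=
    hF.comp_hasFDerivAt x (hasStrictFDerivAt_coord 0 x).hasFDerivAt
  have hΛ := (covectorToOneForm.toContinuousLinearEquiv.hasFDerivAt).comp x hb
  exact hφ.smul hΛ

/-- **The fold model on pairs of vectors**:
`s_x(u, v) = F(x₀) (Db_x(u)(v) - Db_x(v)(u)) + F'(x₀) (u₀ b_x(v) - v₀ b_x(u))`. [folklore] -/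
theorem extDeriv_foldPrimitive_apply_two {F : ℝ → ℝ} {F' : ℝ}
    {b : EuclideanSpace ℝ (Fin 4) → EuclideanSpace ℝ (Fin 4) →L[ℝ] ℝ}
    {b' : EuclideanSpace ℝ (Fin 4) →L[ℝ] EuclideanSpace ℝ (Fin 4) →L[ℝ] ℝ}
    {x : EuclideanSpace ℝ (Fin 4)} (hF : HasDerivAt F F' (x 0)) (hb : HasFDerivAt b b' x)
    (u v : EuclideanSpace ℝ (Fin 4)) :
    extDeriv (foldPrimitive F b) x ![u, v] =
      F (x 0) * (b' u v - b' v u) + F' * (u 0 * b x v - v 0 * b x u) := by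
  rw [extDeriv, (hasFDerivAt_foldPrimitive hF hb).fderiv,
    ContinuousAlternatingMap.alternatizeUncurryFin_apply]
  simp [Fin.sum_univ_two, Fin.removeNth]
  ring

/-- `(b ∧ db)(e₁, e₂, e₃)` for a covector `β = b_x` and a derivative `β' = Db_x`, with
`db(eᵢ, eⱼ) = Db(eᵢ)(eⱼ) - Db(eⱼ)(eᵢ)`: the contact volume of the slice form. [folklore] -/
def sliceContactVolume (β : EuclideanSpace ℝ (Fin 4) →L[ℝ] ℝ)
    (β' : EuclideanSpace ℝ (Fin 4) →L[ℝ] EuclideanSpace ℝ (Fin 4) →L[ℝ] ℝ) : ℝ :=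
  β (stdVec 1) * (β' (stdVec 2) (stdVec 3) - β' (stdVec 3) (stdVec 2)) -
    β (stdVec 2) * (β' (stdVec 1) (stdVec 3) - β' (stdVec 3) (stdVec 1)) +
    β (stdVec 3) * (β' (stdVec 1) (stdVec 2) - β' (stdVec 2) (stdVec 1))

/-- **The Pfaffian of the fold model**: if `b_x(e₀) = 0`, `Db_x(e₀) = 0` and `Db_x(·)(e₀) = 0`
(the slice form is pulled back from the last three coordinates), then
`Pf(s_x) = F(x₀) F'(x₀) · (b ∧ db)(e₁, e₂, e₃)` — from `s_x(e₀, eⱼ) = F'(x₀) b_x(eⱼ)` and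
`s_x(eᵢ, eⱼ) = F(x₀) db_x(eᵢ, eⱼ)` for `i, j ≥ 1`. [folklore] -/
theorem pfaffian_contactFoldForm {F : ℝ → ℝ} {F' : ℝ}
    {b : EuclideanSpace ℝ (Fin 4) → EuclideanSpace ℝ (Fin 4) →L[ℝ] ℝ}
    {b' : EuclideanSpace ℝ (Fin 4) →L[ℝ] EuclideanSpace ℝ (Fin 4) →L[ℝ] ℝ}
    {x : EuclideanSpace ℝ (Fin 4)} (hF : HasDerivAt F F' (x 0)) (hb : HasFDerivAt b b' x)
    (hb0 : b x (stdVec 0) = 0) (hb'0 : b' (stdVec 0) = 0) (hb'1 : ∀ v, b' v (stdVec 0) = 0) :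
    pfaffian (contactFoldForm F b x) = F (x 0) * F' * sliceContactVolume (b x) b' := by
  show pfaffian (extDeriv (foldPrimitive F b) x) = _
  simp only [pfaffian, extDeriv_foldPrimitive_apply_two hF hb, hb0, hb'0, hb'1,
    sliceContactVolume]
  simp [stdVec_apply]
  ring

/-- **`e₀` pairs to `F'(x₀) b_x(w)` under the fold model** (under the pull-back hypotheses on
`b`): `s_x(e₀, w) = F'(x₀) b_x(w)`, which vanishes where `F'(x₀) = 0`. [folklore] -/
theorem contactFoldForm_stdVec_zero {F : ℝ → ℝ} {F' : ℝ}
    {b : EuclideanSpace ℝ (Fin 4) → EuclideanSpace ℝ (Fin 4) →L[ℝ] ℝ}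
    {b' : EuclideanSpace ℝ (Fin 4) →L[ℝ] EuclideanSpace ℝ (Fin 4) →L[ℝ] ℝ}
    {x : EuclideanSpace ℝ (Fin 4)} (hF : HasDerivAt F F' (x 0)) (hb : HasFDerivAt b b' x)
    (hb0 : b x (stdVec 0) = 0) (hb'0 : b' (stdVec 0) = 0) (hb'1 : ∀ v, b' v (stdVec 0) = 0)
    (w : EuclideanSpace ℝ (Fin 4)) :
    contactFoldForm F b x ![stdVec 0, w] = F' * b x w := by
  show extDeriv (foldPrimitive F b) x ![stdVec 0, w] = _
  rw [extDeriv_foldPrimitive_apply_two hF hb, hb0, hb'0, hb'1]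
  simp [stdVec_apply]

/-! #### The fold model near a point: local hypotheses on an open set -/

/-- If `b_y(e₀) = 0` on an open set, then `Db_y(v)(e₀) = 0` there. [folklore] -/
theorem fderiv_apply_stdVec_zero_eq_zero
    {b : EuclideanSpace ℝ (Fin 4) → EuclideanSpace ℝ (Fin 4) →L[ℝ] ℝ}
    {O : Set (EuclideanSpace ℝ (Fin 4))} (hO : IsOpen O) (hbd : DifferentiableOn ℝ b O)
    (hb0 : ∀ y ∈ O, b y (stdVec 0) = 0) {y : EuclideanSpace ℝ (Fin 4)} (hy : y ∈ O)
    (v : EuclideanSpace ℝ (Fin 4)) : fderiv ℝ b y v (stdVec 0) = 0 := by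
  have hd : HasFDerivAt b (fderiv ℝ b y) y :=
    ((hbd y hy).differentiableAt (hO.mem_nhds hy)).hasFDerivAt
  have h1 : HasFDerivAt (fun y' => b y' (stdVec 0)) ((fderiv ℝ b y).flip (stdVec 0)) y := by
    have := hd.clm_apply (hasFDerivAt_const (stdVec 0 : EuclideanSpace ℝ (Fin 4)) y)
    simpa using this
  have h2 : HasFDerivAt (fun y' => b y' (stdVec 0))
      (0 : EuclideanSpace ℝ (Fin 4) →L[ℝ] ℝ) y := by
    refine (hasFDerivAt_const (0 : ℝ) y).congr_of_eventuallyEq ?_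
    filter_upwards [hO.mem_nhds hy] with y' hy'
    exact hb0 y' hy'
  have h3 := h1.unique h2
  have h4 := congrArg (fun L : EuclideanSpace ℝ (Fin 4) →L[ℝ] ℝ => L v) h3
  simpa using h4

/-- **The chart Pfaffian of the fold model as a function**, on an open set `O` where `b` is
differentiable and pulled back from the slices: `Pf(s_y) = F(y₀) F'(y₀) (b ∧ db)_y(e₁,e₂,e₃)`.
[folklore] -/
theorem pfaffian_contactFoldForm_eqOn {F : ℝ → ℝ} (hF : Differentiable ℝ F)
    {b : EuclideanSpace ℝ (Fin 4) → EuclideanSpace ℝ (Fin 4) →L[ℝ] ℝ}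
    {O : Set (EuclideanSpace ℝ (Fin 4))} (hO : IsOpen O) (hbd : DifferentiableOn ℝ b O)
    (hb0 : ∀ y ∈ O, b y (stdVec 0) = 0) (hb1 : ∀ y ∈ O, fderiv ℝ b y (stdVec 0) = 0) :
    EqOn (fun y => pfaffian (contactFoldForm F b y))
      (fun y => F (y 0) * deriv F (y 0) * sliceContactVolume (b y) (fderiv ℝ b y)) O := by
  intro y hy
  have hd : HasFDerivAt b (fderiv ℝ b y) y :=
    ((hbd y hy).differentiableAt (hO.mem_nhds hy)).hasFDerivAt
  exact pfaffian_contactFoldForm (hF (y 0)).hasDerivAt hd (hb0 y hy) (hb1 y hy)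
    (fderiv_apply_stdVec_zero_eq_zero hO hbd hb0 hy)

/-- The slice contact volume `y ↦ (b ∧ db)_y(e₁,e₂,e₃)` is differentiable where `b` is `C^∞`.
[folklore] -/
theorem differentiableAt_sliceContactVolume
    {b : EuclideanSpace ℝ (Fin 4) → EuclideanSpace ℝ (Fin 4) →L[ℝ] ℝ}
    {O : Set (EuclideanSpace ℝ (Fin 4))} (hO : IsOpen O) (hb : ContDiffOn ℝ ∞ b O)
    {y : EuclideanSpace ℝ (Fin 4)} (hy : y ∈ O) :
    DifferentiableAt ℝ (fun y => sliceContactVolume (b y) (fderiv ℝ b y)) y := by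
  have hbA : ContDiffAt ℝ ∞ b y := hb.contDiffAt (hO.mem_nhds hy)
  have hbd : DifferentiableAt ℝ b y := hbA.differentiableAt (by simp)
  have hb'A : ContDiffAt ℝ ∞ (fderiv ℝ b) y :=
    (hb.fderiv_of_isOpen hO le_rfl).contDiffAt (hO.mem_nhds hy)
  have hb'd : DifferentiableAt ℝ (fderiv ℝ b) y := hb'A.differentiableAt (by simp)
  have e1 : ∀ v : EuclideanSpace ℝ (Fin 4), DifferentiableAt ℝ (fun y => b y v) y :=
    fun v => hbd.clm_apply (differentiableAt_const v)
  have e2 : ∀ v w : EuclideanSpace ℝ (Fin 4),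
      DifferentiableAt ℝ (fun y => fderiv ℝ b y v w) y := fun v w =>
    (hb'd.clm_apply (differentiableAt_const v)).clm_apply (differentiableAt_const w)
  unfold sliceContactVolume
  exact (((e1 _).mul ((e2 _ _).sub (e2 _ _))).sub ((e1 _).mul ((e2 _ _).sub (e2 _ _)))).add
    ((e1 _).mul ((e2 _ _).sub (e2 _ _)))

/-- **`ω ∧ ω ⋔ 0` for the fold model.**  On an open set `O` where `b` is `C^∞` with
`b(e₀) = 0`, `∂₀ b = 0`, at a point `z ∈ O` with `F'(z₀) = 0`: the differential at `z` of the
Pfaffian of `s = d(F(x₀) b)` is `F(z₀) F''(z₀) (b ∧ db)_z(e₁,e₂,e₃) · dx₀`. [folklore] -/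
theorem fderiv_pfaffian_contactFoldForm {F : ℝ → ℝ} (hF : ContDiff ℝ ∞ F)
    {b : EuclideanSpace ℝ (Fin 4) → EuclideanSpace ℝ (Fin 4) →L[ℝ] ℝ}
    {O : Set (EuclideanSpace ℝ (Fin 4))} (hO : IsOpen O) (hb : ContDiffOn ℝ ∞ b O)
    (hb0 : ∀ y ∈ O, b y (stdVec 0) = 0) (hb1 : ∀ y ∈ O, fderiv ℝ b y (stdVec 0) = 0)
    {z : EuclideanSpace ℝ (Fin 4)} (hz : z ∈ O) (hcrit : deriv F (z 0) = 0) :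
    fderiv ℝ (fun y => pfaffian (contactFoldForm F b y)) z =
      (sliceContactVolume (b z) (fderiv ℝ b z) * (F (z 0) * deriv (deriv F) (z 0))) •
        (EuclideanSpace.proj (0 : Fin 4) : EuclideanSpace ℝ (Fin 4) →L[ℝ] ℝ) := by
  have hFd : Differentiable ℝ F := hF.differentiable (by simp)
  have hF'c : ContDiff ℝ ∞ (deriv F) := hF.iterate_deriv 1
  have hF'd : Differentiable ℝ (deriv F) := hF'c.differentiable (by simp)
  have hbd : DifferentiableOn ℝ b O := hb.differentiableOn (by simp)
  -- replace the Pfaffian by its closed formula near `z`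
  have hev : (fun y => pfaffian (contactFoldForm F b y)) =ᶠ[𝓝 z]
      fun y => F (y 0) * deriv F (y 0) * sliceContactVolume (b y) (fderiv ℝ b y) :=
    Filter.eventuallyEq_of_mem (hO.mem_nhds hz)
      (pfaffian_contactFoldForm_eqOn hFd hO hbd hb0 hb1)
  rw [hev.fderiv_eq]
  -- the scalar prefactor `G(y₀) = F(y₀) F'(y₀)` vanishes at `z` with derivative `F F'' dx₀`
  have hG : HasDerivAt (fun t => F t * deriv F t)
      (deriv F (z 0) * deriv F (z 0) + F (z 0) * deriv (deriv F) (z 0)) (z 0) :=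
    (hFd (z 0)).hasDerivAt.mul (hF'd (z 0)).hasDerivAt
  have hg : HasFDerivAt (fun y : EuclideanSpace ℝ (Fin 4) => F (y 0) * deriv F (y 0))
      ((F (z 0) * deriv (deriv F) (z 0)) •
        (EuclideanSpace.proj (0 : Fin 4) : EuclideanSpace ℝ (Fin 4) →L[ℝ] ℝ)) z := by
    have h := hG.comp_hasFDerivAt z (hasStrictFDerivAt_coord 0 z).hasFDerivAt
    rw [hcrit, zero_mul, zero_add] at h
    exact h
  have hh := (differentiableAt_sliceContactVolume hO hb hz).hasFDerivAt
  have hprod : HasFDerivAt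
      (fun y : EuclideanSpace ℝ (Fin 4) =>
        F (y 0) * deriv F (y 0) * sliceContactVolume (b y) (fderiv ℝ b y))
      ((F (z 0) * deriv F (z 0)) •
          fderiv ℝ (fun y => sliceContactVolume (b y) (fderiv ℝ b y)) z +
        sliceContactVolume (b z) (fderiv ℝ b z) •
          ((F (z 0) * deriv (deriv F) (z 0)) •
            (EuclideanSpace.proj (0 : Fin 4) : EuclideanSpace ℝ (Fin 4) →L[ℝ] ℝ))) z :=
    hg.mul hh
  rw [hprod.fderiv, hcrit, mul_zero, zero_smul, zero_add, smul_smul]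

/-- **Def. 1 at a fold point of the contact-type fold model** (in the identity chart of `ℝ⁴`).
Under the hypotheses of `fderiv_pfaffian_contactFoldForm` and `F(z₀) F''(z₀) (b∧db)_z ≠ 0`:
`z` is a fold point, the chart Pfaffian has non-zero differential at `z`, and the kernel vector
`e₀` is transverse to the fold.  This is the pointwise computation behind "doubles of symplectic
manifolds with `ω`-convex boundary are folded symplectic" (source, §2) in Baykur's local model
`d((t² + 1) π^*α)` on `[-1, 1] × H` (Baykur 2006, Def. 2 and proof of Thm. 6.1).
[cite: Cannasdasilva2010, §2] -/
theorem contactFoldForm_def_one_at {F : ℝ → ℝ} (hF : ContDiff ℝ ∞ F)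
    {b : EuclideanSpace ℝ (Fin 4) → EuclideanSpace ℝ (Fin 4) →L[ℝ] ℝ}
    {O : Set (EuclideanSpace ℝ (Fin 4))} (hO : IsOpen O) (hb : ContDiffOn ℝ ∞ b O)
    (hb0 : ∀ y ∈ O, b y (stdVec 0) = 0) (hb1 : ∀ y ∈ O, fderiv ℝ b y (stdVec 0) = 0)
    {z : EuclideanSpace ℝ (Fin 4)} (hz : z ∈ O) (hcrit : deriv F (z 0) = 0)
    (hFz : F (z 0) ≠ 0) (hF2 : deriv (deriv F) (z 0) ≠ 0)
    (hvol : sliceContactVolume (b z) (fderiv ℝ b z) ≠ 0) :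
    z ∈ fold (contactFoldForm F b) ∧
    fderiv ℝ (fun y => pfaffian ((contactFoldForm F b).inChart z y))
        (extChartAt (𝓡 4) z z) ≠ 0 ∧
    ((∀ w, contactFoldForm F b z ![stdVec 0, w] = 0) ∧
      fderiv ℝ (fun y => pfaffian ((contactFoldForm F b).inChart z y))
        (extChartAt (𝓡 4) z z) (stdVec 0) ≠ 0) := by
  have hFd : Differentiable ℝ F := hF.differentiable (by simp)
  have hbd : DifferentiableOn ℝ b O := hb.differentiableOn (by simp)
  have hbz : HasFDerivAt b (fderiv ℝ b z) z :=
    ((hbd z hz).differentiableAt (hO.mem_nhds hz)).hasFDerivAt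
  have hb'1 := fderiv_apply_stdVec_zero_eq_zero hO hbd hb0 hz
  have hchart : (contactFoldForm F b).inChart z = contactFoldForm F b :=
    MForm.inChart_model (contactFoldForm F b) z
  have hc : extChartAt (𝓡 4) z z = z := by simp
  have hD := fderiv_pfaffian_contactFoldForm hF hO hb hb0 hb1 hz hcrit
  have hscal : sliceContactVolume (b z) (fderiv ℝ b z) *
      (F (z 0) * deriv (deriv F) (z 0)) ≠ 0 :=
    mul_ne_zero hvol (mul_ne_zero hFz hF2)
  have hproj : (EuclideanSpace.proj (0 : Fin 4) : EuclideanSpace ℝ (Fin 4) →L[ℝ] ℝ)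
      (stdVec 0) = 1 := by
    show (stdVec 0 : EuclideanSpace ℝ (Fin 4)) 0 = 1
    simp [stdVec_apply]
  refine ⟨?_, ?_, ?_, ?_⟩
  · rw [mem_fold_iff_pfaffian_eq_zero,
      pfaffian_contactFoldForm (hFd (z 0)).hasDerivAt hbz (hb0 z hz) (hb1 z hz) hb'1, hcrit]
    ring
  · rw [hchart, hc, hD]
    intro h0
    have h1 := DFunLike.congr_fun h0 (stdVec 0)
    apply hscal
    simpa [hproj] using h1
  · intro w
    rw [contactFoldForm_stdVec_zero (hFd (z 0)).hasDerivAt hbz (hb0 z hz) (hb1 z hz) hb'1,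
      hcrit, zero_mul]
  · rw [hchart, hc, hD]
    simpa [hproj] using hscal

/-! #### The global fold model and Baykur's model `d((t² + 1) π^*α)` -/

/-- The primitive `λ = F(x₀) b` is `C^∞` when `F` and `b` are. [folklore] -/
theorem contDiff_foldPrimitive {F : ℝ → ℝ} (hF : ContDiff ℝ ∞ F)
    {b : EuclideanSpace ℝ (Fin 4) → EuclideanSpace ℝ (Fin 4) →L[ℝ] ℝ} (hb : ContDiff ℝ ∞ b) :
    ContDiff ℝ ∞ (foldPrimitive F b) := by
  have h1 : ContDiff ℝ ∞ fun y : EuclideanSpace ℝ (Fin 4) => F (y 0) :=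
    hF.comp (contDiff_piLp_apply (p := 2) (i := (0 : Fin 4)))
  exact h1.smul (covectorToOneForm.toContinuousLinearEquiv.contDiff.comp hb)

/-- **The contact-type fold model is a smooth form** (for `C^∞` data). [folklore] -/
theorem isSmoothForm_contactFoldForm {F : ℝ → ℝ} (hF : ContDiff ℝ ∞ F)
    {b : EuclideanSpace ℝ (Fin 4) → EuclideanSpace ℝ (Fin 4) →L[ℝ] ℝ} (hb : ContDiff ℝ ∞ b) :
    IsSmoothForm (contactFoldForm F b) := by
  have hlam := contDiff_foldPrimitive hF hb
  have hs : ContDiff ℝ ∞ fun x => extDeriv (foldPrimitive F b) x := by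
    have h1 : ContDiff ℝ ∞ (fderiv ℝ (foldPrimitive F b)) := (contDiff_infty_iff_fderiv.1 hlam).2
    have h2 : ContDiff ℝ ∞
        (⇑(ContinuousAlternatingMap.alternatizeUncurryFinCLM ℝ (EuclideanSpace ℝ (Fin 4)) ℝ
            (n := 1)) ∘ fderiv ℝ (foldPrimitive F b)) :=
      (ContinuousAlternatingMap.alternatizeUncurryFinCLM ℝ (EuclideanSpace ℝ (Fin 4))
        ℝ (n := 1)).contDiff.comp h1
    have h3 : (fun x => extDeriv (foldPrimitive F b) x) =
        ⇑(ContinuousAlternatingMap.alternatizeUncurryFinCLM ℝ (EuclideanSpace ℝ (Fin 4)) ℝ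
            (n := 1)) ∘ fderiv ℝ (foldPrimitive F b) := by
      funext x
      simp [extDeriv]
    rw [h3]
    exact h2
  intro x
  exact (MForm.smoothAt_model_iff (contactFoldForm F b) x).2 hs.contDiffAt

/-- **The contact-type fold model is closed**: `s = dλ`, `d ∘ d = 0`. [folklore] -/
theorem isClosedForm_contactFoldForm {F : ℝ → ℝ} (hF : ContDiff ℝ ∞ F)
    {b : EuclideanSpace ℝ (Fin 4) → EuclideanSpace ℝ (Fin 4) →L[ℝ] ℝ} (hb : ContDiff ℝ ∞ b) :
    IsClosedForm (contactFoldForm F b) := by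
  unfold IsClosedForm
  funext x
  rw [mextDeriv_eq_extDeriv]
  have h := extDeriv_extDeriv (contDiff_foldPrimitive hF hb) (r := ∞) minSmoothness_two_le_infty
  exact congrFun h x

/-- **The fold of the global model** is `{F'(x₀) = 0}` when `F ≠ 0` and the slice form is
contact. [folklore] -/
theorem mem_fold_contactFoldForm_iff {F : ℝ → ℝ} (hF : ContDiff ℝ ∞ F)
    {b : EuclideanSpace ℝ (Fin 4) → EuclideanSpace ℝ (Fin 4) →L[ℝ] ℝ} (hb : ContDiff ℝ ∞ b)
    (hb0 : ∀ y, b y (stdVec 0) = 0) (hb1 : ∀ y, fderiv ℝ b y (stdVec 0) = 0)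
    (hFne : ∀ t, F t ≠ 0) (hvol : ∀ y, sliceContactVolume (b y) (fderiv ℝ b y) ≠ 0)
    (x : EuclideanSpace ℝ (Fin 4)) :
    x ∈ fold (contactFoldForm F b) ↔ deriv F (x 0) = 0 := by
  have hFd : Differentiable ℝ F := hF.differentiable (by simp)
  have hbd : DifferentiableOn ℝ b univ := (hb.differentiable (by simp)).differentiableOn
  have hPf := pfaffian_contactFoldForm_eqOn hFd isOpen_univ hbd (fun y _ => hb0 y)
    (fun y _ => hb1 y) (mem_univ x)
  simp only at hPf
  rw [mem_fold_iff_pfaffian_eq_zero, hPf]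
  constructor
  · intro h
    rcases mul_eq_zero.1 h with h | h
    · rcases mul_eq_zero.1 h with h | h
      · exact absurd h (hFne _)
      · exact h
    · exact absurd h (hvol x)
  · intro h
    rw [h]
    ring

/-- **The global contact-type fold model is a folded symplectic form** (tree vocabulary): for
`C^∞` data with `b(e₀) = 0`, `∂₀ b = 0`, `F ≠ 0`, `F' = 0 ⇒ F'' ≠ 0` and `b ∧ db ≠ 0` on the
slices, `s = d(F(x₀) b)` on `ℝ⁴` is folded with folding hypersurface its fold `{F'(x₀) = 0}`
(an embedded `3`-manifold, `exists_isFoldedForm_of_transverse`). [cite: Cannasdasilva2010, §2] -/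
theorem exists_isFoldedForm_contactFoldForm {F : ℝ → ℝ} (hF : ContDiff ℝ ∞ F)
    {b : EuclideanSpace ℝ (Fin 4) → EuclideanSpace ℝ (Fin 4) →L[ℝ] ℝ} (hb : ContDiff ℝ ∞ b)
    (hb0 : ∀ y, b y (stdVec 0) = 0) (hb1 : ∀ y, fderiv ℝ b y (stdVec 0) = 0)
    (hFne : ∀ t, F t ≠ 0) (hF2 : ∀ t, deriv F t = 0 → deriv (deriv F) t ≠ 0)
    (hvol : ∀ y, sliceContactVolume (b y) (fderiv ℝ b y) ≠ 0) :
    ∃ (_ : ChartedSpace (EuclideanSpace ℝ (Fin 3)) (fold (contactFoldForm F b)))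
      (_ : IsManifold (𝓡 3) ∞ (fold (contactFoldForm F b))),
      IsFoldedForm (contactFoldForm F b) (fold (contactFoldForm F b)) Subtype.val := by
  have key : ∀ z ∈ fold (contactFoldForm F b),
      z ∈ fold (contactFoldForm F b) ∧
      fderiv ℝ (fun y => pfaffian ((contactFoldForm F b).inChart z y))
          (extChartAt (𝓡 4) z z) ≠ 0 ∧
      ((∀ w, contactFoldForm F b z ![stdVec 0, w] = 0) ∧
        fderiv ℝ (fun y => pfaffian ((contactFoldForm F b).inChart z y))
          (extChartAt (𝓡 4) z z) (stdVec 0) ≠ 0) := fun z hz =>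
    contactFoldForm_def_one_at hF isOpen_univ hb.contDiffOn (fun y _ => hb0 y)
      (fun y _ => hb1 y) (mem_univ z)
      ((mem_fold_contactFoldForm_iff hF hb hb0 hb1 hFne hvol z).1 hz) (hFne _)
      (hF2 _ ((mem_fold_contactFoldForm_iff hF hb hb0 hb1 hFne hvol z).1 hz)) (hvol z)
  exact exists_isFoldedForm_of_transverse (isSmoothForm_contactFoldForm hF hb)
    (isClosedForm_contactFoldForm hF hb) (fun z hz => (key z hz).2.1)
    (fun z hz => ⟨stdVec 0, (key z hz).2.2.1, (key z hz).2.2.2⟩)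

/-- The standard contact form of the slices `ℝ³ = {x₀ = c}`: `b = dx₃ + x₁ dx₂`
(`α = dz + x dy` in the coordinates `(x, y, z) = (x₁, x₂, x₃)`), as a covector field on `ℝ⁴`.
[folklore] -/
def stdSliceContactForm (y : EuclideanSpace ℝ (Fin 4)) : EuclideanSpace ℝ (Fin 4) →L[ℝ] ℝ :=
  (EuclideanSpace.proj (3 : Fin 4) : EuclideanSpace ℝ (Fin 4) →L[ℝ] ℝ) +
    y 1 • (EuclideanSpace.proj (2 : Fin 4) : EuclideanSpace ℝ (Fin 4) →L[ℝ] ℝ)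

/-- `(dx₃ + x₁ dx₂)_y (v) = v₃ + y₁ v₂`. [folklore] -/
@[simp]
theorem stdSliceContactForm_apply (y v : EuclideanSpace ℝ (Fin 4)) :
    stdSliceContactForm y v = v 3 + y 1 * v 2 := rfl

/-- `D(dx₃ + x₁ dx₂)_y (v) = v₁ dx₂`. [folklore] -/
theorem hasFDerivAt_stdSliceContactForm (y : EuclideanSpace ℝ (Fin 4)) :
    HasFDerivAt stdSliceContactForm
      ((EuclideanSpace.proj (1 : Fin 4) : EuclideanSpace ℝ (Fin 4) →L[ℝ] ℝ).smulRight
        (EuclideanSpace.proj (2 : Fin 4) : EuclideanSpace ℝ (Fin 4) →L[ℝ] ℝ)) y := by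
  show HasFDerivAt (fun y : EuclideanSpace ℝ (Fin 4) =>
    (EuclideanSpace.proj (3 : Fin 4) : EuclideanSpace ℝ (Fin 4) →L[ℝ] ℝ) +
      ((EuclideanSpace.proj (1 : Fin 4) : EuclideanSpace ℝ (Fin 4) →L[ℝ] ℝ).smulRight
        (EuclideanSpace.proj (2 : Fin 4) : EuclideanSpace ℝ (Fin 4) →L[ℝ] ℝ)) y) _ y
  exact (ContinuousLinearMap.hasFDerivAt _).const_add _

/-- `D(dx₃ + x₁ dx₂) = dx₁ ⊗ dx₂`. [folklore] -/
theorem fderiv_stdSliceContactForm (y : EuclideanSpace ℝ (Fin 4)) :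
    fderiv ℝ stdSliceContactForm y =
      ((EuclideanSpace.proj (1 : Fin 4) : EuclideanSpace ℝ (Fin 4) →L[ℝ] ℝ).smulRight
        (EuclideanSpace.proj (2 : Fin 4) : EuclideanSpace ℝ (Fin 4) →L[ℝ] ℝ)) :=
  (hasFDerivAt_stdSliceContactForm y).fderiv

/-- `dx₃ + x₁ dx₂` is `C^∞` in `y`. [folklore] -/
theorem contDiff_stdSliceContactForm : ContDiff ℝ ∞ stdSliceContactForm := by
  show ContDiff ℝ ∞ (fun y : EuclideanSpace ℝ (Fin 4) =>
    (EuclideanSpace.proj (3 : Fin 4) : EuclideanSpace ℝ (Fin 4) →L[ℝ] ℝ) +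
      ((EuclideanSpace.proj (1 : Fin 4) : EuclideanSpace ℝ (Fin 4) →L[ℝ] ℝ).smulRight
        (EuclideanSpace.proj (2 : Fin 4) : EuclideanSpace ℝ (Fin 4) →L[ℝ] ℝ)) y)
  exact contDiff_const.add (ContinuousLinearMap.contDiff _)

/-- `dx₃ + x₁ dx₂` is a contact form on the slices: `(b ∧ db)(e₁, e₂, e₃) = 1`. [folklore] -/
theorem sliceContactVolume_stdSliceContactForm (y : EuclideanSpace ℝ (Fin 4)) :
    sliceContactVolume (stdSliceContactForm y) (fderiv ℝ stdSliceContactForm y) = 1 := by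
  rw [fderiv_stdSliceContactForm]
  simp [sliceContactVolume, stdVec_apply]

/-- **Baykur's fold model `d((x₀² + 1)(dx₃ + x₁ dx₂))` is a folded symplectic form on `ℝ⁴`,
folded along the hyperplane `{x₀ = 0}`** — the local model `([-1, 1] × H, d((t² + 1) π^*α))`
of a (nicely) folded Kähler structure (Baykur 2006, Def. 2; proof of Thm. 6.1: "the folding
operation provides us with the desired local model on `N`"), here with `H = ℝ³` and its
standard contact form `α = dz + x dy`; an instance of "doubles of symplectic manifolds with
`ω`-convex boundary are easy examples of manifolds with folded symplectic forms" (source, §2).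
[cite: Cannasdasilva2010, §2] -/
theorem exists_isFoldedForm_baykurFoldModel :
    fold (contactFoldForm (fun t => t ^ 2 + 1) stdSliceContactForm) =
        {x : EuclideanSpace ℝ (Fin 4) | x 0 = 0} ∧
      ∃ (_ : ChartedSpace (EuclideanSpace ℝ (Fin 3))
          (fold (contactFoldForm (fun t => t ^ 2 + 1) stdSliceContactForm)))
        (_ : IsManifold (𝓡 3) ∞
          (fold (contactFoldForm (fun t => t ^ 2 + 1) stdSliceContactForm))),
        IsFoldedForm (contactFoldForm (fun t => t ^ 2 + 1) stdSliceContactForm)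
          (fold (contactFoldForm (fun t => t ^ 2 + 1) stdSliceContactForm)) Subtype.val := by
  have hF : ContDiff ℝ ∞ fun t : ℝ => t ^ 2 + 1 := (contDiff_id.pow 2).add contDiff_const
  have hF' : deriv (fun t : ℝ => t ^ 2 + 1) = fun t => 2 * t := by
    funext t
    have h : HasDerivAt (fun t : ℝ => t ^ 2 + 1) (2 * t) t := by
      simpa using ((hasDerivAt_id t).pow 2).add_const 1
    exact h.deriv
  have hF'' : deriv (deriv fun t : ℝ => t ^ 2 + 1) = fun _ => 2 := by
    rw [hF']
    funext t
    have h : HasDerivAt (fun t : ℝ => 2 * t) 2 t := by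
      simpa using (hasDerivAt_id t).const_mul (2 : ℝ)
    exact h.deriv
  have hb0 : ∀ y, stdSliceContactForm y (stdVec 0) = 0 := fun y => by simp [stdVec_apply]
  have hb1 : ∀ y, fderiv ℝ stdSliceContactForm y (stdVec 0) = 0 := fun y => by
    rw [fderiv_stdSliceContactForm]
    ext v
    simp [stdVec_apply]
  have hFne : ∀ t : ℝ, t ^ 2 + 1 ≠ 0 := fun t => by positivity
  have hF2 : ∀ t : ℝ, deriv (fun t : ℝ => t ^ 2 + 1) t = 0 →
      deriv (deriv fun t : ℝ => t ^ 2 + 1) t ≠ 0 := fun t _ => by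
    rw [hF'']
    norm_num
  have hvol : ∀ y, sliceContactVolume (stdSliceContactForm y)
      (fderiv ℝ stdSliceContactForm y) ≠ 0 := fun y => by
    rw [sliceContactVolume_stdSliceContactForm]
    exact one_ne_zero
  refine ⟨?_, exists_isFoldedForm_contactFoldForm hF contDiff_stdSliceContactForm hb0 hb1 hFne
    hF2 hvol⟩
  ext x
  rw [mem_fold_contactFoldForm_iff hF contDiff_stdSliceContactForm hb0 hb1 hFne hvol, hF']
  simp

end ContactFoldModel

/-! ### Def. 1 pulls back along local diffeomorphisms (germ form); transport along
diffeomorphisms -/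

section DefOnePullback

variable {M : Type*} [TopologicalSpace M] [ChartedSpace (EuclideanSpace ℝ (Fin 4)) M]
  {X : Type*} [TopologicalSpace X] [ChartedSpace (EuclideanSpace ℝ (Fin 4)) X]

/-- Chart representatives at `z` of two forms that agree near `z` agree near the centre.
[folklore] -/
theorem inChart_congr_of_eventuallyEq {k : ℕ} {s s' : MForm (𝓡 4) M ℝ k} {z : M}
    (h : ∀ᶠ x in 𝓝 z, s x = s' x) :
    s.inChart z =ᶠ[𝓝 (extChartAt (𝓡 4) z z)] s'.inChart z := by
  have hz : (extChartAt (𝓡 4) z).symm (extChartAt (𝓡 4) z z) = z := extChartAt_to_inv z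
  have h' : ∀ᶠ x in 𝓝 ((extChartAt (𝓡 4) z).symm (extChartAt (𝓡 4) z z)), s x = s' x := by
    rwa [hz]
  filter_upwards [(continuousAt_extChartAt_symm z).eventually h'] with y hy
  show (s ((extChartAt (𝓡 4) z).symm y)).compContinuousLinearMap _ =
    (s' ((extChartAt (𝓡 4) z).symm y)).compContinuousLinearMap _
  rw [hy]

/-- The determinant of a differentiable family of `4 × 4` matrices is differentiable (Leibniz
formula). [folklore] -/
theorem differentiableAt_matrix_det_fin_four
    {A : EuclideanSpace ℝ (Fin 4) → Matrix (Fin 4) (Fin 4) ℝ} {y : EuclideanSpace ℝ (Fin 4)}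
    (hA : ∀ i j, DifferentiableAt ℝ (fun z => A z i j) y) :
    DifferentiableAt ℝ (fun z => (A z).det) y := by
  simp only [Matrix.det_apply, Units.smul_def, zsmul_eq_mul]
  refine DifferentiableAt.fun_sum fun σ _ => ?_
  refine DifferentiableAt.const_mul ?_ _
  exact (HasFDerivAt.finsetProd (fun i _ => (hA (σ i) i).hasFDerivAt)).differentiableAt

/-- The Jacobian determinant `y ↦ det (Dg y)` of a map `C^∞` at `c` is differentiable at `c`.
[folklore] -/
theorem differentiableAt_det_fderiv {g : EuclideanSpace ℝ (Fin 4) → EuclideanSpace ℝ (Fin 4)}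
    {c : EuclideanSpace ℝ (Fin 4)} (hg : ContDiffAt ℝ ∞ g c) :
    DifferentiableAt ℝ (fun y => LinearMap.det (fderiv ℝ g y :
      (EuclideanSpace ℝ (Fin 4)) →ₗ[ℝ] EuclideanSpace ℝ (Fin 4))) c := by
  have hfun : (fun y => LinearMap.det (fderiv ℝ g y :
      (EuclideanSpace ℝ (Fin 4)) →ₗ[ℝ] EuclideanSpace ℝ (Fin 4))) =
      fun y => (Matrix.of fun i j => fderiv ℝ g y (stdVec j) i).det :=
    funext fun y => linearMap_det_eq_det_coords _
  rw [hfun]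
  have hD : DifferentiableAt ℝ (fderiv ℝ g) c :=
    (hg.fderiv_right (m := ∞) (by simp)).differentiableAt (by simp)
  refine differentiableAt_matrix_det_fin_four fun i j => ?_
  have h1 : DifferentiableAt ℝ (fun y => fderiv ℝ g y (stdVec j)) c :=
    hD.clm_apply (differentiableAt_const _)
  exact ((EuclideanSpace.proj i : EuclideanSpace ℝ (Fin 4) →L[ℝ] ℝ).differentiableAt).comp c h1

variable [IsManifold (𝓡 4) ∞ M] [IsManifold (𝓡 4) ∞ X]

/-- **The clauses of Def. 1 at a point pull back along a local diffeomorphism** (germ form).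
Let `t` be a `2`-form on `X` smooth at `f z`, `f : M → X` differentiable near `z` and `C^∞` at
`z` with `df_z` bijective, and `s` a `2`-form on `M` that agrees with `f^*t` near `z`.  If `f z`
is a fold point of `t` and some kernel vector `v'` of `t_{f z}` has `d(Pf)(v') ≠ 0` (so that the
chart Pfaffian of `t` has non-zero differential at `f z`), then `z` is a fold point of `s`, the
chart Pfaffian of `s` has non-zero differential at `z`, and the kernel vector `v = df_z⁻¹ v'` of
`s_z` has `d(Pf)(v) ≠ 0`: in the preferred charts `Pf(f^*t) = det(Dg) · (Pf(t) ∘ g)`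
(`pfaffian_inChart_pullback_eventuallyEq`), the second factor vanishes at the centre, so the
differential there is `det(Dg(c)) · d(Pf(t)) ∘ Dg(c)` with `det(Dg(c)) ≠ 0`.  (With
`exists_isFoldedForm_iff` this transports folded symplectic forms along diffeomorphisms, and it
lets Def. 1 be checked in any chart of the maximal atlas.)
[cite: Cannasdasilva2010, Def. 1 (§2)] -/
theorem def_one_at_of_pullback {t : MForm (𝓡 4) X ℝ 2} {f : M → X} {z : M}
    (ht : t.SmoothAt (f z)) (hf : ContMDiffAt (𝓡 4) (𝓡 4) ∞ f z)
    (hf' : ∀ᶠ x in 𝓝 z, MDifferentiableAt (𝓡 4) (𝓡 4) f x)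
    (hbij : Bijective (mfderiv (𝓡 4) (𝓡 4) f z))
    {s : MForm (𝓡 4) M ℝ 2} (hs : ∀ᶠ x in 𝓝 z, s x = t.pullback (𝓡 4) f x)
    (hfold : f z ∈ fold t)
    {v' : TangentSpace (𝓡 4) (f z)} (hv'k : ∀ w, t (f z) ![v', w] = 0)
    (hv't : fderiv ℝ (fun y => pfaffian (t.inChart (f z) y))
      (extChartAt (𝓡 4) (f z) (f z)) v' ≠ 0) :
    z ∈ fold s ∧
    fderiv ℝ (fun y => pfaffian (s.inChart z y)) (extChartAt (𝓡 4) z z) ≠ 0 ∧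
    ∃ v : TangentSpace (𝓡 4) z, (∀ w, s z ![v, w] = 0) ∧
      fderiv ℝ (fun y => pfaffian (s.inChart z y)) (extChartAt (𝓡 4) z z) v ≠ 0 := by
  -- notation
  set c := extChartAt (𝓡 4) z z with hc
  set g := writtenInExtChartAt (𝓡 4) (𝓡 4) z f with hg
  have hsz : s z = t.pullback (𝓡 4) f z := hs.self_of_nhds
  -- `g` is `C^∞` at `c`, `g c` is the centre of the chart at `f z`, `Dg(c) = df_z`
  have hgs : ContDiffAt ℝ ∞ g c := by
    have h2 := (contMDiffAt_iff.1 hf).2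
    rw [ModelWithCorners.Boundaryless.range_eq_univ] at h2
    exact h2.contDiffAt univ_mem
  have hgc : g c = extChartAt (𝓡 4) (f z) (f z) := writtenInExtChartAt_apply_self f z
  have hm : mfderiv (𝓡 4) (𝓡 4) f z = fderiv ℝ g c := by
    rw [(hf.mdifferentiableAt (by simp)).mfderiv, ModelWithCorners.Boundaryless.range_eq_univ,
      fderivWithin_univ]
  -- the kernel vector upstairs
  obtain ⟨v, hv⟩ := hbij.2 v'
  -- `det (Dg c) ≠ 0`
  have hdet : LinearMap.det (fderiv ℝ g c :
      (EuclideanSpace ℝ (Fin 4)) →ₗ[ℝ] EuclideanSpace ℝ (Fin 4)) ≠ 0 := by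
    have hb : Bijective (fderiv ℝ g c) := by rw [← hm]; exact hbij
    have hunit : IsUnit (fderiv ℝ g c :
        (EuclideanSpace ℝ (Fin 4)) →ₗ[ℝ] EuclideanSpace ℝ (Fin 4)) :=
      (LinearMap.isUnit_iff_ker_eq_bot _).2 (LinearMap.ker_eq_bot.2 hb.1)
    exact (LinearMap.isUnit_det _ hunit).ne_zero
  -- the chart Pfaffian of `s` near `c`
  have hev1 : (fun y => pfaffian (s.inChart z y)) =ᶠ[𝓝 c]
      fun y => pfaffian ((t.pullback (𝓡 4) f).inChart z y) :=
    (inChart_congr_of_eventuallyEq hs).fun_comp pfaffian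
  have hev2 := pfaffian_inChart_pullback_eventuallyEq t (x₀ := z) hf'
  have hev := hev1.trans hev2
  -- the factors: `p = Pf(t) ∘ g` differentiable at `c` with `p c = 0`, `u = det Dg`
  -- differentiable at `c`
  have hpd0 : DifferentiableAt ℝ (fun y => pfaffian (t.inChart (f z) y)) (g c) := by
    have h1 : ContDiffWithinAt ℝ ∞ (t.inChart (f z)) univ (g c) := by
      have h := ht
      rw [MForm.SmoothAt] at h
      rwa [ModelWithCorners.Boundaryless.range_eq_univ, ← hgc] at h
    have h2 : DifferentiableAt ℝ (t.inChart (f z)) (g c) :=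
      (h1.contDiffAt univ_mem).differentiableAt (by simp)
    exact (contDiff_pfaffian.differentiable (by simp)).differentiableAt.comp (g c) h2
  have hgd : DifferentiableAt ℝ g c := hgs.differentiableAt (by simp)
  have hpd : DifferentiableAt ℝ (fun y => pfaffian (t.inChart (f z) (g y))) c :=
    hpd0.comp c hgd
  have hp0 : pfaffian (t.inChart (f z) (g c)) = 0 := by
    rw [hgc]
    exact (mem_fold_iff_pfaffian_inChart_self t (f z)).1 hfold
  have hud := differentiableAt_det_fderiv hgs
  -- the differential of the chart Pfaffian of `s` at `c`
  have hD : fderiv ℝ (fun y => pfaffian (s.inChart z y)) c =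
      LinearMap.det (fderiv ℝ g c :
        (EuclideanSpace ℝ (Fin 4)) →ₗ[ℝ] EuclideanSpace ℝ (Fin 4)) •
        (fderiv ℝ (fun y => pfaffian (t.inChart (f z) y)) (g c)).comp (fderiv ℝ g c) := by
    have hcomp : fderiv ℝ (fun y => pfaffian (t.inChart (f z) (g y))) c =
        (fderiv ℝ (fun y => pfaffian (t.inChart (f z) y)) (g c)).comp (fderiv ℝ g c) :=
      fderiv_comp c hpd0 hgd
    rw [hev.fderiv_eq, fderiv_fun_mul hud hpd, hp0, zero_smul, add_zero, hcomp]
  -- the value of that differential on `v` is `det(Dg c) · d(Pf t)(v')`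
  have hval : ∀ (h : fderiv ℝ (fun y => pfaffian (t.inChart (f z) y)) (g c)
      (fderiv ℝ g c v) = 0), False := by
    intro h
    apply hv't
    rw [← hv, hm, ← hgc]
    exact h
  have hv'0 : v' ≠ 0 := by
    intro h
    apply hv't
    rw [h]
    exact map_zero _
  have hv0 : v ≠ 0 := by
    intro h
    apply hv'0
    rw [← hv, h]
    exact map_zero _
  refine ⟨?_, ?_, v, ?_, ?_⟩
  · -- fold point
    rw [mem_fold_iff]
    refine ⟨v, hv0, fun w => ?_⟩
    rw [hsz, pullback_apply_two, hv]
    exact hv'k _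
  · -- transversality
    rw [hD]
    intro h0
    have h1 := DFunLike.congr_fun h0 v
    change LinearMap.det (fderiv ℝ g c :
        (EuclideanSpace ℝ (Fin 4)) →ₗ[ℝ] EuclideanSpace ℝ (Fin 4)) *
      fderiv ℝ (fun y => pfaffian (t.inChart (f z) y)) (g c) (fderiv ℝ g c v) = 0 at h1
    rcases mul_eq_zero.1 h1 with h1 | h1
    · exact hdet h1
    · exact hval h1
  · -- kernel vector
    intro w
    rw [hsz, pullback_apply_two, hv]
    exact hv'k _
  · -- transverse kernel vector
    rw [hD]
    change LinearMap.det (fderiv ℝ g c :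
        (EuclideanSpace ℝ (Fin 4)) →ₗ[ℝ] EuclideanSpace ℝ (Fin 4)) *
      fderiv ℝ (fun y => pfaffian (t.inChart (f z) y)) (g c) (fderiv ℝ g c v) ≠ 0
    exact mul_ne_zero hdet fun h => hval h


/-- **Def. 1 may be checked in any chart of the maximal atlas.**  For a chart `φ` of the maximal
`C^∞` atlas at `z` and a `2`-form `t` on `ℝ⁴`, smooth at `φ z`, with `s = φ^*t` near `z`: if
`φ z` is a fold point of `t` with a kernel vector `v'` transverse to the fold
(`d(Pf t)(v') ≠ 0`, Pfaffian read in the preferred (identity) chart of `ℝ⁴`), then the clauses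
of Def. 1 hold for `s` at `z` in the preferred chart (`def_one_at_of_pullback` with `f = φ`).
[cite: Cannasdasilva2010, Def. 1 (§2)] -/
theorem def_one_at_of_chart {s : MForm (𝓡 4) M ℝ 2} {z : M}
    {φ : OpenPartialHomeomorph M (EuclideanSpace ℝ (Fin 4))}
    (hφ : φ ∈ IsManifold.maximalAtlas (𝓡 4) ∞ M) (hz : z ∈ φ.source)
    {t : MForm (𝓡 4) (EuclideanSpace ℝ (Fin 4)) ℝ 2} (ht : t.SmoothAt (φ z))
    (hs : ∀ᶠ x in 𝓝 z, s x = t.pullback (𝓡 4) φ x) (hfold : φ z ∈ fold t)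
    {v' : EuclideanSpace ℝ (Fin 4)} (hv'k : ∀ w, t (φ z) ![v', w] = 0)
    (hv't : fderiv ℝ (fun y => pfaffian (t.inChart (φ z) y))
      (extChartAt (𝓡 4) (φ z) (φ z)) v' ≠ 0) :
    z ∈ fold s ∧
    fderiv ℝ (fun y => pfaffian (s.inChart z y)) (extChartAt (𝓡 4) z z) ≠ 0 ∧
    ∃ v : TangentSpace (𝓡 4) z, (∀ w, s z ![v, w] = 0) ∧
      fderiv ℝ (fun y => pfaffian (s.inChart z y)) (extChartAt (𝓡 4) z z) v ≠ 0 := by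
  have hon : ContMDiffOn (𝓡 4) (𝓡 4) ∞ φ φ.source := contMDiffOn_of_mem_maximalAtlas hφ
  have hnhds : φ.source ∈ 𝓝 z := φ.open_source.mem_nhds hz
  have hf : ContMDiffAt (𝓡 4) (𝓡 4) ∞ φ z := hon.contMDiffAt hnhds
  have hf' : ∀ᶠ x in 𝓝 z, MDifferentiableAt (𝓡 4) (𝓡 4) φ x := by
    filter_upwards [hnhds] with x hx
    exact (hon.contMDiffAt (φ.open_source.mem_nhds hx)).mdifferentiableAt (by simp)
  have hmd : φ.MDifferentiable (𝓡 4) (𝓡 4) :=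
    ⟨hon.mdifferentiableOn (by simp),
      (contMDiffOn_symm_of_mem_maximalAtlas hφ).mdifferentiableOn (by simp)⟩
  have hbij : Bijective (mfderiv (𝓡 4) (𝓡 4) φ z) := hmd.mfderiv_bijective hz
  exact def_one_at_of_pullback ht hf hf' hbij hs hfold hv'k hv't

/-- **Def. 1 is invariant under diffeomorphisms**: the pull-back `Φ^*t` of a `2`-form satisfying
Def. 1 along its fold by a `C^∞` diffeomorphism `Φ : M ≅ X` is smooth, closed, and satisfies
Def. 1 along its fold `Φ⁻¹(fold t)`. [cite: Cannasdasilva2010, Def. 1 (§2)] -/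
theorem def_one_pullback_diffeomorph (Φ : M ≃ₘ⟮𝓡 4, 𝓡 4⟯ X) {t : MForm (𝓡 4) X ℝ 2}
    (hts : IsSmoothForm t) (htc : IsClosedForm t)
    (htmax : ∀ x ∈ fold t, ∃ v : TangentSpace (𝓡 4) x, (∀ w, t x ![v, w] = 0) ∧
      fderiv ℝ (fun y => pfaffian (t.inChart x y)) (extChartAt (𝓡 4) x x) v ≠ 0) :
    IsSmoothForm (t.pullback (𝓡 4) Φ) ∧ IsClosedForm (t.pullback (𝓡 4) Φ) ∧
    (∀ z, z ∈ fold (t.pullback (𝓡 4) Φ) ↔ Φ z ∈ fold t) ∧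
    (∀ z ∈ fold (t.pullback (𝓡 4) Φ),
      fderiv ℝ (fun y => pfaffian ((t.pullback (𝓡 4) Φ).inChart z y))
        (extChartAt (𝓡 4) z z) ≠ 0) ∧
    (∀ z ∈ fold (t.pullback (𝓡 4) Φ), ∃ v : TangentSpace (𝓡 4) z,
      (∀ w, (t.pullback (𝓡 4) Φ) z ![v, w] = 0) ∧
      fderiv ℝ (fun y => pfaffian ((t.pullback (𝓡 4) Φ).inChart z y))
        (extChartAt (𝓡 4) z z) v ≠ 0) := by
  have hΦ : ContMDiff (𝓡 4) (𝓡 4) ∞ Φ := Φ.contMDiff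
  have hbij : ∀ z, Bijective (mfderiv (𝓡 4) (𝓡 4) Φ z) := fun z =>
    (Φ.mfderivToContinuousLinearEquiv (by simp) z).bijective
  have hfold : ∀ z, z ∈ fold (t.pullback (𝓡 4) Φ) ↔ Φ z ∈ fold t := by
    intro z
    constructor
    · intro hz
      by_contra h
      refine not_mem_fold_pullback t Φ h (fun v hv h0 => hv ?_) hz
      exact (hbij z).1 (by rw [h0, map_zero])
    · intro hz
      obtain ⟨v', hv'k, hv't⟩ := htmax _ hz
      exact (def_one_at_of_pullback (hts (Φ z)) (hΦ z)
        (Eventually.of_forall fun x => (hΦ x).mdifferentiableAt (by simp)) (hbij z)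
        (s := t.pullback (𝓡 4) Φ) (Eventually.of_forall fun _ => rfl) hz hv'k hv't).1
  have key : ∀ z ∈ fold (t.pullback (𝓡 4) Φ),
      z ∈ fold (t.pullback (𝓡 4) Φ) ∧
      fderiv ℝ (fun y => pfaffian ((t.pullback (𝓡 4) Φ).inChart z y))
          (extChartAt (𝓡 4) z z) ≠ 0 ∧
      ∃ v : TangentSpace (𝓡 4) z, (∀ w, (t.pullback (𝓡 4) Φ) z ![v, w] = 0) ∧
        fderiv ℝ (fun y => pfaffian ((t.pullback (𝓡 4) Φ).inChart z y))
          (extChartAt (𝓡 4) z z) v ≠ 0 := fun z hz => by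
    obtain ⟨v', hv'k, hv't⟩ := htmax _ ((hfold z).1 hz)
    exact def_one_at_of_pullback (hts (Φ z)) (hΦ z)
      (Eventually.of_forall fun x => (hΦ x).mdifferentiableAt (by simp)) (hbij z)
      (s := t.pullback (𝓡 4) Φ) (Eventually.of_forall fun _ => rfl) ((hfold z).1 hz) hv'k hv't
  refine ⟨Literature.NumberTheory.Transcendental.isSmoothForm_pullback hΦ hts, ?_, hfold,
    fun z hz => (key z hz).2.1, fun z hz => (key z hz).2.2⟩
  have h0 : mextDeriv t = 0 := htc
  rw [IsClosedForm, Literature.NumberTheory.Transcendental.mextDeriv_pullback hΦ hts, h0,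
    MForm.pullback_zero]

/-- **Folded symplectic forms transport along diffeomorphisms**: if `t` is folded on `X` with
some hypersurface datum, then `Φ^*t` is folded on `M ≅ X`, with its own (compact, for `M`
compact) fold as hypersurface datum (`exists_isFoldedForm_iff`, `def_one_pullback_diffeomorph`,
`exists_isFoldedForm_of_transverse'`). [cite: Cannasdasilva2010, Def. 1 (§2)] -/
theorem exists_isFoldedForm_pullback_diffeomorph {M X : Type} [TopologicalSpace M] [T2Space M]
    [CompactSpace M] [ChartedSpace (EuclideanSpace ℝ (Fin 4)) M] [IsManifold (𝓡 4) ∞ M]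
    [TopologicalSpace X] [T2Space X] [ChartedSpace (EuclideanSpace ℝ (Fin 4)) X]
    [IsManifold (𝓡 4) ∞ X] (Φ : M ≃ₘ⟮𝓡 4, 𝓡 4⟯ X) {t : MForm (𝓡 4) X ℝ 2}
    {N : Type} [TopologicalSpace N] [ChartedSpace (EuclideanSpace ℝ (Fin 3)) N]
    [IsManifold (𝓡 3) ∞ N] {j : N → X} (h : IsFoldedForm t N j) :
    ∃ (N' : Type) (_ : TopologicalSpace N') (_ : ChartedSpace (EuclideanSpace ℝ (Fin 3)) N')
      (_ : IsManifold (𝓡 3) ∞ N') (_ : CompactSpace N') (j' : N' → M),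
      IsFoldedForm (t.pullback (𝓡 4) Φ) N' j' := by
  obtain ⟨hts, htc, -, htmax⟩ := (exists_isFoldedForm_iff t).1 ⟨N, inferInstance, inferInstance,
    inferInstance, j, h⟩
  obtain ⟨hs, hc, -, hstr, hsmax⟩ := def_one_pullback_diffeomorph Φ hts htc htmax
  exact exists_isFoldedForm_of_transverse' hs hc hstr hsmax

/-! #### The contact-type fold model in a chart -/

/-- The fold model `d(F(x₀) b)` is smooth at the points of an open set on which `b` is `C^∞`.
[folklore] -/
theorem smoothAt_contactFoldForm {F : ℝ → ℝ} (hF : ContDiff ℝ ∞ F)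
    {b : EuclideanSpace ℝ (Fin 4) → EuclideanSpace ℝ (Fin 4) →L[ℝ] ℝ}
    {O : Set (EuclideanSpace ℝ (Fin 4))} (hO : IsOpen O) (hb : ContDiffOn ℝ ∞ b O)
    {y : EuclideanSpace ℝ (Fin 4)} (hy : y ∈ O) : (contactFoldForm F b).SmoothAt y := by
  have h1 : ContDiff ℝ ∞ fun y : EuclideanSpace ℝ (Fin 4) => F (y 0) :=
    hF.comp (contDiff_piLp_apply (p := 2) (i := (0 : Fin 4)))
  have hlam : ContDiffOn ℝ ∞ (foldPrimitive F b) O :=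
    h1.contDiffOn.smul (covectorToOneForm.toContinuousLinearEquiv.contDiff.comp_contDiffOn hb)
  have h2 : ContDiffOn ℝ ∞ (fderiv ℝ (foldPrimitive F b)) O := hlam.fderiv_of_isOpen hO le_rfl
  have h3 : ContDiffOn ℝ ∞
      (⇑(ContinuousAlternatingMap.alternatizeUncurryFinCLM ℝ (EuclideanSpace ℝ (Fin 4)) ℝ
          (n := 1)) ∘ fderiv ℝ (foldPrimitive F b)) O :=
    (ContinuousAlternatingMap.alternatizeUncurryFinCLM ℝ (EuclideanSpace ℝ (Fin 4))
      ℝ (n := 1)).contDiff.comp_contDiffOn h2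
  have h4 : (fun x => extDeriv (foldPrimitive F b) x) =
      ⇑(ContinuousAlternatingMap.alternatizeUncurryFinCLM ℝ (EuclideanSpace ℝ (Fin 4)) ℝ
          (n := 1)) ∘ fderiv ℝ (foldPrimitive F b) := by
    funext x
    simp [extDeriv]
  refine (MForm.smoothAt_model_iff (contactFoldForm F b) y).2 ?_
  show ContDiffAt ℝ ∞ (fun x => extDeriv (foldPrimitive F b) x) y
  rw [h4]
  exact h3.contDiffAt (hO.mem_nhds hy)

/-- **The contact-type fold model in a chart gives Def. 1.**  Let `φ` be a chart of the
maximal `C^∞` atlas of `M` at `z` in which the `2`-form `s` reads, near `z`, as the fold model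
`d(F(x₀) · b)` (`s = φ^* (contactFoldForm F b)` near `z`) with `b` `C^∞` on an open set
`O ∋ φ z` and pulled back from the slices there (`b(e₀) = 0`, `∂₀ b = 0`), and suppose
`F'((φ z)₀) = 0`, `F((φ z)₀) ≠ 0`, `F''((φ z)₀) ≠ 0`, `(b ∧ db)_{φ z}(e₁,e₂,e₃) ≠ 0`.  Then the
clauses of Def. 1 hold for `s` at `z`: `z` is a fold point, `ω ∧ ω ⋔ 0` there, and a kernel
vector (`dφ_z⁻¹ e₀`) is transverse to the fold.  This is how the seam of a double of an
`ω`-convex symplectic manifold (source, §2), read in bicollar coordinates, is seen to be a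
folding hypersurface. [cite: Cannasdasilva2010, §2 and Def. 1] -/
theorem def_one_at_of_chart_contactFoldForm {s : MForm (𝓡 4) M ℝ 2} {z : M}
    {φ : OpenPartialHomeomorph M (EuclideanSpace ℝ (Fin 4))}
    (hφ : φ ∈ IsManifold.maximalAtlas (𝓡 4) ∞ M) (hz : z ∈ φ.source)
    {F : ℝ → ℝ} (hF : ContDiff ℝ ∞ F)
    {b : EuclideanSpace ℝ (Fin 4) → EuclideanSpace ℝ (Fin 4) →L[ℝ] ℝ}
    {O : Set (EuclideanSpace ℝ (Fin 4))} (hO : IsOpen O) (hb : ContDiffOn ℝ ∞ b O)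
    (hb0 : ∀ y ∈ O, b y (stdVec 0) = 0) (hb1 : ∀ y ∈ O, fderiv ℝ b y (stdVec 0) = 0)
    (hφz : φ z ∈ O) (hs : ∀ᶠ x in 𝓝 z, s x = (contactFoldForm F b).pullback (𝓡 4) φ x)
    (hcrit : deriv F (φ z 0) = 0) (hFz : F (φ z 0) ≠ 0) (hF2 : deriv (deriv F) (φ z 0) ≠ 0)
    (hvol : sliceContactVolume (b (φ z)) (fderiv ℝ b (φ z)) ≠ 0) :
    z ∈ fold s ∧
    fderiv ℝ (fun y => pfaffian (s.inChart z y)) (extChartAt (𝓡 4) z z) ≠ 0 ∧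
    ∃ v : TangentSpace (𝓡 4) z, (∀ w, s z ![v, w] = 0) ∧
      fderiv ℝ (fun y => pfaffian (s.inChart z y)) (extChartAt (𝓡 4) z z) v ≠ 0 := by
  obtain ⟨hfold, -, hker, htr⟩ :=
    contactFoldForm_def_one_at hF hO hb hb0 hb1 hφz hcrit hFz hF2 hvol
  exact def_one_at_of_chart hφ hz (smoothAt_contactFoldForm hF hO hb hφz) hs hfold hker htr

end DefOnePullback

/-! ### Def. 1 depends only on germs: forms defined piecewise

The clauses of Def. 1 at `z` depend only on the germ of the form at `z`; hence a form which
near every point agrees with some form satisfying them there (e.g. a form defined by cases on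
the pieces of a gluing) satisfies them. -/

section Germ

variable {M : Type*} [TopologicalSpace M] [ChartedSpace (EuclideanSpace ℝ (Fin 4)) M]

/-- Smoothness at a point depends only on the germ of the form. [folklore] -/
theorem smoothAt_congr_of_eventuallyEq {k : ℕ} {s s' : MForm (𝓡 4) M ℝ k} {z : M}
    (h : ∀ᶠ x in 𝓝 z, s x = s' x) : s.SmoothAt z ↔ s'.SmoothAt z := by
  have hev := inChart_congr_of_eventuallyEq h
  have hev' : s.inChart z =ᶠ[𝓝[range (𝓡 4)] (extChartAt (𝓡 4) z z)] s'.inChart z :=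
    hev.filter_mono nhdsWithin_le_nhds
  simp only [MForm.SmoothAt]
  exact ⟨fun h1 => h1.congr_of_eventuallyEq hev'.symm hev.self_of_nhds.symm,
    fun h1 => h1.congr_of_eventuallyEq hev' hev.self_of_nhds⟩

/-- The exterior derivative at a point depends only on the germ of the form. [folklore] -/
theorem mextDeriv_congr_of_eventuallyEq {k : ℕ} {s s' : MForm (𝓡 4) M ℝ k} {z : M}
    (h : ∀ᶠ x in 𝓝 z, s x = s' x) : mextDeriv s z = mextDeriv s' z := by
  have hev := inChart_congr_of_eventuallyEq h
  simp only [mextDeriv]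
  rw [(hev.filter_mono nhdsWithin_le_nhds).extDerivWithin_eq hev.self_of_nhds]

/-- Fold membership depends only on the value of the form at the point. [folklore] -/
theorem mem_fold_congr {s s' : MForm (𝓡 4) M ℝ 2} {z : M} (h : s z = s' z) :
    z ∈ fold s ↔ z ∈ fold s' := by
  simp only [mem_fold_iff, h]

/-- The differential of the chart Pfaffian depends only on the germ of the form. [folklore] -/
theorem fderiv_pfaffian_inChart_congr_of_eventuallyEq {s s' : MForm (𝓡 4) M ℝ 2} {z : M}
    (h : ∀ᶠ x in 𝓝 z, s x = s' x) :
    fderiv ℝ (fun y => pfaffian (s.inChart z y)) (extChartAt (𝓡 4) z z) =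
      fderiv ℝ (fun y => pfaffian (s'.inChart z y)) (extChartAt (𝓡 4) z z) :=
  ((inChart_congr_of_eventuallyEq h).fun_comp pfaffian).fderiv_eq

/-- **The clauses of Def. 1 at a point depend only on the germ of the form**: if `s = s'` near
`z` and `s'` satisfies them at `z` (fold point, `ω ∧ ω ⋔ 0`, a transverse kernel vector), so
does `s`. [cite: Cannasdasilva2010, Def. 1 (§2)] -/
theorem def_one_at_congr {s s' : MForm (𝓡 4) M ℝ 2} {z : M} (h : ∀ᶠ x in 𝓝 z, s x = s' x)
    (hfold : z ∈ fold s')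
    (htr : fderiv ℝ (fun y => pfaffian (s'.inChart z y)) (extChartAt (𝓡 4) z z) ≠ 0)
    (hmax : ∃ v : TangentSpace (𝓡 4) z, (∀ w, s' z ![v, w] = 0) ∧
      fderiv ℝ (fun y => pfaffian (s'.inChart z y)) (extChartAt (𝓡 4) z z) v ≠ 0) :
    z ∈ fold s ∧
    fderiv ℝ (fun y => pfaffian (s.inChart z y)) (extChartAt (𝓡 4) z z) ≠ 0 ∧
    ∃ v : TangentSpace (𝓡 4) z, (∀ w, s z ![v, w] = 0) ∧
      fderiv ℝ (fun y => pfaffian (s.inChart z y)) (extChartAt (𝓡 4) z z) v ≠ 0 := by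
  have h0 : s z = s' z := h.self_of_nhds
  have hD := fderiv_pfaffian_inChart_congr_of_eventuallyEq h
  obtain ⟨v, hv, hvt⟩ := hmax
  refine ⟨(mem_fold_congr h0).2 hfold, by rwa [hD], v, fun w => ?_, by rwa [hD]⟩
  rw [h0]
  exact hv w

/-- **A form which near every point agrees with a form smooth there is smooth.** [folklore] -/
theorem isSmoothForm_of_locally {k : ℕ} {s : MForm (𝓡 4) M ℝ k}
    (h : ∀ z, ∃ s' : MForm (𝓡 4) M ℝ k, (∀ᶠ x in 𝓝 z, s x = s' x) ∧ s'.SmoothAt z) :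
    IsSmoothForm s := by
  intro z
  obtain ⟨s', hs', hsm⟩ := h z
  exact (smoothAt_congr_of_eventuallyEq hs').2 hsm

/-- **A form which near every point agrees with a form closed there is closed.** [folklore] -/
theorem isClosedForm_of_locally {k : ℕ} {s : MForm (𝓡 4) M ℝ k}
    (h : ∀ z, ∃ s' : MForm (𝓡 4) M ℝ k, (∀ᶠ x in 𝓝 z, s x = s' x) ∧ mextDeriv s' z = 0) :
    IsClosedForm s := by
  unfold IsClosedForm
  funext z
  obtain ⟨s', hs', hcl⟩ := h z
  rw [mextDeriv_congr_of_eventuallyEq hs', hcl]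
  rfl

/-- **Def. 1 for a form given piecewise**: a `2`-form `s` which near every point `z` agrees with
a `2`-form `s'_z` that is smooth and closed at `z` and, when `z` is a fold point of `s'_z`,
satisfies the pointwise clauses of Def. 1 there, is smooth, closed, and satisfies Def. 1 along
its fold. [cite: Cannasdasilva2010, Def. 1 (§2)] -/
theorem def_one_of_locally {s : MForm (𝓡 4) M ℝ 2}
    (h : ∀ z, ∃ s' : MForm (𝓡 4) M ℝ 2, (∀ᶠ x in 𝓝 z, s x = s' x) ∧ s'.SmoothAt z ∧
      mextDeriv s' z = 0 ∧ (z ∈ fold s' →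
        fderiv ℝ (fun y => pfaffian (s'.inChart z y)) (extChartAt (𝓡 4) z z) ≠ 0 ∧
        ∃ v : TangentSpace (𝓡 4) z, (∀ w, s' z ![v, w] = 0) ∧
          fderiv ℝ (fun y => pfaffian (s'.inChart z y)) (extChartAt (𝓡 4) z z) v ≠ 0)) :
    IsSmoothForm s ∧ IsClosedForm s ∧
    (∀ z ∈ fold s,
      fderiv ℝ (fun y => pfaffian (s.inChart z y)) (extChartAt (𝓡 4) z z) ≠ 0) ∧
    (∀ z ∈ fold s, ∃ v : TangentSpace (𝓡 4) z, (∀ w, s z ![v, w] = 0) ∧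
      fderiv ℝ (fun y => pfaffian (s.inChart z y)) (extChartAt (𝓡 4) z z) v ≠ 0) := by
  have key : ∀ z ∈ fold s,
      z ∈ fold s ∧
      fderiv ℝ (fun y => pfaffian (s.inChart z y)) (extChartAt (𝓡 4) z z) ≠ 0 ∧
      ∃ v : TangentSpace (𝓡 4) z, (∀ w, s z ![v, w] = 0) ∧
        fderiv ℝ (fun y => pfaffian (s.inChart z y)) (extChartAt (𝓡 4) z z) v ≠ 0 := by
    intro z hz
    obtain ⟨s', hs', -, -, hd⟩ := h z
    have hz' : z ∈ fold s' := (mem_fold_congr hs'.self_of_nhds).1 hz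
    obtain ⟨htr, hmax⟩ := hd hz'
    exact def_one_at_congr hs' hz' htr hmax
  refine ⟨isSmoothForm_of_locally fun z => ?_, isClosedForm_of_locally fun z => ?_,
    fun z hz => (key z hz).2.1, fun z hz => (key z hz).2.2⟩
  · obtain ⟨s', hs', hsm, -, -⟩ := h z
    exact ⟨s', hs', hsm⟩
  · obtain ⟨s', hs', -, hcl, -⟩ := h z
    exact ⟨s', hs', hcl⟩

end Germ

/-! ### The general fold model `d(Φ · b)` with a profile depending on all coordinates

For the glue along a seam one meets primitives `Φ(t, h) · β₀(h)` whose profile depends on the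
point of the seam as well (flow of a NORMALISED Liouville field; conformal factor of the seam
absorbed into the profile).  The computation of the previous model goes through unchanged:
with `b` pulled back from the slices, `(dΦ ∧ b)² = 0`, `(db)² = 0` and `dΦ ∧ b ∧ db =
∂₀Φ · (b ∧ db)(e₁,e₂,e₃) · vol`, so `Pf(d(Φ b)) = Φ · ∂₀Φ · (b ∧ db)(e₁,e₂,e₃)`, the fold is
`{∂₀Φ = 0}`, and at its points `e₀` is a kernel vector with `d(Pf)(e₀) = Φ ∂₀∂₀Φ (b ∧ db)`. -/

section GeneralFoldModel

/-- The `1`-form `λ_x = Φ(x) · b_x` on `ℝ⁴`. [folklore] -/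
def genFoldPrimitive (Φ : EuclideanSpace ℝ (Fin 4) → ℝ)
    (b : EuclideanSpace ℝ (Fin 4) → EuclideanSpace ℝ (Fin 4) →L[ℝ] ℝ) :
    EuclideanSpace ℝ (Fin 4) → (EuclideanSpace ℝ (Fin 4)) [⋀^Fin 1]→L[ℝ] ℝ := fun x =>
  Φ x • covectorToOneForm (b x)

/-- The **general fold model** `s = d(Φ · b)`, a `2`-form on `ℝ⁴`. [folklore] -/
def genContactFoldForm (Φ : EuclideanSpace ℝ (Fin 4) → ℝ)
    (b : EuclideanSpace ℝ (Fin 4) → EuclideanSpace ℝ (Fin 4) →L[ℝ] ℝ) :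
    MForm (𝓡 4) (EuclideanSpace ℝ (Fin 4)) ℝ 2 := fun x =>
  extDeriv (genFoldPrimitive Φ b) x

/-- The model with profile `F(x₀)` is the general model with `Φ = F ∘ x₀`. [folklore] -/
theorem contactFoldForm_eq_genContactFoldForm (F : ℝ → ℝ)
    (b : EuclideanSpace ℝ (Fin 4) → EuclideanSpace ℝ (Fin 4) →L[ℝ] ℝ) :
    contactFoldForm F b = genContactFoldForm (fun x => F (x 0)) b := rfl

/-- `Dλ_x(u) = Φ(x) · Db_x(u) + DΦ_x(u) · b_x`. [folklore] -/
theorem hasFDerivAt_genFoldPrimitive {Φ : EuclideanSpace ℝ (Fin 4) → ℝ}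
    {Φ' : EuclideanSpace ℝ (Fin 4) →L[ℝ] ℝ}
    {b : EuclideanSpace ℝ (Fin 4) → EuclideanSpace ℝ (Fin 4) →L[ℝ] ℝ}
    {b' : EuclideanSpace ℝ (Fin 4) →L[ℝ] EuclideanSpace ℝ (Fin 4) →L[ℝ] ℝ}
    {x : EuclideanSpace ℝ (Fin 4)} (hΦ : HasFDerivAt Φ Φ' x) (hb : HasFDerivAt b b' x) :
    HasFDerivAt (genFoldPrimitive Φ b)
      (Φ x • (covectorToOneForm.toContinuousLinearEquiv :
          (EuclideanSpace ℝ (Fin 4) →L[ℝ] ℝ) →L[ℝ] (EuclideanSpace ℝ (Fin 4)) [⋀^Fin 1]→L[ℝ] ℝ).comp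
            b' +
        Φ'.smulRight (covectorToOneForm (b x))) x :=
  hΦ.smul ((covectorToOneForm.toContinuousLinearEquiv.hasFDerivAt).comp x hb)

/-- **The general fold model on pairs of vectors**:
`s_x(u, v) = Φ(x) (Db_x(u)(v) - Db_x(v)(u)) + DΦ_x(u) b_x(v) - DΦ_x(v) b_x(u)`. [folklore] -/
theorem extDeriv_genFoldPrimitive_apply_two {Φ : EuclideanSpace ℝ (Fin 4) → ℝ}
    {Φ' : EuclideanSpace ℝ (Fin 4) →L[ℝ] ℝ}
    {b : EuclideanSpace ℝ (Fin 4) → EuclideanSpace ℝ (Fin 4) →L[ℝ] ℝ}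
    {b' : EuclideanSpace ℝ (Fin 4) →L[ℝ] EuclideanSpace ℝ (Fin 4) →L[ℝ] ℝ}
    {x : EuclideanSpace ℝ (Fin 4)} (hΦ : HasFDerivAt Φ Φ' x) (hb : HasFDerivAt b b' x)
    (u v : EuclideanSpace ℝ (Fin 4)) :
    extDeriv (genFoldPrimitive Φ b) x ![u, v] =
      Φ x * (b' u v - b' v u) + (Φ' u * b x v - Φ' v * b x u) := by
  rw [extDeriv, (hasFDerivAt_genFoldPrimitive hΦ hb).fderiv,
    ContinuousAlternatingMap.alternatizeUncurryFin_apply]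
  simp [Fin.sum_univ_two, Fin.removeNth]
  ring

/-- **The Pfaffian of the general fold model**: under the pull-back hypotheses on `b`,
`Pf(s_x) = Φ(x) · ∂₀Φ(x) · (b ∧ db)(e₁, e₂, e₃)` — the derivatives of `Φ` along the slices
cancel. [folklore] -/
theorem pfaffian_genContactFoldForm {Φ : EuclideanSpace ℝ (Fin 4) → ℝ}
    {Φ' : EuclideanSpace ℝ (Fin 4) →L[ℝ] ℝ}
    {b : EuclideanSpace ℝ (Fin 4) → EuclideanSpace ℝ (Fin 4) →L[ℝ] ℝ}
    {b' : EuclideanSpace ℝ (Fin 4) →L[ℝ] EuclideanSpace ℝ (Fin 4) →L[ℝ] ℝ}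
    {x : EuclideanSpace ℝ (Fin 4)} (hΦ : HasFDerivAt Φ Φ' x) (hb : HasFDerivAt b b' x)
    (hb0 : b x (stdVec 0) = 0) (hb'0 : b' (stdVec 0) = 0) (hb'1 : ∀ v, b' v (stdVec 0) = 0) :
    pfaffian (genContactFoldForm Φ b x) = Φ x * Φ' (stdVec 0) * sliceContactVolume (b x) b' := by
  show pfaffian (extDeriv (genFoldPrimitive Φ b) x) = _
  simp only [pfaffian, extDeriv_genFoldPrimitive_apply_two hΦ hb, hb0, hb'0, hb'1,
    sliceContactVolume]
  simp
  ring

/-- `s_x(e₀, w) = ∂₀Φ(x) b_x(w)` for the general model (under the pull-back hypotheses on `b`).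
[folklore] -/
theorem genContactFoldForm_stdVec_zero {Φ : EuclideanSpace ℝ (Fin 4) → ℝ}
    {Φ' : EuclideanSpace ℝ (Fin 4) →L[ℝ] ℝ}
    {b : EuclideanSpace ℝ (Fin 4) → EuclideanSpace ℝ (Fin 4) →L[ℝ] ℝ}
    {b' : EuclideanSpace ℝ (Fin 4) →L[ℝ] EuclideanSpace ℝ (Fin 4) →L[ℝ] ℝ}
    {x : EuclideanSpace ℝ (Fin 4)} (hΦ : HasFDerivAt Φ Φ' x) (hb : HasFDerivAt b b' x)
    (hb0 : b x (stdVec 0) = 0) (hb'0 : b' (stdVec 0) = 0) (hb'1 : ∀ v, b' v (stdVec 0) = 0)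
    (w : EuclideanSpace ℝ (Fin 4)) :
    genContactFoldForm Φ b x ![stdVec 0, w] = Φ' (stdVec 0) * b x w := by
  show extDeriv (genFoldPrimitive Φ b) x ![stdVec 0, w] = _
  rw [extDeriv_genFoldPrimitive_apply_two hΦ hb, hb0, hb'0, hb'1]
  simp

/-- The chart Pfaffian of the general model as a function on an open set `O`:
`Pf(s_y) = Φ(y) ∂₀Φ(y) (b ∧ db)_y(e₁,e₂,e₃)`. [folklore] -/
theorem pfaffian_genContactFoldForm_eqOn {Φ : EuclideanSpace ℝ (Fin 4) → ℝ}
    {b : EuclideanSpace ℝ (Fin 4) → EuclideanSpace ℝ (Fin 4) →L[ℝ] ℝ}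
    {O : Set (EuclideanSpace ℝ (Fin 4))} (hO : IsOpen O) (hΦd : DifferentiableOn ℝ Φ O)
    (hbd : DifferentiableOn ℝ b O)
    (hb0 : ∀ y ∈ O, b y (stdVec 0) = 0) (hb1 : ∀ y ∈ O, fderiv ℝ b y (stdVec 0) = 0) :
    EqOn (fun y => pfaffian (genContactFoldForm Φ b y))
      (fun y => Φ y * fderiv ℝ Φ y (stdVec 0) *
        sliceContactVolume (b y) (fderiv ℝ b y)) O := by
  intro y hy
  have hd : HasFDerivAt b (fderiv ℝ b y) y :=
    ((hbd y hy).differentiableAt (hO.mem_nhds hy)).hasFDerivAt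
  have hΦ : HasFDerivAt Φ (fderiv ℝ Φ y) y :=
    ((hΦd y hy).differentiableAt (hO.mem_nhds hy)).hasFDerivAt
  exact pfaffian_genContactFoldForm hΦ hd (hb0 y hy) (hb1 y hy)
    (fderiv_apply_stdVec_zero_eq_zero hO hbd hb0 hy)

/-- **`ω ∧ ω ⋔ 0` for the general model**: at `z ∈ O` with `∂₀Φ(z) = 0` the differential of
the Pfaffian is `Φ(z) (b ∧ db)_z(e₁,e₂,e₃) · d(∂₀Φ)_z`. [folklore] -/
theorem fderiv_pfaffian_genContactFoldForm {Φ : EuclideanSpace ℝ (Fin 4) → ℝ}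
    {b : EuclideanSpace ℝ (Fin 4) → EuclideanSpace ℝ (Fin 4) →L[ℝ] ℝ}
    {O : Set (EuclideanSpace ℝ (Fin 4))} (hO : IsOpen O) (hΦ : ContDiffOn ℝ ∞ Φ O)
    (hb : ContDiffOn ℝ ∞ b O)
    (hb0 : ∀ y ∈ O, b y (stdVec 0) = 0) (hb1 : ∀ y ∈ O, fderiv ℝ b y (stdVec 0) = 0)
    {z : EuclideanSpace ℝ (Fin 4)} (hz : z ∈ O) (hcrit : fderiv ℝ Φ z (stdVec 0) = 0) :
    fderiv ℝ (fun y => pfaffian (genContactFoldForm Φ b y)) z =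
      (Φ z * sliceContactVolume (b z) (fderiv ℝ b z)) •
        fderiv ℝ (fun y => fderiv ℝ Φ y (stdVec 0)) z := by
  have hΦd : DifferentiableOn ℝ Φ O := hΦ.differentiableOn (by simp)
  have hbd : DifferentiableOn ℝ b O := hb.differentiableOn (by simp)
  have hev : (fun y => pfaffian (genContactFoldForm Φ b y)) =ᶠ[𝓝 z]
      fun y => fderiv ℝ Φ y (stdVec 0) *
        (Φ y * sliceContactVolume (b y) (fderiv ℝ b y)) := by
    filter_upwards [Filter.eventuallyEq_of_mem (hO.mem_nhds hz)
      (pfaffian_genContactFoldForm_eqOn hO hΦd hbd hb0 hb1)] with y hy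
    rw [hy]
    ring
  rw [hev.fderiv_eq]
  have hΦA : ContDiffAt ℝ ∞ Φ z := hΦ.contDiffAt (hO.mem_nhds hz)
  have hG : DifferentiableAt ℝ (fun y => fderiv ℝ Φ y (stdVec 0)) z :=
    ((hΦA.fderiv_right (m := ∞) (by simp)).differentiableAt (by simp)).clm_apply
      (differentiableAt_const _)
  have hH : DifferentiableAt ℝ (fun y => Φ y * sliceContactVolume (b y) (fderiv ℝ b y)) z :=
    (hΦA.differentiableAt (by simp)).mul (differentiableAt_sliceContactVolume hO hb hz)
  rw [fderiv_fun_mul hG hH, hcrit, zero_smul, zero_add]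

/-- **Def. 1 at a fold point of the general fold model** (identity chart of `ℝ⁴`): on an open
set `O` where `Φ` and `b` are `C^∞` with `b(e₀) = 0`, `∂₀ b = 0`, at `z ∈ O` with
`∂₀Φ(z) = 0`, `Φ(z) ≠ 0`, `∂₀∂₀Φ(z) ≠ 0`, `(b ∧ db)_z(e₁,e₂,e₃) ≠ 0`: `z` is a fold point of
`s = d(Φ b)`, `ω ∧ ω ⋔ 0` there, and the kernel vector `e₀` is transverse to the fold.
[cite: Cannasdasilva2010, §2 and Def. 1] -/
theorem genContactFoldForm_def_one_at {Φ : EuclideanSpace ℝ (Fin 4) → ℝ}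
    {b : EuclideanSpace ℝ (Fin 4) → EuclideanSpace ℝ (Fin 4) →L[ℝ] ℝ}
    {O : Set (EuclideanSpace ℝ (Fin 4))} (hO : IsOpen O) (hΦ : ContDiffOn ℝ ∞ Φ O)
    (hb : ContDiffOn ℝ ∞ b O)
    (hb0 : ∀ y ∈ O, b y (stdVec 0) = 0) (hb1 : ∀ y ∈ O, fderiv ℝ b y (stdVec 0) = 0)
    {z : EuclideanSpace ℝ (Fin 4)} (hz : z ∈ O) (hcrit : fderiv ℝ Φ z (stdVec 0) = 0)
    (hΦz : Φ z ≠ 0) (hΦ2 : fderiv ℝ (fun y => fderiv ℝ Φ y (stdVec 0)) z (stdVec 0) ≠ 0)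
    (hvol : sliceContactVolume (b z) (fderiv ℝ b z) ≠ 0) :
    z ∈ fold (genContactFoldForm Φ b) ∧
    fderiv ℝ (fun y => pfaffian ((genContactFoldForm Φ b).inChart z y))
        (extChartAt (𝓡 4) z z) ≠ 0 ∧
    ((∀ w, genContactFoldForm Φ b z ![stdVec 0, w] = 0) ∧
      fderiv ℝ (fun y => pfaffian ((genContactFoldForm Φ b).inChart z y))
        (extChartAt (𝓡 4) z z) (stdVec 0) ≠ 0) := by
  have hΦd : DifferentiableOn ℝ Φ O := hΦ.differentiableOn (by simp)
  have hbd : DifferentiableOn ℝ b O := hb.differentiableOn (by simp)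
  have hbz : HasFDerivAt b (fderiv ℝ b z) z :=
    ((hbd z hz).differentiableAt (hO.mem_nhds hz)).hasFDerivAt
  have hΦz' : HasFDerivAt Φ (fderiv ℝ Φ z) z :=
    ((hΦd z hz).differentiableAt (hO.mem_nhds hz)).hasFDerivAt
  have hb'1 := fderiv_apply_stdVec_zero_eq_zero hO hbd hb0 hz
  have hchart : (genContactFoldForm Φ b).inChart z = genContactFoldForm Φ b :=
    MForm.inChart_model (genContactFoldForm Φ b) z
  have hc : extChartAt (𝓡 4) z z = z := by simp
  have hD := fderiv_pfaffian_genContactFoldForm hO hΦ hb hb0 hb1 hz hcrit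
  have hscal : Φ z * sliceContactVolume (b z) (fderiv ℝ b z) ≠ 0 := mul_ne_zero hΦz hvol
  have hval : fderiv ℝ (fun y => pfaffian ((genContactFoldForm Φ b).inChart z y))
      (extChartAt (𝓡 4) z z) (stdVec 0) ≠ 0 := by
    rw [hchart, hc, hD]
    exact mul_ne_zero hscal hΦ2
  refine ⟨?_, ?_, ?_, hval⟩
  · rw [mem_fold_iff_pfaffian_eq_zero,
      pfaffian_genContactFoldForm hΦz' hbz (hb0 z hz) (hb1 z hz) hb'1, hcrit]
    ring
  · intro h0
    apply hval
    rw [h0]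
    rfl
  · intro w
    rw [genContactFoldForm_stdVec_zero hΦz' hbz (hb0 z hz) (hb1 z hz) hb'1, hcrit, zero_mul]

/-- The general fold model is smooth at the points of an open set on which `Φ` and `b` are
`C^∞`. [folklore] -/
theorem smoothAt_genContactFoldForm {Φ : EuclideanSpace ℝ (Fin 4) → ℝ}
    {b : EuclideanSpace ℝ (Fin 4) → EuclideanSpace ℝ (Fin 4) →L[ℝ] ℝ}
    {O : Set (EuclideanSpace ℝ (Fin 4))} (hO : IsOpen O) (hΦ : ContDiffOn ℝ ∞ Φ O)
    (hb : ContDiffOn ℝ ∞ b O) {y : EuclideanSpace ℝ (Fin 4)} (hy : y ∈ O) :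
    (genContactFoldForm Φ b).SmoothAt y := by
  have hlam : ContDiffOn ℝ ∞ (genFoldPrimitive Φ b) O :=
    hΦ.smul (covectorToOneForm.toContinuousLinearEquiv.contDiff.comp_contDiffOn hb)
  have h2 : ContDiffOn ℝ ∞ (fderiv ℝ (genFoldPrimitive Φ b)) O := hlam.fderiv_of_isOpen hO le_rfl
  have h3 : ContDiffOn ℝ ∞
      (⇑(ContinuousAlternatingMap.alternatizeUncurryFinCLM ℝ (EuclideanSpace ℝ (Fin 4)) ℝ
          (n := 1)) ∘ fderiv ℝ (genFoldPrimitive Φ b)) O :=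
    (ContinuousAlternatingMap.alternatizeUncurryFinCLM ℝ (EuclideanSpace ℝ (Fin 4))
      ℝ (n := 1)).contDiff.comp_contDiffOn h2
  have h4 : (fun x => extDeriv (genFoldPrimitive Φ b) x) =
      ⇑(ContinuousAlternatingMap.alternatizeUncurryFinCLM ℝ (EuclideanSpace ℝ (Fin 4)) ℝ
          (n := 1)) ∘ fderiv ℝ (genFoldPrimitive Φ b) := by
    funext x
    simp [extDeriv]
  refine (MForm.smoothAt_model_iff (genContactFoldForm Φ b) y).2 ?_
  show ContDiffAt ℝ ∞ (fun x => extDeriv (genFoldPrimitive Φ b) x) y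
  rw [h4]
  exact h3.contDiffAt (hO.mem_nhds hy)

/-- The general fold model is closed at the points of an open set on which `Φ` and `b` are
`C^∞` (`d ∘ d = 0`, local form `extDeriv_extDeriv_apply`). [folklore] -/
theorem mextDeriv_genContactFoldForm_eq_zero {Φ : EuclideanSpace ℝ (Fin 4) → ℝ}
    {b : EuclideanSpace ℝ (Fin 4) → EuclideanSpace ℝ (Fin 4) →L[ℝ] ℝ}
    {O : Set (EuclideanSpace ℝ (Fin 4))} (hO : IsOpen O) (hΦ : ContDiffOn ℝ ∞ Φ O)
    (hb : ContDiffOn ℝ ∞ b O) {y : EuclideanSpace ℝ (Fin 4)} (hy : y ∈ O) :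
    mextDeriv (genContactFoldForm Φ b) y = 0 := by
  rw [mextDeriv_eq_extDeriv]
  have hlam : ContDiffOn ℝ ∞ (genFoldPrimitive Φ b) O :=
    hΦ.smul (covectorToOneForm.toContinuousLinearEquiv.contDiff.comp_contDiffOn hb)
  exact extDeriv_extDeriv_apply (hlam.contDiffAt (hO.mem_nhds hy)) minSmoothness_two_le_infty

variable {M : Type*} [TopologicalSpace M] [ChartedSpace (EuclideanSpace ℝ (Fin 4)) M]
  [IsManifold (𝓡 4) ∞ M]

/-- **The general fold model in a chart gives Def. 1** (as `def_one_at_of_chart_contactFoldForm`,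
for a profile `Φ` depending on all coordinates): if `s = φ^*(d(Φ b))` near `z` for a chart `φ`
of the maximal atlas, with `Φ`, `b` `C^∞` near `φ z`, `b` pulled back from the slices,
`∂₀Φ(φ z) = 0`, `Φ(φ z) ≠ 0`, `∂₀∂₀Φ(φ z) ≠ 0`, `(b ∧ db)_{φ z} ≠ 0`, then the clauses of
Def. 1 hold for `s` at `z`; moreover `s` is smooth and closed at `z`.
[cite: Cannasdasilva2010, §2 and Def. 1] -/
theorem def_one_at_of_chart_genContactFoldForm {s : MForm (𝓡 4) M ℝ 2} {z : M}
    {φ : OpenPartialHomeomorph M (EuclideanSpace ℝ (Fin 4))}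
    (hφ : φ ∈ IsManifold.maximalAtlas (𝓡 4) ∞ M) (hz : z ∈ φ.source)
    {Φ : EuclideanSpace ℝ (Fin 4) → ℝ}
    {b : EuclideanSpace ℝ (Fin 4) → EuclideanSpace ℝ (Fin 4) →L[ℝ] ℝ}
    {O : Set (EuclideanSpace ℝ (Fin 4))} (hO : IsOpen O) (hΦ : ContDiffOn ℝ ∞ Φ O)
    (hb : ContDiffOn ℝ ∞ b O)
    (hb0 : ∀ y ∈ O, b y (stdVec 0) = 0) (hb1 : ∀ y ∈ O, fderiv ℝ b y (stdVec 0) = 0)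
    (hφz : φ z ∈ O) (hs : ∀ᶠ x in 𝓝 z, s x = (genContactFoldForm Φ b).pullback (𝓡 4) φ x)
    (hcrit : fderiv ℝ Φ (φ z) (stdVec 0) = 0) (hΦz : Φ (φ z) ≠ 0)
    (hΦ2 : fderiv ℝ (fun y => fderiv ℝ Φ y (stdVec 0)) (φ z) (stdVec 0) ≠ 0)
    (hvol : sliceContactVolume (b (φ z)) (fderiv ℝ b (φ z)) ≠ 0) :
    z ∈ fold s ∧
    fderiv ℝ (fun y => pfaffian (s.inChart z y)) (extChartAt (𝓡 4) z z) ≠ 0 ∧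
    ∃ v : TangentSpace (𝓡 4) z, (∀ w, s z ![v, w] = 0) ∧
      fderiv ℝ (fun y => pfaffian (s.inChart z y)) (extChartAt (𝓡 4) z z) v ≠ 0 := by
  obtain ⟨hfold, -, hker, htr⟩ :=
    genContactFoldForm_def_one_at hO hΦ hb hb0 hb1 hφz hcrit hΦz hΦ2 hvol
  exact def_one_at_of_chart hφ hz (smoothAt_genContactFoldForm hO hΦ hb hφz) hs hfold hker htr

end GeneralFoldModel

end Literature.Geometry.Symplectic

end
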